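import Mathlib
import Literature.Analysis.FluidPDE.GaussianWeightedSpace
import Literature.Analysis.FluidPDE.GaussianVortexPlanar
import Literature.Analysis.FluidPDE.GaussianVortexKernelRadial
import Literature.Analysis.FluidPDE.PineauVicolWeightedIdentity
import Mathlib.MeasureTheory.Integral.IntegralEqImproper
import Mathlib.Analysis.SpecialFunctions.Integrals.Basic
import Mathlib.Analysis.SpecialFunctions.Gaussian.GaussianIntegral
import Literature.Analysis.FluidPDE.NSFourierWeights
import HarnessLib

/-!
# Arnold coercivity of the Gaussian vortex (Gallay–Šverák 2021 Thm 2.5), file 1 of 3: class-closure tools and the mode-one constrained coercivity in one dimension (re-homed proofs)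

**T. Gallay, V. Šverák, *Arnold's variational principle and its application to the stability of planar vortices*, arXiv:2110.13739
(Anal. PDE, 2024), Theorem 2.5 with Remark 2.7 and §4.1 (the Gaussian weight) [GallaySverak2021]: Arnold-type coercivity of the
quadratic form of the Oseen (Gaussian) vortex — for continuous, odd densities of Gaussian class with vanishing first moments,
`γ ∫ Φ⁻¹ ω² ≤ ∫ Φ⁻¹ ω² + ∫ ω ψ_ω` with `ψ_ω = (2π)⁻¹ log|·| ∗ ω` and some `γ > 0`.**  The named fact
`Literature.Analysis.FluidPDE.GallaySverak2021_thm25_gaussian` (`ArnoldCoercivityGaussianVortex.lean`) is PROVED in the tree by the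
Navier–Stokes / anomalous-dissipation cells (the angular Fourier splitting `ω = a(r) cos θ + b(r) sin θ + ω_r`, a one-dimensional
constrained coercivity for the `n = ±1` modes, an explicit coercivity for the modes `|n| ≥ 2`, and the logarithmic-potential
toolkit: Green's function, decay, energy identities, Hardy–Wirtinger) — until now Summits-side only (`stub_gallaySverak2021` in
`Summits/NavierStokesRegularity/NavierStokesRegularity/Theorems/FilamentSkeletonRssCoreLinearInvertibilityArnoldGaussian.lean`).
RE-HOMED into `Literature/` by the Hodge foundations lane (`lit-hodgefound`, prover p20, generation 39) as THREE files: verbatim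
DECLARATION-LEVEL ports (the 200 theorems the discharge needs, in dependency order; each Part header lists the declarations of its
source module that are NOT carried) of 33 Summits modules `Summits/NavierStokesRegularity/NavierStokesRegularity/Theorems/FilamentSkeletonRssCoreLinearInvertibility*.lean`
and `Summits/AnomalousDissipation/AnomalousDissipation/Theorems/MarginalStabilityChainStretchedVortexRowsStub*.lean`, namespaces
`Summit.NavierStokesRegularity.NavierStokesRegularity.Theorems{,.…}` → `Literature.Analysis.GaussianVortexArnold{,.…}` and
`Summit.AnomalousDissipation.AnomalousDissipation.Theorems.MarginalStabilityChainStretchedVortexRows` → `Literature.Analysis.GaussianVortexArnold.StretchedVortexRows`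
(a root outside `Literature.Analysis.FluidPDE` on purpose: namespace-prefix resolution would otherwise shadow the cone's lemmas by
same-named `FluidPDE` lemmas); theorems only (kernel path), imports from `Literature/` and Mathlib only; no `sorry`, no new axiom, NO
named fact (D-0026).  PROVENANCE CONVENTION: docstrings byte-for-byte; the cell's cites kept; `[folklore]`-tagged and untagged cell
lemmas carry the Part's tag `[cite: GallaySverak2021, <loc> (source of the ARGUMENT implemented / context; this declaration is the
cell's own lemma, NOT a printed statement)]`, because the gate does not admit a public Literature theorem without a cite tag.

THIS FILE (1 of 3) ports: FilamentSkeletonRssCoreLinearInvertibilityClassClosureToolsA, MarginalStabilityChainStretchedVortexRowsStubCellSolvabilityTools, FilamentSkeletonRssCoreLinearInvertibilityClassClosureToolsB, FilamentSkeletonRssCoreLinearInvertibilityOddArnoldToolsA, FilamentSkeletonRssCoreLinearInvertibilityArnoldModeOne1DKernel, FilamentSkeletonRssCoreLinearInvertibilityArnoldModeOne1DFunctionals, FilamentSkeletonRssCoreLinearInvertibilityArnoldModeOne1DEnergy, FilamentSkeletonRssCoreLinearInvertibilityArnoldModeOne1DNeutral, FilamentSkeletonRssCoreLinearInvertibilityArnoldModeOne1DDeflation,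 FilamentSkeletonRssCoreLinearInvertibilityArnoldModeOne1D.
-/

noncomputable section

/-!
## Part 1 — port of `Summits/NavierStokesRegularity/NavierStokesRegularity/Theorems/FilamentSkeletonRssCoreLinearInvertibilityClassClosureToolsA.lean` (3 declarations kept)

# Tools for stub `stub_classClosure` (crux `CoreLinearInvertibility`, stmt-NavierStokesRegularity-17973,
# route `FilamentSkeletonRss`, line `Sketch`) — part A: weighted `L²` convergence

The class-closure stub transports the a-priori bound `c²‖w‖²_{X_λ} ≤ ‖T w‖²_{X_λ}` from `C²_c`
zero-moment vorticities to the maximal-domain class; all it needs is a sequence of `C²_c`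
approximants whose two squared weighted norms converge. This file supplies the measure-theoretic
part, for the weight `g = G_λ⁻¹`, `G_λ = gaussWeightLam λ` (Gallay–Maekawa's `X_λ = L²(∞;λ)`):

* a weighted Cauchy–Schwarz inequality `|∫ g a b| ≤ (∫ g a²)^{1/2} (∫ g b²)^{1/2}` and its
  consequence: `∫ g (F_k − f)² → 0` implies `∫ g F_k² → ∫ g f²` (`tendsto_integral_weight_mul_sq`);
* "`φ_k → 0` in `X_λ`" as the conjunction `X φ` of measurability, `G_λ⁻¹ φ_k² ∈ L¹` and
  `∫ G_λ⁻¹ φ_k² → 0` (kept abstract through a section hypothesis `hX`, no new definition), and its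
  closure under sums, constants, scalar sequences tending to zero, domination (dominated
  convergence) and explicit bounds; `tendsto_of_xconv` turns `X (F − f)` into `‖F_k‖² → ‖f‖²`.

References: Th. Gallay, Y. Maekawa, arXiv:1610.08384, §4.1 (4.5)–(4.6) (the space `L²(∞;λ)`);
the estimates are folklore.

Not carried from this source module (not needed by the declarations re-homed here; their consumers are Summits-side): `tendsto_integral_weight_mul_sq`, `xconv_add`, `xconv_const_mul`, `xconv_sub`, `xconv_of_dominated`, `xconv_mul_of_tendsto_zero`, `xconv_of_integral_le`, `tendsto_of_xconv`, `stub_classClosureToolsA`.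
-/

section Part1

namespace Literature.Analysis.GaussianVortexArnold

open _root_.Set _root_.Function _root_.Filter _root_.MeasureTheory _root_.Topology
open Literature.Analysis.FluidPDE
open scoped _root_.InnerProductSpace

/-! ### Weighted Cauchy–Schwarz and convergence of weighted squares -/

section Weighted

variable {α : Type*} [MeasurableSpace α] {μ : Measure α}

/-- Weighted Cauchy–Schwarz: for a weight `g ≥ 0` and `g a², g b² ∈ L¹`, the product `g a b` is
integrable and `|∫ g a b| ≤ (∫ g a²)^{1/2} (∫ g b²)^{1/2}`. [folklore]
[cite: GallaySverak2021, §2 Thm 2.5 with Rem. 2.7 (source of the ARGUMENT implemented; this declaration is the cell’s own lemma, NOT a printed statement)] -/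
theorem abs_integral_weight_mul_mul_le {g a b : α → ℝ} (hg : ∀ x, 0 ≤ g x)
    (hgm : AEStronglyMeasurable g μ) (ham : AEStronglyMeasurable a μ)
    (hbm : AEStronglyMeasurable b μ) (ha : Integrable (fun x => g x * a x ^ 2) μ)
    (hb : Integrable (fun x => g x * b x ^ 2) μ) :
    Integrable (fun x => g x * (a x * b x)) μ ∧
      |∫ x, g x * (a x * b x) ∂μ| ≤
        Real.sqrt (∫ x, g x * a x ^ 2 ∂μ) * Real.sqrt (∫ x, g x * b x ^ 2 ∂μ) := by
  have hint : Integrable (fun x => g x * (a x * b x)) μ := by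
    refine Integrable.mono' ((ha.add hb).div_const 2) (hgm.mul (ham.mul hbm))
      (Eventually.of_forall fun x => ?_)
    rw [Real.norm_eq_abs, abs_mul, abs_of_nonneg (hg x), abs_mul]
    change g x * (|a x| * |b x|) ≤ (g x * a x ^ 2 + g x * b x ^ 2) / 2
    have h0 := hg x
    nlinarith [mul_nonneg h0 (sq_nonneg (|a x| - |b x|)), sq_abs (a x), sq_abs (b x)]
  refine ⟨hint, ?_⟩
  have hsm : AEStronglyMeasurable (fun x => Real.sqrt (g x)) μ :=
    Real.continuous_sqrt.comp_aestronglyMeasurable hgm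
  have hFm : AEStronglyMeasurable (fun x => Real.sqrt (g x) * |a x|) μ :=
    hsm.mul (continuous_abs.comp_aestronglyMeasurable ham)
  have hGm : AEStronglyMeasurable (fun x => Real.sqrt (g x) * |b x|) μ :=
    hsm.mul (continuous_abs.comp_aestronglyMeasurable hbm)
  have hsqa : ∀ x, (Real.sqrt (g x) * |a x|) ^ 2 = g x * a x ^ 2 := fun x => by
    rw [mul_pow, Real.sq_sqrt (hg x), sq_abs]
  have hsqb : ∀ x, (Real.sqrt (g x) * |b x|) ^ 2 = g x * b x ^ 2 := fun x => by
    rw [mul_pow, Real.sq_sqrt (hg x), sq_abs]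
  have hF : MemLp (fun x => Real.sqrt (g x) * |a x|) (ENNReal.ofReal 2) μ := by
    rw [ENNReal.ofReal_ofNat, memLp_two_iff_integrable_sq hFm]
    simp_rw [hsqa]
    exact ha
  have hG : MemLp (fun x => Real.sqrt (g x) * |b x|) (ENNReal.ofReal 2) μ := by
    rw [ENNReal.ofReal_ofNat, memLp_two_iff_integrable_sq hGm]
    simp_rw [hsqb]
    exact hb
  have hCS := integral_mul_le_Lp_mul_Lq_of_nonneg Real.HolderConjugate.two_two
    (Eventually.of_forall fun x => mul_nonneg (Real.sqrt_nonneg _) (abs_nonneg _))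
    (Eventually.of_forall fun x => mul_nonneg (Real.sqrt_nonneg _) (abs_nonneg _)) hF hG
  have h1 : ∀ x, Real.sqrt (g x) * |a x| * (Real.sqrt (g x) * |b x|) = |g x * (a x * b x)| :=
    fun x => by
    rw [abs_mul, abs_mul, abs_of_nonneg (hg x)]
    calc Real.sqrt (g x) * |a x| * (Real.sqrt (g x) * |b x|)
        = (Real.sqrt (g x) * Real.sqrt (g x)) * (|a x| * |b x|) := by ring
      _ = g x * (|a x| * |b x|) := by rw [Real.mul_self_sqrt (hg x)]
  have h2a : ∀ x, (Real.sqrt (g x) * |a x|) ^ (2 : ℝ) = g x * a x ^ 2 := fun x => by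
    rw [Real.rpow_two, hsqa]
  have h2b : ∀ x, (Real.sqrt (g x) * |b x|) ^ (2 : ℝ) = g x * b x ^ 2 := fun x => by
    rw [Real.rpow_two, hsqb]
  simp_rw [h1, h2a, h2b, ← Real.sqrt_eq_rpow] at hCS
  exact (abs_integral_le_integral_abs).trans hCS

end Weighted

/-! ### The weight `g = G_λ⁻¹` and convergence to zero in `X_λ` -/

/-- `G_λ` is continuous. [folklore]
[cite: GallaySverak2021, §2 Thm 2.5 with Rem. 2.7 (source of the ARGUMENT implemented; this declaration is the cell’s own lemma, NOT a printed statement)] -/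
theorem continuous_gaussWeightLam (lam : ℝ) : Continuous (gaussWeightLam lam) := by
  change Continuous fun x : EuclideanSpace ℝ (Fin 2) =>
    (1 - lam) / (4 * Real.pi) * Real.exp (-((1 - lam) / 4 * ‖x‖ ^ 2))
  fun_prop

/-- `G_λ⁻¹` is continuous for `λ < 1`. [folklore]
[cite: GallaySverak2021, §2 Thm 2.5 with Rem. 2.7 (source of the ARGUMENT implemented; this declaration is the cell’s own lemma, NOT a printed statement)] -/
theorem continuous_inv_gaussWeightLam {lam : ℝ} (hlam : lam < 1) :
    Continuous fun x => (gaussWeightLam lam x)⁻¹ :=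
  (continuous_gaussWeightLam lam).inv₀ fun x => (gaussWeightLam_pos hlam x).ne'

section XConvLemmas

/-! Throughout this section `X φ` abbreviates "`φ_k → 0` in `X_λ`": the conjunction of
measurability of every `φ_k`, integrability of `G_λ⁻¹ φ_k²`, and `∫ G_λ⁻¹ φ_k² → 0`
(hypothesis `hX`; instantiate `X` with that conjunction and `hX := fun _ => Iff.rfl`). -/

variable {lam : ℝ} {φ ψ : ℕ → EuclideanSpace ℝ (Fin 2) → ℝ}
  {X : (ℕ → EuclideanSpace ℝ (Fin 2) → ℝ) → Prop}
  (hX : ∀ φ : ℕ → EuclideanSpace ℝ (Fin 2) → ℝ, X φ ↔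
    ((∀ k, AEStronglyMeasurable (φ k) volume) ∧
      (∀ k, Integrable (fun x => (gaussWeightLam lam x)⁻¹ * φ k x ^ 2)) ∧
        Tendsto (fun k => ∫ x, (gaussWeightLam lam x)⁻¹ * φ k x ^ 2) atTop (𝓝 0)))
include hX

end XConvLemmas

end Literature.Analysis.GaussianVortexArnold

end Part1

/-!
## Part 2 — port of `Summits/AnomalousDissipation/AnomalousDissipation/Theorems/MarginalStabilityChainStretchedVortexRowsStubCellSolvabilityTools.lean` (4 declarations kept)

# Tools for the Gallay–Wayne cell operator `Λ_G` (stub `stub_cellSolvability`)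

Helper file for the stub `stub_cellSolvability` of the line `braid-closed-large-circulation-gluing`
(crux stmt-AnomalousDissipation-3009, `MarginalStabilityChain.StretchedVortexRows`). The stub asks
for solutions of the generalised Gallay–Wayne / Maekawa CELL PROBLEM `Λ_G w = g`, where
`Λ_G w = ⟪v^G, ∇w⟫ + ⟪K ∗ w, ∇G⟫` is the linearisation of the transport term at the Gaussian
vortex `G` (Gallay–Wayne 2007, §1; Gallay–Maekawa 2016, §2.1), written pointwise in the
tree vocabulary of `Literature.Analysis.FluidPDE.GaussianVortexPlanar`
(`gaussVortexVelocity = v^G`, `biotSavart2D w = K ∗ w`, `gaussVortexProfile = G`). The radial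
half of the structure (`Λ_G h = 0` for radial `h`, `v^G·∇w = Ω ∂_θ w`) is in the sibling file
`…StubCoreInverseTools` (`lamG_eq_zero_of_radial`; two of its one-line lemmas are re-proved here
as `private` copies so that the files stay independent); this file adds the ANGULAR half that the
Fourier analysis of the cell problem rests on. Everything is proved, nothing is assumed:

* `gradient_gaussVortexProfile`: `∇G(ξ) = −(G(ξ)/2) ξ` (vector form), hence
  `⟪K∗w(ξ), ∇G(ξ)⟫ = −(G(ξ)/2) ⟪K∗w(ξ), ξ⟫` — only the RADIAL velocity of `w` enters `Λ_G`;
* point symmetry: `v^G`, `K_{2D}`, `∇G` are odd, the Biot–Savart velocity and the gradient of an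
  EVEN vorticity are odd (`biotSavart2D_neg_of_even`, `gradient_neg_of_even`), so **`Λ_G` maps even
  functions to even functions** (`stub_cellSolvability_evenness`, registered sub-goal);
* the circle `θ ↦ (r cos θ, r sin θ)` has velocity `ξ_θ^⊥` (`hasDerivAt_toLp_cos_sin`), the chain
  rule `d/dθ w(ξ_θ) = Dw(ξ_θ)[ξ_θ^⊥]`, and therefore **the circle means of the transport term
  vanish**: `∫₀^{2π} ⟪v^G, ∇w⟫(r cos θ, r sin θ) dθ = 0` for every `C¹` function `w`
  (`stub_cellSolvability_transportCircleMean`, registered sub-goal) — the `m = 0` angular mode is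
  invisible to `Λ_G`, which is why the stub's data `g` must have vanishing circle means;
* **`Λ_G` is an exact angular derivative**: if `(K∗w)(ξ) = ∇^⊥Ψ(ξ)` (a stream function) then
  `Λ_G w(ξ) = ⟪ξ^⊥, ∇(Ω w + (G/2) Ψ)(ξ)⟫`, `Ω = (8π)⁻¹φ(|·|²/4)`
  (`stub_cellSolvability_angularPotential`, registered sub-goal): the identity behind the
  mode-wise reduction of `Λ_G w = g` to `im(Ω w_m + (G/2)ψ_m) = g_m`, `Δ_m ψ_m = w_m`, i.e. to the
  Rayleigh-type equation `Δ_m ψ_m + (G/(2Ω)) ψ_m = g_m/(imΩ)` of Gallay–Wayne 2007, proof of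
  Prop. 3.1 (`h = g/(2φ)` there, `m = 2`).

## References

* Th. Gallay, C. E. Wayne, *Existence and stability of asymmetric Burgers vortices*, J. Math.
  Fluid Mech. 9 (2007) 243–261 = arXiv:math/0503353, §1 (definition of `Λ`) and §3, Prop. 3.1.
  [GallayWayne2006]
* Th. Gallay, Y. Maekawa, *Existence and stability of viscous vortices*, arXiv:1610.08384, §2.1
  Observation 3 and §2.2, Lemma 2.7. [GallayMaekawa2016]

Not carried from this source module (not needed by the declarations re-homed here; their consumers are Summits-side): `real_inner_gradient_right`, `real_inner_gradient_left`, `gradient_gaussVortexProfile`, `inner_biotSavart2D_gradient_gaussVortexProfile`, `inner_gaussVortexVelocity_gradient_eq_mul_inner_perp`, `norm_cos_smul_add_sin_smul_perp'`, `fderiv_perp_eq_zero_of_radial'`, `gaussVortexProfile_neg`, `gaussVortexVelocity_neg`, `biotSavartKernel2D_neg`, `gradient_gaussVortexProfile_neg`, `biotSavart2D_neg_of_even`, `fderiv_neg_of_even`, `gradient_neg_of_even`, `stub_cellSolvability_evenness`, `norm_toLp_cos_sin`, `hasDerivAt_comp_toLp_cos_sin`, `stub_cellSolvability_transportCircleMean`,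 `contDiff_gaussAngularVelocity`, `stub_cellSolvability_angularPotential`, `intervalIntegral_cellLam_eq_zero_of_stream`.
-/

section Part2

open scoped _root_.BigOperators _root_.Topology RealInnerProductSpace _root_.ContDiff
open _root_.Filter _root_.Set _root_.Function _root_.MeasureTheory WithLp

namespace Literature.Analysis.GaussianVortexArnold.StretchedVortexRows

open Literature.Analysis.FluidPDE

/-! ### Gradients in the plane -/

/-- The circle point `(r cos θ, r sin θ)` in the standard basis. [folklore]
[cite: GallaySverak2021, §2 and §4.1 (context: potential theory of the planar Biot–Savart / logarithmic potential used in the proof of Thm 2.5; this declaration is the cell’s own lemma, NOT a printed statement)] -/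
theorem toLp_cos_sin_eq (r θ : ℝ) :
    (toLp 2 ![r * Real.cos θ, r * Real.sin θ] : EuclideanSpace ℝ (Fin 2)) =
      (r * Real.cos θ) • EuclideanSpace.single 0 (1 : ℝ) +
        (r * Real.sin θ) • EuclideanSpace.single 1 (1 : ℝ) := by
  ext i
  fin_cases i <;> simp

/-- `(r cos θ, r sin θ)^⊥ = (−r sin θ, r cos θ)` in the standard basis. [folklore]
[cite: GallaySverak2021, §2 and §4.1 (context: potential theory of the planar Biot–Savart / logarithmic potential used in the proof of Thm 2.5; this declaration is the cell’s own lemma, NOT a printed statement)] -/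
theorem perp_toLp_cos_sin_eq (r θ : ℝ) :
    perp (toLp 2 ![r * Real.cos θ, r * Real.sin θ] : EuclideanSpace ℝ (Fin 2)) =
      (-(r * Real.sin θ)) • EuclideanSpace.single 0 (1 : ℝ) +
        (r * Real.cos θ) • EuclideanSpace.single 1 (1 : ℝ) := by
  ext i
  fin_cases i <;> simp [perp]

/-- The circle `θ ↦ (r cos θ, r sin θ)` has velocity `ξ_θ^⊥`. [folklore]
[cite: GallaySverak2021, §2 and §4.1 (context: potential theory of the planar Biot–Savart / logarithmic potential used in the proof of Thm 2.5; this declaration is the cell’s own lemma, NOT a printed statement)] -/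
theorem hasDerivAt_toLp_cos_sin (r θ : ℝ) :
    HasDerivAt (fun θ : ℝ => (toLp 2 ![r * Real.cos θ, r * Real.sin θ] : EuclideanSpace ℝ (Fin 2)))
      (perp (toLp 2 ![r * Real.cos θ, r * Real.sin θ])) θ := by
  rw [perp_toLp_cos_sin_eq]
  have h := (((Real.hasDerivAt_cos θ).const_mul r).smul_const
      (EuclideanSpace.single (0 : Fin 2) (1 : ℝ))).add
    (((Real.hasDerivAt_sin θ).const_mul r).smul_const (EuclideanSpace.single (1 : Fin 2) (1 : ℝ)))
  simp only [mul_neg] at h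
  refine h.congr_of_eventuallyEq (Eventually.of_forall fun t => ?_)
  exact toLp_cos_sin_eq r t

/-- The circle map is continuous in the angle. [folklore]
[cite: GallaySverak2021, §2 and §4.1 (context: potential theory of the planar Biot–Savart / logarithmic potential used in the proof of Thm 2.5; this declaration is the cell’s own lemma, NOT a printed statement)] -/
theorem continuous_toLp_cos_sin (r : ℝ) :
    Continuous fun θ : ℝ => (toLp 2 ![r * Real.cos θ, r * Real.sin θ] : EuclideanSpace ℝ (Fin 2)) :=
  continuous_iff_continuousAt.2 fun θ => (hasDerivAt_toLp_cos_sin r θ).continuousAt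

end Literature.Analysis.GaussianVortexArnold.StretchedVortexRows

end Part2

/-!
## Part 3 — port of `Summits/NavierStokesRegularity/NavierStokesRegularity/Theorems/FilamentSkeletonRssCoreLinearInvertibilityClassClosureToolsB.lean` (4 declarations kept)

# Tools for stub `stub_classClosure` (crux `CoreLinearInvertibility`, stmt-NavierStokesRegularity-17973,
# route `FilamentSkeletonRss`, line `Sketch`) — part B: Gaussian weights and the nonlocal term

Gaussian weight algebra for `G_λ = gaussWeightLam λ = (1−λ)/(4π) e^{−(1−λ)|x|²/4}` and
`G = gaussVortexProfile = G₀`: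

* `G_μ ≤ (1−μ)/(1−ν) G_ν` (`μ ≤ ν < 1`), `|x|² G_μ ≤ 16/(1−μ) G_{(1+μ)/2}` (so `|x|²G_μ ∈ L¹`),
  `G²/G_λ = G_{−λ}/(1−λ²)`;
* `|x_i| w ∈ L¹` for `w ∈ X_λ = L²(G_λ⁻¹dx)` and `X_λ ⊆ L¹ ∩ L²` (tree `MemL2InftyLam.integrable`);
* **the nonlocal term `⟪K∗v, ∇G⟫` in `X_λ`**: with the Young weight `h = G_λ^{-1/2}‖∇G‖`
  (`h² = ¼|x|²G²/G_λ`, bounded, `h² ∈ L¹`) and the tree's Young-type bound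
  `∫ ‖K∗v‖² h² ≤ C(H²∫v² + ‖v‖₁²∫h²)` (`biotSavart2D_mul_sq_integral_le`),
  `∫ G_λ⁻¹ ⟪K∗v, ∇G⟫² ≤ C (∫ v² + ‖v‖₁²)` for every continuous `v ∈ L¹ ∩ L²`.

References: Th. Gallay, C. E. Wayne, J. Math. Fluid Mech. 9 (2007), (1.3) (the kernel `K`);
Th. Gallay, Y. Maekawa, arXiv:1610.08384, §4.1 (4.5)–(4.6); folklore estimates.

Not carried from this source module (not needed by the declarations re-homed here; their consumers are Summits-side): `gaussWeightLam_le_mul`, `inv_gaussWeightLam_mul_sq_gaussVortexProfile`, `inv_gaussWeightLam_mul_inner_gradient_sq_le`, `youngWeight_sq_le`, `exists_inv_gaussWeightLam_mul_inner_biotSavart2D_sq_le`, `stub_classClosureToolsB`.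
-/

section Part3

namespace Literature.Analysis.GaussianVortexArnold

open _root_.Set _root_.Function _root_.Filter _root_.MeasureTheory _root_.Topology
open Literature.Analysis.FluidPDE
open Literature.Analysis.GaussianVortexArnold.StretchedVortexRows
open scoped _root_.InnerProductSpace

/-! ### Gaussian weight algebra -/

section Gauss

/-- Second Gaussian moment, pointwise: `|x|² G_μ(x) ≤ 16/(1−μ) G_{(1+μ)/2}(x)` (`t e^{−t} ≤ 1`).
[folklore]
[cite: GallaySverak2021, §2 Thm 2.5 with Rem. 2.7 (source of the ARGUMENT implemented; this declaration is the cell’s own lemma, NOT a printed statement)] -/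
theorem norm_sq_mul_gaussWeightLam_le {μ : ℝ} (hμ : μ < 1) (x : EuclideanSpace ℝ (Fin 2)) :
    ‖x‖ ^ 2 * gaussWeightLam μ x ≤ 16 / (1 - μ) * gaussWeightLam ((1 + μ) / 2) x := by
  unfold gaussWeightLam
  have h1 : 0 < 1 - μ := by linarith
  set e : ℝ := Real.exp (-((1 - μ) / 8 * ‖x‖ ^ 2)) with he
  have he0 : 0 < e := Real.exp_pos _
  -- `t e^{−(1−μ)t/8} ≤ 8/(1−μ)`
  have hkey : ‖x‖ ^ 2 * e ≤ 8 / (1 - μ) := by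
    have hs : (1 - μ) / 8 * ‖x‖ ^ 2 ≤ Real.exp ((1 - μ) / 8 * ‖x‖ ^ 2) := by
      linarith [Real.add_one_le_exp ((1 - μ) / 8 * ‖x‖ ^ 2)]
    have hE : Real.exp ((1 - μ) / 8 * ‖x‖ ^ 2) * e = 1 := by
      rw [he, ← Real.exp_add, add_neg_cancel, Real.exp_zero]
    have h3 : (1 - μ) / 8 * ‖x‖ ^ 2 * e ≤ 1 := by
      calc (1 - μ) / 8 * ‖x‖ ^ 2 * e ≤ Real.exp ((1 - μ) / 8 * ‖x‖ ^ 2) * e :=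
            mul_le_mul_of_nonneg_right hs he0.le
        _ = 1 := hE
    rw [le_div_iff₀ h1]
    nlinarith
  have hsplit : Real.exp (-((1 - μ) / 4 * ‖x‖ ^ 2)) = e * e := by
    rw [he, ← Real.exp_add]
    congr 1
    ring
  have hr1 : (1 - (1 + μ) / 2) / (4 * Real.pi) = (1 - μ) / (8 * Real.pi) := by ring
  have hr2 : -((1 - (1 + μ) / 2) / 4 * ‖x‖ ^ 2) = -((1 - μ) / 8 * ‖x‖ ^ 2) := by ring
  rw [hr1, hr2, ← he, hsplit]
  have hpi : 0 < Real.pi := Real.pi_pos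
  calc ‖x‖ ^ 2 * ((1 - μ) / (4 * Real.pi) * (e * e))
      = (1 - μ) / (4 * Real.pi) * e * (‖x‖ ^ 2 * e) := by ring
    _ ≤ (1 - μ) / (4 * Real.pi) * e * (8 / (1 - μ)) :=
        mul_le_mul_of_nonneg_left hkey (by positivity)
    _ = 16 / (1 - μ) * ((1 - μ) / (8 * Real.pi) * e) := by
        field_simp
        ring

/-- `|x|² G_μ` is integrable for `μ < 1`. [folklore]
[cite: GallaySverak2021, §2 Thm 2.5 with Rem. 2.7 (source of the ARGUMENT implemented; this declaration is the cell’s own lemma, NOT a printed statement)] -/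
theorem integrable_norm_sq_mul_gaussWeightLam {μ : ℝ} (hμ : μ < 1) :
    Integrable (fun x : EuclideanSpace ℝ (Fin 2) => ‖x‖ ^ 2 * gaussWeightLam μ x) := by
  have hμ' : (1 + μ) / 2 < 1 := by linarith
  refine Integrable.mono' ((integrable_gaussWeightLam hμ').const_mul (16 / (1 - μ)))
    ((continuous_norm.pow 2).mul (continuous_gaussWeightLam μ)).aestronglyMeasurable
    (Eventually.of_forall fun x => ?_)
  rw [Real.norm_of_nonneg (mul_nonneg (sq_nonneg _) (gaussWeightLam_pos hμ x).le)]
  exact norm_sq_mul_gaussWeightLam_le hμ x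

/-- **`|x_i| w ∈ L¹` for `w ∈ X_λ`**: `|x_i w| ≤ ½ (|x|² G_λ + w²/G_λ)`. [folklore]
[cite: GallaySverak2021, §2 Thm 2.5 with Rem. 2.7 (source of the ARGUMENT implemented; this declaration is the cell’s own lemma, NOT a printed statement)] -/
theorem integrable_coord_mul_of_memX {lam : ℝ} (hlam : lam < 1) {w : EuclideanSpace ℝ (Fin 2) → ℝ}
    (hwm : AEStronglyMeasurable w volume)
    (hwX : Integrable (fun x => (gaussWeightLam lam x)⁻¹ * w x ^ 2)) (i : Fin 2) :
    Integrable (fun x : EuclideanSpace ℝ (Fin 2) => x i * w x) := by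
  refine Integrable.mono' (((integrable_norm_sq_mul_gaussWeightLam hlam).add hwX).div_const 2)
    ((PiLp.continuous_apply 2 _ i).aestronglyMeasurable.mul hwm) (Eventually.of_forall fun x => ?_)
  have hG := gaussWeightLam_pos hlam x
  have hxi : |x i| ≤ ‖x‖ := FourierNS.abs_apply_le_norm x i
  rw [Real.norm_eq_abs, abs_mul]
  change |x i| * |w x| ≤ (‖x‖ ^ 2 * gaussWeightLam lam x + (gaussWeightLam lam x)⁻¹ * w x ^ 2) / 2
  rw [le_div_iff₀ (by norm_num : (0 : ℝ) < 2)]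
  have h1 : |x i| * |w x| ≤ ‖x‖ * |w x| := mul_le_mul_of_nonneg_right hxi (abs_nonneg _)
  -- AM–GM: `2‖x‖|w| ≤ ‖x‖² G + w²/G`
  have h2 : ‖x‖ * |w x| * 2 ≤ ‖x‖ ^ 2 * gaussWeightLam lam x + (gaussWeightLam lam x)⁻¹ * w x ^ 2 := by
    have key : ‖x‖ ^ 2 * gaussWeightLam lam x + (gaussWeightLam lam x)⁻¹ * w x ^ 2 - ‖x‖ * |w x| * 2 =
        (gaussWeightLam lam x)⁻¹ * (‖x‖ * gaussWeightLam lam x - |w x|) ^ 2 := by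
      rw [sub_sq, ← sq_abs (w x)] ; field_simp; ring
    have h0 : 0 ≤ (gaussWeightLam lam x)⁻¹ * (‖x‖ * gaussWeightLam lam x - |w x|) ^ 2 := by positivity
    linarith
  linarith

/-- **`X_λ ⊆ L¹ ∩ L²`** in the form used here (tree: `MemL2InftyLam.integrable`,
`MemL2InftyLam.integrable_sq`). [folklore]
[cite: GallaySverak2021, §2 Thm 2.5 with Rem. 2.7 (source of the ARGUMENT implemented; this declaration is the cell’s own lemma, NOT a printed statement)] -/
theorem integrable_and_sq_of_memX {lam : ℝ} (hlam : lam < 1) {w : EuclideanSpace ℝ (Fin 2) → ℝ}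
    (hwm : AEStronglyMeasurable w volume)
    (hwX : Integrable (fun x => (gaussWeightLam lam x)⁻¹ * w x ^ 2)) :
    Integrable w ∧ Integrable (fun x => w x ^ 2) := by
  have hmem : MemL2InftyLam lam w := ⟨hwm, by simpa [div_eq_inv_mul] using hwX⟩
  exact ⟨hmem.integrable hlam, hmem.integrable_sq hlam⟩

end Gauss

/-! ### The nonlocal term in `X_λ` -/

section Young

variable {lam : ℝ}

end Young

end Literature.Analysis.GaussianVortexArnold

end Part3

/-!
## Part 4 — port of `Summits/NavierStokesRegularity/NavierStokesRegularity/Theorems/FilamentSkeletonRssCoreLinearInvertibilityOddArnoldToolsA.lean` (6 declarations kept)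

# Tools for stub `stub_oddSymmetrizerBoundedBelow` (crux `CoreLinearInvertibility`,
# stmt-NavierStokesRegularity-17973, route `FilamentSkeletonRss`, line `Sketch`) — part A:
# the kernel weight `Φ` against the Gaussian weights, and the Gaussian class

Elementary bookkeeping for the transfer of the Gallay–Šverák coercivity of Arnold's quadratic form
(weight `A = 1/Φ`, `Φ = kerWeight`, `Φ(r) = (r²/4)/(e^{r²/4} − 1)`) to the `X_λ = L²(G_λ⁻¹ dx)` bound
of the odd symmetrizer:

* weight comparisons: `Φ⁻¹(r) ≤ e^{r²/4}`, `Φ(r) ≤ (1 + r²/4) e^{−r²/4}`, and for `0 < λ < 1`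
  `Φ(|x|) ≤ (4π/(λ(1−λ))) G_λ(x)` (so `L²(Φ⁻¹) ↪ X_λ` — the place where `λ > 0` is used);
* the GAUSSIAN CLASS `|a(x)| ≤ C (1+|x|)^N e^{−|x|²/4}` (the form printed in the registered stubs):
  nonnegativity of the constant, sums, scalar multiples, compactly supported functions,
  `x_j e^{−|x|²/4}`, `Φ(|x|) p(x)` for polynomially bounded `p`, reduction to a pure Gaussian bound
  `B e^{−|x|²/8}`;
* integrability for a measurable Gaussian-class `a`: `Φ⁻¹ a²`, `G_λ⁻¹ a²` (`0 ≤ λ < 1`), hence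
  `a, x_j a ∈ L¹` (tree: `integrable_and_sq_of_memX`, `integrable_coord_mul_of_memX`).

References: Th. Gallay, V. Šverák, arXiv:2110.13739, §2 (the weight `A`), §4 (4.8) (`A = (eˢ−1)/s`,
`s = r²/4`, for the Gaussian); Th. Gallay, C. E. Wayne, J. Math. Fluid Mech. 9 (2007), proof of
Prop. 3.1 (the weight `h = Φ`). Everything here is folklore calculus.

Not carried from this source module (not needed by the declarations re-homed here; their consumers are Summits-side): `arnold_kerWeight_le`, `arnold_kerWeight_le_mul_gaussWeightLam`, `arnold_inv_gaussWeightLam_le`, `arnold_gc_mono`, `arnold_gc_add`, `arnold_gc_const_mul`, `arnold_gc_neg`, `arnold_gc_of_hasCompactSupport`, `arnold_gc_coord_mul_exp`, `arnold_gc_kerWeight_mul`, `stub_oddArnoldToolsA`.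
-/

section Part4

namespace Literature.Analysis.GaussianVortexArnold

open _root_.Set _root_.Function _root_.Filter _root_.MeasureTheory _root_.Topology _root_.Metric
open Literature.Analysis.FluidPDE

/-! ### The kernel weight against Gaussians -/

/-- `Φ(r)⁻¹ = φ(s) eˢ ≤ eˢ`, `s = r²/4` (`φ = burgersPhi ≤ 1`). [folklore]
[cite: GallaySverak2021, §2 Thm 2.5 with Rem. 2.7 (source of the ARGUMENT implemented; this declaration is the cell’s own lemma, NOT a printed statement)] -/
theorem arnold_inv_kerWeight_le (r : ℝ) : (kerWeight r)⁻¹ ≤ Real.exp (r ^ 2 / 4) := by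
  rw [kerWeight, inv_div, Real.exp_neg, div_inv_eq_mul]
  calc burgersPhi (r ^ 2 / 4) * Real.exp (r ^ 2 / 4) ≤ 1 * Real.exp (r ^ 2 / 4) :=
        mul_le_mul_of_nonneg_right (burgersPhi_le_one (by positivity)) (Real.exp_pos _).le
    _ = Real.exp (r ^ 2 / 4) := one_mul _

section GaussClass

variable {a b : EuclideanSpace ℝ (Fin 2) → ℝ}

/-- The constant of a Gaussian-class bound is nonnegative (read off at `x = 0`). [folklore]
[cite: GallaySverak2021, §2 Thm 2.5 with Rem. 2.7 (source of the ARGUMENT implemented; this declaration is the cell’s own lemma, NOT a printed statement)] -/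
theorem arnold_gc_const_nonneg {C : ℝ} {N : ℕ}
    (h : ∀ x, |a x| ≤ C * (1 + ‖x‖) ^ N * Real.exp (-(‖x‖ ^ 2 / 4))) : 0 ≤ C := by
  have h0 := h 0
  simp only [norm_zero, add_zero, one_pow, mul_one, ne_eq, OfNat.ofNat_ne_zero,
    not_false_eq_true, zero_pow, zero_div, neg_zero, Real.exp_zero] at h0
  exact (abs_nonneg _).trans h0

/-- **Reduction to a pure Gaussian bound**: a Gaussian-class function satisfies
`|a| ≤ B e^{−|x|²/8}` (`(1+r)^N e^{−r²/4} ≤ K_N e^{−r²/8}`). [folklore]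
[cite: GallaySverak2021, §2 Thm 2.5 with Rem. 2.7 (source of the ARGUMENT implemented; this declaration is the cell’s own lemma, NOT a printed statement)] -/
theorem arnold_gc_exp_eighth
    (ha : ∃ (C : ℝ) (N : ℕ), ∀ x, |a x| ≤ C * (1 + ‖x‖) ^ N * Real.exp (-(‖x‖ ^ 2 / 4))) :
    ∃ B : ℝ, 0 ≤ B ∧ ∀ x, |a x| ≤ B * Real.exp (-(1 / 8) * ‖x‖ ^ 2) := by
  obtain ⟨C, N, hC⟩ := ha
  have hC0 := arnold_gc_const_nonneg hC
  refine ⟨C * (N.factorial * (4 / (1 / 4)) ^ N * Real.exp ((1 / 4) / 2)), by positivity, fun x => ?_⟩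
  have h := PineauVicol2026.one_add_pow_mul_exp_neg_mul_sq_le (c := 1 / 4) (by norm_num) N (norm_nonneg x)
  have e1 : -(1 / 4 : ℝ) * ‖x‖ ^ 2 = -(‖x‖ ^ 2 / 4) := by ring
  have e2 : -((1 / 4 : ℝ) / 2) * ‖x‖ ^ 2 = -(1 / 8) * ‖x‖ ^ 2 := by ring
  rw [e1, e2] at h
  calc |a x| ≤ C * ((1 + ‖x‖) ^ N * Real.exp (-(‖x‖ ^ 2 / 4))) := by rw [← mul_assoc]; exact hC x
    _ ≤ C * ((N.factorial * (4 / (1 / 4)) ^ N * Real.exp ((1 / 4) / 2)) * Real.exp (-(1 / 8) * ‖x‖ ^ 2)) :=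
        mul_le_mul_of_nonneg_left h hC0
    _ = _ := by ring

/-! ### Integrability of the weighted squares of a Gaussian-class function -/

/-- **`Φ⁻¹ a² ∈ L¹`** for a measurable Gaussian-class `a` (`Φ⁻¹ ≤ e^{r²/4}`, so
`Φ⁻¹a² ≤ C²(1+r)^{2N} e^{−r²/4}`). [folklore]
[cite: GallaySverak2021, §2 Thm 2.5 with Rem. 2.7 (source of the ARGUMENT implemented; this declaration is the cell’s own lemma, NOT a printed statement)] -/
theorem arnold_integrable_inv_kerWeight_mul_sq (ham : AEStronglyMeasurable a volume)
    (ha : ∃ (C : ℝ) (N : ℕ), ∀ x, |a x| ≤ C * (1 + ‖x‖) ^ N * Real.exp (-(‖x‖ ^ 2 / 4))) :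
    Integrable fun x => (kerWeight ‖x‖)⁻¹ * a x ^ 2 := by
  obtain ⟨C, N, hC⟩ := ha
  have hC0 := arnold_gc_const_nonneg hC
  have hint := (PineauVicol2026.integrable_one_add_norm_pow_mul_exp_neg_mul_sq
    (E := EuclideanSpace ℝ (Fin 2)) (c := 1 / 4) (by norm_num) (2 * N)).const_mul (C ^ 2)
  refine hint.mono' (((continuous_kerWeight.comp continuous_norm).inv₀
      fun x => (kerWeight_pos _).ne').aestronglyMeasurable.mul (ham.pow 2))
    (Eventually.of_forall fun x => ?_)
  have hΦ := kerWeight_pos ‖x‖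
  rw [Real.norm_of_nonneg (by positivity)]
  have h1 := arnold_inv_kerWeight_le ‖x‖
  have h2 : a x ^ 2 ≤ (C * (1 + ‖x‖) ^ N * Real.exp (-(‖x‖ ^ 2 / 4))) ^ 2 := by
    rw [← sq_abs]; exact pow_le_pow_left₀ (abs_nonneg _) (hC x) 2
  have h3 : Real.exp (‖x‖ ^ 2 / 4) * Real.exp (-(‖x‖ ^ 2 / 4)) ^ 2 = Real.exp (-(1 / 4) * ‖x‖ ^ 2) := by
    rw [pow_two (Real.exp _), ← Real.exp_add, ← Real.exp_add]; congr 1; ring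
  calc (kerWeight ‖x‖)⁻¹ * a x ^ 2
      ≤ Real.exp (‖x‖ ^ 2 / 4) * (C * (1 + ‖x‖) ^ N * Real.exp (-(‖x‖ ^ 2 / 4))) ^ 2 :=
        mul_le_mul h1 h2 (sq_nonneg _) (Real.exp_pos _).le
    _ = C ^ 2 * ((1 + ‖x‖) ^ (2 * N) * Real.exp (-(1 / 4) * ‖x‖ ^ 2)) := by
        rw [← h3]; ring

/-- **`G_λ⁻¹ a² ∈ L¹`** for a measurable Gaussian-class `a` and `0 ≤ λ < 1`
(`G_λ⁻¹ a² ≤ (4πC²/(1−λ)) (1+r)^{2N} e^{−(1+λ)r²/4}`). [folklore]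
[cite: GallaySverak2021, §2 Thm 2.5 with Rem. 2.7 (source of the ARGUMENT implemented; this declaration is the cell’s own lemma, NOT a printed statement)] -/
theorem arnold_integrable_inv_gaussWeightLam_mul_sq {lam : ℝ} (h0 : 0 ≤ lam) (h1 : lam < 1)
    (ham : AEStronglyMeasurable a volume)
    (ha : ∃ (C : ℝ) (N : ℕ), ∀ x, |a x| ≤ C * (1 + ‖x‖) ^ N * Real.exp (-(‖x‖ ^ 2 / 4))) :
    Integrable fun x => (gaussWeightLam lam x)⁻¹ * a x ^ 2 := by
  obtain ⟨C, N, hC⟩ := ha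
  have hC0 := arnold_gc_const_nonneg hC
  have hl : 0 < 1 - lam := by linarith
  have hint := (PineauVicol2026.integrable_one_add_norm_pow_mul_exp_neg_mul_sq
    (E := EuclideanSpace ℝ (Fin 2)) (c := 1 / 4) (by norm_num) (2 * N)).const_mul
    (4 * Real.pi / (1 - lam) * C ^ 2)
  refine hint.mono' ((continuous_inv_gaussWeightLam h1).aestronglyMeasurable.mul (ham.pow 2))
    (Eventually.of_forall fun x => ?_)
  have hG := gaussWeightLam_pos h1 x
  rw [Real.norm_of_nonneg (by positivity)]
  have h2 : a x ^ 2 ≤ (C * (1 + ‖x‖) ^ N * Real.exp (-(‖x‖ ^ 2 / 4))) ^ 2 := by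
    rw [← sq_abs]; exact pow_le_pow_left₀ (abs_nonneg _) (hC x) 2
  have hGinv : (gaussWeightLam lam x)⁻¹ = 4 * Real.pi / (1 - lam) * Real.exp ((1 - lam) / 4 * ‖x‖ ^ 2) := by
    rw [gaussWeightLam, mul_inv, Real.exp_neg, inv_inv, inv_div]
  have h3 : Real.exp ((1 - lam) / 4 * ‖x‖ ^ 2) * Real.exp (-(‖x‖ ^ 2 / 4)) ^ 2 ≤
      Real.exp (-(1 / 4) * ‖x‖ ^ 2) := by
    rw [pow_two (Real.exp _), ← Real.exp_add, ← Real.exp_add, Real.exp_le_exp]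
    nlinarith [sq_nonneg ‖x‖]
  calc (gaussWeightLam lam x)⁻¹ * a x ^ 2
      ≤ (gaussWeightLam lam x)⁻¹ * (C * (1 + ‖x‖) ^ N * Real.exp (-(‖x‖ ^ 2 / 4))) ^ 2 :=
        mul_le_mul_of_nonneg_left h2 (inv_nonneg.2 hG.le)
    _ = 4 * Real.pi / (1 - lam) * C ^ 2 * ((1 + ‖x‖) ^ (2 * N) *
          (Real.exp ((1 - lam) / 4 * ‖x‖ ^ 2) * Real.exp (-(‖x‖ ^ 2 / 4)) ^ 2)) := by
        rw [hGinv]; ring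
    _ ≤ 4 * Real.pi / (1 - lam) * C ^ 2 * ((1 + ‖x‖) ^ (2 * N) * Real.exp (-(1 / 4) * ‖x‖ ^ 2)) := by
        gcongr

/-- A measurable Gaussian-class function and its first moments are integrable (through
`X_{1/2} ⊆ L¹`, tree `integrable_and_sq_of_memX`, `integrable_coord_mul_of_memX`). [folklore]
[cite: GallaySverak2021, §2 Thm 2.5 with Rem. 2.7 (source of the ARGUMENT implemented; this declaration is the cell’s own lemma, NOT a printed statement)] -/
theorem arnold_integrable_of_gc (ham : AEStronglyMeasurable a volume)
    (ha : ∃ (C : ℝ) (N : ℕ), ∀ x, |a x| ≤ C * (1 + ‖x‖) ^ N * Real.exp (-(‖x‖ ^ 2 / 4))) :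
    Integrable a ∧ (Integrable fun x => a x ^ 2) ∧
      ∀ j : Fin 2, Integrable fun x : EuclideanSpace ℝ (Fin 2) => x j * a x := by
  have hX := arnold_integrable_inv_gaussWeightLam_mul_sq (lam := 1 / 2) (by norm_num) (by norm_num) ham ha
  obtain ⟨h1, h2⟩ := integrable_and_sq_of_memX (lam := 1 / 2) (by norm_num) ham hX
  exact ⟨h1, h2, fun j => integrable_coord_mul_of_memX (lam := 1 / 2) (by norm_num) ham hX j⟩

end GaussClass

/-! ### The registered tools stub -/

end Literature.Analysis.GaussianVortexArnold

end Part4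

/-!
## Part 5 — port of `Summits/NavierStokesRegularity/NavierStokesRegularity/Theorems/FilamentSkeletonRssCoreLinearInvertibilityArnoldModeOne1DKernel.lean` (17 declarations kept)

# Tools for stub `stub_arnoldModeOne1D` (crux `CoreLinearInvertibility`,
# stmt-NavierStokesRegularity-17973, route `FilamentSkeletonRss`, line `Sketch`) — part A: kernel calculus

One-variable calculus on `(0, ∞)` for the `k = ±1` constrained Arnold coercivity at the Gaussian
(Gallay–Šverák, arXiv:2110.13739, §2, proof of Thm. 2.5 — here by an elementary trace argument):

* the Gaussian class `|f(r)| ≤ C (1+r)ᴺ e^{−r²/4}` on `[0, ∞)`: absorption of polynomial weights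
  (`(1+r)ᴺ e^{−r²/8} ≤ e^{2N²}`), integrability of `rᵏ f`, of the weighted products `Φ⁻¹ f g r`
  (`Φ = kerWeight`, `Φ⁻¹ ≤ e^{r²/4}` — tree `arnold_inv_kerWeight_le`), closure under `c₁ f + c₂ g`;
* explicit integrals: `∫₀^∞ r³ e^{−r²/c} dr = c²/2`, `∫₀ʳ s³ e^{−s²/4} ds = 8 − 2(r²+4)e^{−r²/4}`,
  `∫ᵣ^∞ s e^{−s²/4} ds = 2e^{−r²/4}`;
* the kernel weight: `Φ⁻¹(r) · r e^{−r²/4} = 4(1 − e^{−r²/4})/r`, `Φ ≤ (r²/4)e^{−r²/4} + e^{−3r²/8}`,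
  hence the trace bound `∫₀^∞ r Φ(r) dr ≤ 10/3` (true value `π²/3`), and `∫₀^∞ r³Φ ≤ 32`;
* Gaussian limits at `∞` (`rᵏ e^{−r²/c} → 0`).

Everything is folklore calculus; no definitions are introduced (statements are spelled out).

Not carried from this source module (not needed by the declarations re-homed here; their consumers are Summits-side): `stub_arnoldModeOne1DToolsA`.
-/

section Part5

namespace Literature.Analysis.GaussianVortexArnold

open _root_.Set _root_.Function _root_.Filter _root_.MeasureTheory _root_.Topology
open Literature.Analysis.FluidPDE

/-! ### The Gaussian class on `[0, ∞)` -/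

/-- `(1 + r)ᴺ e^{−r²/8} ≤ e^{2N²}` for `r ≥ 0` (`1 + r ≤ eʳ`, `Nr − r²/8 ≤ 2N²`). [folklore]
[cite: GallaySverak2021, §2 proof of Thm 2.5, the mode-one (n = ±1) constrained coercivity (source of the ARGUMENT implemented; this declaration is the cell’s own lemma, NOT a printed statement)] -/
theorem am1_one_add_pow_mul_exp_le (N : ℕ) {r : ℝ} (hr : 0 ≤ r) :
    (1 + r) ^ N * Real.exp (-(r ^ 2 / 8)) ≤ Real.exp (2 * (N : ℝ) ^ 2) := by
  have h1 : (1 + r) ^ N ≤ Real.exp ((N : ℝ) * r) := by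
    have h := Real.add_one_le_exp r
    rw [add_comm] at h
    calc (1 + r) ^ N ≤ Real.exp r ^ N := pow_le_pow_left₀ (by positivity) h N
      _ = Real.exp ((N : ℝ) * r) := by rw [← Real.exp_nat_mul]
  have h2 : (N : ℝ) * r + -(r ^ 2 / 8) ≤ 2 * (N : ℝ) ^ 2 := by
    nlinarith [sq_nonneg (r - 4 * N)]
  calc (1 + r) ^ N * Real.exp (-(r ^ 2 / 8)) ≤ Real.exp ((N : ℝ) * r) * Real.exp (-(r ^ 2 / 8)) :=
        mul_le_mul_of_nonneg_right h1 (Real.exp_pos _).le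
    _ = Real.exp ((N : ℝ) * r + -(r ^ 2 / 8)) := (Real.exp_add _ _).symm
    _ ≤ Real.exp (2 * (N : ℝ) ^ 2) := Real.exp_le_exp.2 h2

/-- Absorption of polynomial weights: a Gaussian-class `f` satisfies
`rᵏ |f(r)| ≤ |C| e^{2(N+k)²} e^{−r²/8}` on `[0, ∞)`. [folklore]
[cite: GallaySverak2021, §2 proof of Thm 2.5, the mode-one (n = ±1) constrained coercivity (source of the ARGUMENT implemented; this declaration is the cell’s own lemma, NOT a printed statement)] -/
theorem am1_pow_mul_abs_le {f : ℝ → ℝ} {C : ℝ} {N : ℕ}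
    (hb : ∀ r, 0 ≤ r → |f r| ≤ C * (1 + r) ^ N * Real.exp (-(r ^ 2 / 4))) (k : ℕ) {r : ℝ}
    (hr : 0 ≤ r) :
    r ^ k * |f r| ≤ |C| * Real.exp (2 * ((N + k : ℕ) : ℝ) ^ 2) * Real.exp (-(r ^ 2 / 8)) := by
  have h1 : r ^ k ≤ (1 + r) ^ k := pow_le_pow_left₀ hr (by linarith) k
  have h2 : |f r| ≤ |C| * (1 + r) ^ N * Real.exp (-(r ^ 2 / 4)) :=
    (hb r hr).trans (by gcongr; exact le_abs_self C)
  have h3 : Real.exp (-(r ^ 2 / 4)) = Real.exp (-(r ^ 2 / 8)) * Real.exp (-(r ^ 2 / 8)) := by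
    rw [← Real.exp_add]; ring_nf
  have h4 := am1_one_add_pow_mul_exp_le (N + k) hr
  calc r ^ k * |f r| ≤ (1 + r) ^ k * (|C| * (1 + r) ^ N * Real.exp (-(r ^ 2 / 4))) :=
        mul_le_mul h1 h2 (abs_nonneg _) (by positivity)
    _ = |C| * ((1 + r) ^ (N + k) * Real.exp (-(r ^ 2 / 8))) * Real.exp (-(r ^ 2 / 8)) := by
        rw [h3, pow_add]; ring
    _ ≤ |C| * Real.exp (2 * ((N + k : ℕ) : ℝ) ^ 2) * Real.exp (-(r ^ 2 / 8)) := by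
        gcongr

/-- The Gaussian `e^{−r²/8}` and `r e^{−r²/8}` are integrable on `(0, ∞)` (Mathlib's Gaussian
integrability, rewritten). [folklore]
[cite: GallaySverak2021, §2 proof of Thm 2.5, the mode-one (n = ±1) constrained coercivity (source of the ARGUMENT implemented; this declaration is the cell’s own lemma, NOT a printed statement)] -/
theorem am1_integrableOn_exp_neg_sq :
    IntegrableOn (fun r : ℝ => Real.exp (-(r ^ 2 / 8))) (Ioi 0) ∧
      IntegrableOn (fun r : ℝ => r * Real.exp (-(r ^ 2 / 8))) (Ioi 0) := by
  have h8 : (0 : ℝ) < 1 / 8 := by norm_num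
  have e : ∀ r : ℝ, Real.exp (-(1 / 8) * r ^ 2) = Real.exp (-(r ^ 2 / 8)) := fun r => by
    congr 1; ring
  refine ⟨((integrable_exp_neg_mul_sq h8).integrableOn.congr_fun (fun r _ => e r)
    measurableSet_Ioi), ((integrable_mul_exp_neg_mul_sq h8).integrableOn.congr_fun
    (fun r _ => by simp only [e r]) measurableSet_Ioi)⟩

/-- `rᵏ f` is integrable on `(0, ∞)` for a continuous Gaussian-class `f`. [folklore]
[cite: GallaySverak2021, §2 proof of Thm 2.5, the mode-one (n = ±1) constrained coercivity (source of the ARGUMENT implemented; this declaration is the cell’s own lemma, NOT a printed statement)] -/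
theorem am1_integrableOn_pow_mul {f : ℝ → ℝ} (hf : Continuous f) {C : ℝ} {N : ℕ}
    (hb : ∀ r, 0 ≤ r → |f r| ≤ C * (1 + r) ^ N * Real.exp (-(r ^ 2 / 4))) (k : ℕ) :
    IntegrableOn (fun r : ℝ => r ^ k * f r) (Ioi 0) := by
  refine Integrable.mono' (am1_integrableOn_exp_neg_sq.1.const_mul
    (|C| * Real.exp (2 * ((N + k : ℕ) : ℝ) ^ 2)))
    (((continuous_pow k).mul hf).aestronglyMeasurable) ?_
  refine (ae_restrict_iff' measurableSet_Ioi).2 (Eventually.of_forall fun r hr => ?_)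
  rw [Real.norm_eq_abs, abs_mul, abs_of_nonneg (pow_nonneg (le_of_lt hr) k)]
  exact am1_pow_mul_abs_le hb k (le_of_lt hr)

/-- `rᵏ |f|` is integrable on `(0, ∞)` for a continuous Gaussian-class `f`. [folklore]
[cite: GallaySverak2021, §2 proof of Thm 2.5, the mode-one (n = ±1) constrained coercivity (source of the ARGUMENT implemented; this declaration is the cell’s own lemma, NOT a printed statement)] -/
theorem am1_integrableOn_pow_mul_abs {f : ℝ → ℝ} (hf : Continuous f) {C : ℝ} {N : ℕ}
    (hb : ∀ r, 0 ≤ r → |f r| ≤ C * (1 + r) ^ N * Real.exp (-(r ^ 2 / 4))) (k : ℕ) :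
    IntegrableOn (fun r : ℝ => r ^ k * |f r|) (Ioi 0) := by
  have h : IntegrableOn (fun r : ℝ => ‖r ^ k * f r‖) (Ioi 0) := (am1_integrableOn_pow_mul hf hb k).norm
  refine IntegrableOn.congr_fun h (fun r hr => ?_) measurableSet_Ioi
  have hk : 0 ≤ r ^ k := pow_nonneg (le_of_lt hr) k
  simp only [Real.norm_eq_abs, abs_mul, abs_of_nonneg hk]

/-- The Gaussian class is stable under linear combinations `c₁ f + c₂ g` (constants
`|c₁||C_f| + |c₂||C_g|`, `max N_f N_g`). [folklore]
[cite: GallaySverak2021, §2 proof of Thm 2.5, the mode-one (n = ±1) constrained coercivity (source of the ARGUMENT implemented; this declaration is the cell’s own lemma, NOT a printed statement)] -/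
theorem am1_gc_lin {f g : ℝ → ℝ} {Cf Cg : ℝ} {Nf Ng : ℕ}
    (hbf : ∀ r, 0 ≤ r → |f r| ≤ Cf * (1 + r) ^ Nf * Real.exp (-(r ^ 2 / 4)))
    (hbg : ∀ r, 0 ≤ r → |g r| ≤ Cg * (1 + r) ^ Ng * Real.exp (-(r ^ 2 / 4))) (c₁ c₂ : ℝ) :
    ∀ r, 0 ≤ r → |c₁ * f r + c₂ * g r| ≤
      (|c₁| * |Cf| + |c₂| * |Cg|) * (1 + r) ^ (max Nf Ng) * Real.exp (-(r ^ 2 / 4)) := by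
  intro r hr
  have h1r : (1 : ℝ) ≤ 1 + r := by linarith
  have hf' : |f r| ≤ |Cf| * (1 + r) ^ (max Nf Ng) * Real.exp (-(r ^ 2 / 4)) :=
    (hbf r hr).trans (by
      gcongr
      · exact le_abs_self _
      · exact le_max_left _ _)
  have hg' : |g r| ≤ |Cg| * (1 + r) ^ (max Nf Ng) * Real.exp (-(r ^ 2 / 4)) :=
    (hbg r hr).trans (by
      gcongr
      · exact le_abs_self _
      · exact le_max_right _ _)
  calc |c₁ * f r + c₂ * g r| ≤ |c₁| * |f r| + |c₂| * |g r| := by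
        rw [← abs_mul, ← abs_mul]; exact abs_add_le _ _
    _ ≤ |c₁| * (|Cf| * (1 + r) ^ (max Nf Ng) * Real.exp (-(r ^ 2 / 4))) +
        |c₂| * (|Cg| * (1 + r) ^ (max Nf Ng) * Real.exp (-(r ^ 2 / 4))) := by
        gcongr
    _ = (|c₁| * |Cf| + |c₂| * |Cg|) * (1 + r) ^ (max Nf Ng) * Real.exp (-(r ^ 2 / 4)) := by ring

/-- The profile `a⋆(r) = r e^{−r²/4}` (the `k = 1` mode of `∂_j G`) is in the Gaussian class with
`C = 1`, `N = 1`. [folklore]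
[cite: GallaySverak2021, §2 proof of Thm 2.5, the mode-one (n = ±1) constrained coercivity (source of the ARGUMENT implemented; this declaration is the cell’s own lemma, NOT a printed statement)] -/
theorem am1_gc_aStar : ∀ r : ℝ, 0 ≤ r →
    |r * Real.exp (-(r ^ 2 / 4))| ≤ 1 * (1 + r) ^ 1 * Real.exp (-(r ^ 2 / 4)) := by
  intro r hr
  rw [abs_mul, abs_of_nonneg hr, abs_of_pos (Real.exp_pos _), pow_one, one_mul]
  gcongr
  linarith

/-! ### The kernel weight against the Gaussian class -/

/-- The weighted products `Φ⁻¹ f g · r` of two continuous Gaussian-class functions are integrable on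
`(0, ∞)` (`Φ⁻¹ ≤ e^{r²/4}` eats one Gaussian, the other is left). [folklore]
[cite: GallaySverak2021, §2 proof of Thm 2.5, the mode-one (n = ±1) constrained coercivity (source of the ARGUMENT implemented; this declaration is the cell’s own lemma, NOT a printed statement)] -/
theorem am1_integrableOn_weight_mul_mul {f g : ℝ → ℝ} (hf : Continuous f) (hg : Continuous g)
    {Cf Cg : ℝ} {Nf Ng : ℕ}
    (hbf : ∀ r, 0 ≤ r → |f r| ≤ Cf * (1 + r) ^ Nf * Real.exp (-(r ^ 2 / 4)))
    (hbg : ∀ r, 0 ≤ r → |g r| ≤ Cg * (1 + r) ^ Ng * Real.exp (-(r ^ 2 / 4))) :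
    IntegrableOn (fun r : ℝ => (kerWeight r)⁻¹ * (f r * g r) * r) (Ioi 0) := by
  -- `h r := (1+r)^{Ng} e^{r²/4} g r · r` hmm: we bound `Φ⁻¹ |g| ≤ |Cg| (1+r)^{Ng}` and use `r f`.
  set K : ℝ := |Cf| * Real.exp (2 * ((Nf + (Ng + 1) : ℕ) : ℝ) ^ 2) * |Cg| with hK
  refine Integrable.mono' (am1_integrableOn_exp_neg_sq.1.const_mul K)
    ((((continuous_kerWeight.inv₀ fun r => (kerWeight_pos r).ne').mul (hf.mul hg)).mul
      continuous_id).aestronglyMeasurable) ?_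
  refine (ae_restrict_iff' measurableSet_Ioi).2 (Eventually.of_forall fun r hr => ?_)
  have hr0 : 0 ≤ r := le_of_lt hr
  have hΦ := kerWeight_pos r
  rw [Real.norm_eq_abs, abs_mul, abs_mul, abs_of_pos (inv_pos.2 hΦ), abs_mul, abs_of_nonneg hr0]
  -- `|g r| ≤ |Cg| (1+r)^Ng e^{-r²/4}` and `Φ⁻¹ e^{-r²/4} ≤ 1`
  have hg1 : |g r| ≤ |Cg| * (1 + r) ^ Ng * Real.exp (-(r ^ 2 / 4)) :=
    (hbg r hr0).trans (by gcongr; exact le_abs_self _)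
  have hinv : (kerWeight r)⁻¹ * Real.exp (-(r ^ 2 / 4)) ≤ 1 := by
    have h := arnold_inv_kerWeight_le r
    have h2 : Real.exp (r ^ 2 / 4) * Real.exp (-(r ^ 2 / 4)) = 1 := by
      rw [← Real.exp_add, add_neg_cancel, Real.exp_zero]
    calc (kerWeight r)⁻¹ * Real.exp (-(r ^ 2 / 4)) ≤ Real.exp (r ^ 2 / 4) * Real.exp (-(r ^ 2 / 4)) :=
          mul_le_mul_of_nonneg_right h (Real.exp_pos _).le
      _ = 1 := h2
  -- `(1+r)^Ng r |f r| ≤ |Cf| e^{2(Nf+Ng+1)²} e^{-r²/8}` (as in `am1_pow_mul_abs_le`)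
  have hfg : (1 + r) ^ Ng * (r * |f r|) ≤ |Cf| * Real.exp (2 * ((Nf + (Ng + 1) : ℕ) : ℝ) ^ 2) *
      Real.exp (-(r ^ 2 / 8)) := by
    have h2 : |f r| ≤ |Cf| * (1 + r) ^ Nf * Real.exp (-(r ^ 2 / 4)) :=
      (hbf r hr0).trans (by gcongr; exact le_abs_self _)
    have h3 : Real.exp (-(r ^ 2 / 4)) = Real.exp (-(r ^ 2 / 8)) * Real.exp (-(r ^ 2 / 8)) := by
      rw [← Real.exp_add]; ring_nf
    have h4 := am1_one_add_pow_mul_exp_le (Nf + (Ng + 1)) hr0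
    have h5 : r ≤ (1 + r) ^ 1 := by rw [pow_one]; linarith
    calc (1 + r) ^ Ng * (r * |f r|)
        ≤ (1 + r) ^ Ng * ((1 + r) ^ 1 * (|Cf| * (1 + r) ^ Nf * Real.exp (-(r ^ 2 / 4)))) := by
          gcongr
      _ = |Cf| * ((1 + r) ^ (Nf + (Ng + 1)) * Real.exp (-(r ^ 2 / 8))) * Real.exp (-(r ^ 2 / 8)) := by
          rw [h3, pow_add, pow_add]; ring
      _ ≤ |Cf| * Real.exp (2 * ((Nf + (Ng + 1) : ℕ) : ℝ) ^ 2) * Real.exp (-(r ^ 2 / 8)) := by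
          gcongr
  -- assemble
  calc (kerWeight r)⁻¹ * (|f r| * |g r|) * r
      ≤ (kerWeight r)⁻¹ * (|f r| * (|Cg| * (1 + r) ^ Ng * Real.exp (-(r ^ 2 / 4)))) * r := by
        gcongr
    _ = ((kerWeight r)⁻¹ * Real.exp (-(r ^ 2 / 4))) * ((1 + r) ^ Ng * r * |f r|) * |Cg| := by ring
    _ ≤ 1 * ((1 + r) ^ Ng * r * |f r|) * |Cg| := by gcongr
    _ = |Cg| * ((1 + r) ^ Ng * (r * |f r|)) := by ring
    _ ≤ |Cg| * (|Cf| * Real.exp (2 * ((Nf + (Ng + 1) : ℕ) : ℝ) ^ 2) * Real.exp (-(r ^ 2 / 8))) := by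
        gcongr
    _ = K * Real.exp (-(r ^ 2 / 8)) := by rw [hK]; ring

/-! ### Gaussian limits at infinity and explicit integrals -/

/-- `rᵏ e^{−r²/c} → 0` at `+∞` (`c > 0`). [folklore]
[cite: GallaySverak2021, §2 proof of Thm 2.5, the mode-one (n = ±1) constrained coercivity (source of the ARGUMENT implemented; this declaration is the cell’s own lemma, NOT a printed statement)] -/
theorem am1_tendsto_pow_mul_exp_neg_sq (k : ℕ) {c : ℝ} (hc : 0 < c) :
    Tendsto (fun r : ℝ => r ^ k * Real.exp (-(r ^ 2 / c))) atTop (𝓝 0) := by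
  have hhalf : Tendsto (fun x : ℝ => Real.exp (-(1 / 2) * x)) atTop (𝓝 0) := by
    have := Real.tendsto_exp_neg_atTop_nhds_zero.comp
      (tendsto_id.const_mul_atTop (show (0 : ℝ) < 1 / 2 by norm_num))
    refine this.congr' (Eventually.of_forall fun x => ?_)
    simp [neg_mul]
  have h := (rpow_mul_exp_neg_mul_sq_isLittleO_exp_neg (b := 1 / c) (by positivity) (k : ℝ)).trans_tendsto
    hhalf
  refine h.congr' ?_
  filter_upwards [eventually_ge_atTop (0 : ℝ)] with r hr
  rw [Real.rpow_natCast]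
  congr 2
  ring

/-- `d/dρ [−(c/2)(ρ² + c) e^{−ρ²/c}] = ρ³ e^{−ρ²/c}`. [folklore]
[cite: GallaySverak2021, §2 proof of Thm 2.5, the mode-one (n = ±1) constrained coercivity (source of the ARGUMENT implemented; this declaration is the cell’s own lemma, NOT a printed statement)] -/
theorem am1_hasDerivAt_cube_primitive {c : ℝ} (hc : c ≠ 0) (ρ : ℝ) :
    HasDerivAt (fun ρ : ℝ => -(c / 2) * (ρ ^ 2 + c) * Real.exp (-(ρ ^ 2 / c)))
      (ρ ^ 3 * Real.exp (-(ρ ^ 2 / c))) ρ := by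
  have h1 : HasDerivAt (fun ρ : ℝ => -(ρ ^ 2 / c)) (-(2 * ρ / c)) ρ := by
    have h := (hasDerivAt_pow 2 ρ).const_mul (-(1 / c))
    refine (h.congr_of_eventuallyEq (Eventually.of_forall fun x => ?_)).congr_deriv ?_
    · simp only; ring
    · push_cast; ring
  have h2 : HasDerivAt (fun ρ : ℝ => Real.exp (-(ρ ^ 2 / c))) (Real.exp (-(ρ ^ 2 / c)) * (-(2 * ρ / c))) ρ :=
    (Real.hasDerivAt_exp _).comp ρ h1
  have h3 : HasDerivAt (fun ρ : ℝ => -(c / 2) * (ρ ^ 2 + c)) (-(c / 2) * (2 * ρ)) ρ := by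
    have h := ((hasDerivAt_pow 2 ρ).add_const c).const_mul (-(c / 2))
    refine h.congr_deriv ?_
    push_cast; ring
  refine ((h3.mul h2).congr_of_eventuallyEq (Eventually.of_forall fun x => ?_)).congr_deriv ?_
  · simp only [Pi.mul_apply]
  · field_simp
    ring

/-- **`∫₀^∞ ρ³ e^{−ρ²/c} dρ = c²/2`** for `c > 0`, with integrability on `(0, ∞)`. [folklore]
[cite: GallaySverak2021, §2 proof of Thm 2.5, the mode-one (n = ±1) constrained coercivity (source of the ARGUMENT implemented; this declaration is the cell’s own lemma, NOT a printed statement)] -/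
theorem am1_integral_Ioi_pow_three_mul_exp {c : ℝ} (hc : 0 < c) :
    (∫ ρ in Ioi (0 : ℝ), ρ ^ 3 * Real.exp (-(ρ ^ 2 / c))) = c ^ 2 / 2 ∧
      IntegrableOn (fun ρ : ℝ => ρ ^ 3 * Real.exp (-(ρ ^ 2 / c))) (Ioi 0) := by
  have hderiv : ∀ x ∈ Ici (0 : ℝ), HasDerivAt (fun ρ : ℝ => -(c / 2) * (ρ ^ 2 + c) * Real.exp (-(ρ ^ 2 / c)))
      (x ^ 3 * Real.exp (-(x ^ 2 / c))) x := fun x _ => am1_hasDerivAt_cube_primitive hc.ne' x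
  have hpos : ∀ x ∈ Ioi (0 : ℝ), 0 ≤ x ^ 3 * Real.exp (-(x ^ 2 / c)) := fun x hx =>
    mul_nonneg (pow_nonneg (le_of_lt hx) 3) (Real.exp_pos _).le
  have hlim : Tendsto (fun ρ : ℝ => -(c / 2) * (ρ ^ 2 + c) * Real.exp (-(ρ ^ 2 / c))) atTop (𝓝 0) := by
    have h2 := am1_tendsto_pow_mul_exp_neg_sq 2 hc
    have h0 := am1_tendsto_pow_mul_exp_neg_sq 0 hc
    have h := (h2.add (h0.const_mul c)).const_mul (-(c / 2))
    simp only [add_zero, mul_zero] at h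
    refine h.congr' (Eventually.of_forall fun ρ => ?_)
    simp only [pow_zero, one_mul]
    ring
  refine ⟨?_, integrableOn_Ioi_deriv_of_nonneg' hderiv hpos hlim⟩
  rw [integral_Ioi_of_hasDerivAt_of_nonneg' hderiv hpos hlim]
  simp only [pow_two (0:ℝ), mul_zero, zero_add, zero_div, neg_zero, Real.exp_zero, mul_one]
  ring

/-- **`∫₀ʳ s² · (s e^{−s²/4}) ds = 8 − 2(r² + 4) e^{−r²/4}`** (the functional `A` of the profile
`a⋆(s) = s e^{−s²/4}`). [folklore]
[cite: GallaySverak2021, §2 proof of Thm 2.5, the mode-one (n = ±1) constrained coercivity (source of the ARGUMENT implemented; this declaration is the cell’s own lemma, NOT a printed statement)] -/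
theorem am1_integral_sq_mul_aStar (r : ℝ) :
    ∫ s in (0 : ℝ)..r, s ^ 2 * (s * Real.exp (-(s ^ 2 / 4))) =
      8 - 2 * (r ^ 2 + 4) * Real.exp (-(r ^ 2 / 4)) := by
  have hderiv : ∀ x ∈ uIcc 0 r, HasDerivAt (fun ρ : ℝ => -(4 / 2) * (ρ ^ 2 + 4) * Real.exp (-(ρ ^ 2 / 4)))
      (x ^ 2 * (x * Real.exp (-(x ^ 2 / 4)))) x := fun x _ =>
    (am1_hasDerivAt_cube_primitive (c := 4) (by norm_num) x).congr_deriv (by ring)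
  have hint : IntervalIntegrable (fun x : ℝ => x ^ 2 * (x * Real.exp (-(x ^ 2 / 4)))) volume 0 r :=
    (by fun_prop : Continuous fun x : ℝ => x ^ 2 * (x * Real.exp (-(x ^ 2 / 4)))).intervalIntegrable _ _
  rw [intervalIntegral.integral_eq_sub_of_hasDerivAt hderiv hint]
  simp only [pow_two (0:ℝ), mul_zero, zero_add, zero_div, neg_zero, Real.exp_zero, mul_one]
  ring

/-- **`∫ᵣ^∞ s e^{−s²/4} ds = 2 e^{−r²/4}`** for `r ≥ 0` (the functional `B` of `a⋆`; tree
`integral_Ioi_mul_exp_neg_sq_div`, `c = 4`). [folklore]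
[cite: GallaySverak2021, §2 proof of Thm 2.5, the mode-one (n = ±1) constrained coercivity (source of the ARGUMENT implemented; this declaration is the cell’s own lemma, NOT a printed statement)] -/
theorem am1_integral_Ioi_aStar {r : ℝ} (hr : 0 ≤ r) :
    ∫ s in Ioi r, s * Real.exp (-(s ^ 2 / 4)) = 2 * Real.exp (-(r ^ 2 / 4)) := by
  rw [(integral_Ioi_mul_exp_neg_sq_div (c := 4) (by norm_num) hr).1]
  ring

/-! ### The kernel weight -/

/-- `Φ(r)⁻¹ · r e^{−r²/4} = 4(1 − e^{−r²/4})/r` for `r ≠ 0` (`Φ⁻¹ = (eˢ − 1)/s`, `s = r²/4`):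
`A a⋆ = B₁ a⋆` for the `k = 1` mode operator. [folklore]
[cite: GallaySverak2021, §2 proof of Thm 2.5, the mode-one (n = ±1) constrained coercivity (source of the ARGUMENT implemented; this declaration is the cell’s own lemma, NOT a printed statement)] -/
theorem am1_inv_kerWeight_mul_aStar {r : ℝ} (hr : r ≠ 0) :
    (kerWeight r)⁻¹ * (r * Real.exp (-(r ^ 2 / 4))) = 4 * (1 - Real.exp (-(r ^ 2 / 4))) / r := by
  rw [kerWeight_eq hr, inv_div, Real.exp_neg]
  have hE : Real.exp (r ^ 2 / 4) ≠ 0 := (Real.exp_pos _).ne'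
  field_simp

/-- `Φ(r) ≤ (r²/4) e^{−r²/4} + e^{−3r²/8}` (`Φ = s e^{−s} + e^{−s}Φ`, `Φ ≤ e^{−s/2}`, `s = r²/4`). [folklore]
[cite: GallaySverak2021, §2 proof of Thm 2.5, the mode-one (n = ±1) constrained coercivity (source of the ARGUMENT implemented; this declaration is the cell’s own lemma, NOT a printed statement)] -/
theorem am1_kerWeight_le_add (r : ℝ) :
    kerWeight r ≤ r ^ 2 / 4 * Real.exp (-(r ^ 2 / 4)) + Real.exp (-(3 * r ^ 2 / 8)) := by
  rcases eq_or_ne r 0 with h | h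
  · subst h; simp
  have hid : kerWeight r = r ^ 2 / 4 * Real.exp (-(r ^ 2 / 4)) + Real.exp (-(r ^ 2 / 4)) * kerWeight r := by
    rw [kerWeight_eq h, Real.exp_neg]
    have hs : 0 < r ^ 2 / 4 := by positivity
    have hE : Real.exp (r ^ 2 / 4) ≠ 0 := (Real.exp_pos _).ne'
    have hne : Real.exp (r ^ 2 / 4) - 1 ≠ 0 := by
      have : 1 < Real.exp (r ^ 2 / 4) := Real.one_lt_exp_iff.2 hs; linarith
    field_simp
    ring
  have h2 : Real.exp (-(r ^ 2 / 4)) * kerWeight r ≤ Real.exp (-(3 * r ^ 2 / 8)) := by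
    calc Real.exp (-(r ^ 2 / 4)) * kerWeight r ≤ Real.exp (-(r ^ 2 / 4)) * Real.exp (-(r ^ 2 / 8)) :=
          mul_le_mul_of_nonneg_left (kerWeight_le_exp r) (Real.exp_pos _).le
      _ = Real.exp (-(3 * r ^ 2 / 8)) := by rw [← Real.exp_add]; ring_nf
  linarith

/-- **The trace bound `∫₀^∞ r Φ(r) dr ≤ 10/3`** (true value `2ζ(2) = π²/3 ≈ 3.29`): with
`Φ ≤ (r²/4)e^{−r²/4} + e^{−3r²/8}`, `∫ r³/4 · e^{−r²/4} = 2` and `∫ r e^{−3r²/8} = 4/3`. This is the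
numerical input `tr B̃₁ = ½∫ rΦ < 2` of the trace argument. [folklore]
[cite: GallaySverak2021, §2 proof of Thm 2.5, the mode-one (n = ±1) constrained coercivity (source of the ARGUMENT implemented; this declaration is the cell’s own lemma, NOT a printed statement)] -/
theorem am1_integral_mul_kerWeight_le : ∫ r in Ioi (0 : ℝ), r * kerWeight r ≤ 10 / 3 := by
  obtain ⟨h3v, h3i⟩ := am1_integral_Ioi_pow_three_mul_exp (c := 4) (by norm_num)
  obtain ⟨h1v, h1i⟩ := integral_Ioi_mul_exp_neg_sq_div (c := 8 / 3) (by norm_num) (le_refl (0 : ℝ))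
  have h1v' : (∫ ρ in Ioi (0 : ℝ), ρ * Real.exp (-(3 * ρ ^ 2 / 8))) = 4 / 3 := by
    have : (fun ρ : ℝ => ρ * Real.exp (-(3 * ρ ^ 2 / 8))) = fun ρ : ℝ => ρ * Real.exp (-(ρ ^ 2 / (8 / 3))) := by
      funext ρ; congr 2; field_simp
    rw [this, h1v]; norm_num
  have h1i' : IntegrableOn (fun ρ : ℝ => ρ * Real.exp (-(3 * ρ ^ 2 / 8))) (Ioi 0) := by
    refine h1i.congr_fun (fun ρ _ => ?_) measurableSet_Ioi
    simp only; congr 2; field_simp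
  calc (∫ r in Ioi (0 : ℝ), r * kerWeight r)
      ≤ ∫ r in Ioi (0 : ℝ), ((1 / 4) * (r ^ 3 * Real.exp (-(r ^ 2 / 4))) + r * Real.exp (-(3 * r ^ 2 / 8))) := by
        refine setIntegral_mono_on integrableOn_mul_kerWeight ((h3i.const_mul _).add h1i')
          measurableSet_Ioi fun r hr => ?_
        have h := am1_kerWeight_le_add r
        have hr0 : 0 ≤ r := le_of_lt hr
        calc r * kerWeight r ≤ r * (r ^ 2 / 4 * Real.exp (-(r ^ 2 / 4)) + Real.exp (-(3 * r ^ 2 / 8))) :=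
              mul_le_mul_of_nonneg_left h hr0
          _ = _ := by ring
    _ = (1 / 4) * (4 ^ 2 / 2) + 4 / 3 := by
        rw [integral_add (h3i.const_mul _) h1i', MeasureTheory.integral_const_mul, h3v, h1v']
    _ = 10 / 3 := by norm_num

/-- `∫₀^∞ r³ Φ(r) dr ≤ 32` (`Φ ≤ e^{−r²/8}`, `∫ r³e^{−r²/8} = 32`; true value `16ζ(3) ≈ 19.2`), with the
integrability of `r³Φ` on `(0, ∞)`. [folklore]
[cite: GallaySverak2021, §2 proof of Thm 2.5, the mode-one (n = ±1) constrained coercivity (source of the ARGUMENT implemented; this declaration is the cell’s own lemma, NOT a printed statement)] -/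
theorem am1_integral_pow_three_mul_kerWeight_le :
    (∫ r in Ioi (0 : ℝ), r ^ 3 * kerWeight r) ≤ 32 ∧
      IntegrableOn (fun r : ℝ => r ^ 3 * kerWeight r) (Ioi 0) := by
  obtain ⟨hv, hi⟩ := am1_integral_Ioi_pow_three_mul_exp (c := 8) (by norm_num)
  have hle : ∀ r ∈ Ioi (0 : ℝ), r ^ 3 * kerWeight r ≤ r ^ 3 * Real.exp (-(r ^ 2 / 8)) := fun r hr =>
    mul_le_mul_of_nonneg_left (kerWeight_le_exp r) (pow_nonneg (le_of_lt hr) 3)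
  have hint : IntegrableOn (fun r : ℝ => r ^ 3 * kerWeight r) (Ioi 0) := by
    refine Integrable.mono' hi (((continuous_pow 3).mul continuous_kerWeight).aestronglyMeasurable) ?_
    refine (ae_restrict_iff' measurableSet_Ioi).2 (Eventually.of_forall fun r hr => ?_)
    rw [Real.norm_of_nonneg (mul_nonneg (pow_nonneg (le_of_lt hr) 3) (kerWeight_pos r).le)]
    exact hle r hr
  refine ⟨?_, hint⟩
  calc (∫ r in Ioi (0 : ℝ), r ^ 3 * kerWeight r) ≤ ∫ r in Ioi (0 : ℝ), r ^ 3 * Real.exp (-(r ^ 2 / 8)) :=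
        setIntegral_mono_on hint hi measurableSet_Ioi hle
    _ = 32 := by rw [hv]; norm_num

/-! ### The registered tools stub -/

end Literature.Analysis.GaussianVortexArnold

end Part5

/-!
## Part 6 — port of `Summits/NavierStokesRegularity/NavierStokesRegularity/Theorems/FilamentSkeletonRssCoreLinearInvertibilityArnoldModeOne1DFunctionals.lean` (14 declarations kept)

# Tools for stub `stub_arnoldModeOne1D` (crux `CoreLinearInvertibility`,
# stmt-NavierStokesRegularity-17973, route `FilamentSkeletonRss`, line `Sketch`) — part B: the functionals

For a continuous Gaussian-class `f` on `[0, ∞)` put `A_f(r) = ∫₀ʳ s² f`, `B_f(r) = ∫ᵣ^∞ f` (these are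
`⟨Φ s 1_{(0,r]}, f⟩` and `⟨Φ s⁻¹ 1_{(r,∞)}, f⟩` in `L²(Φ⁻¹ s ds)`, `Φ = kerWeight`). This file: an
integration-by-parts frame on `(0, ∞)` with vanishing boundary values; derivatives, continuity and
the bounds `|A_f| ≤ K r³`, `|A_f| ≤ ∫ s²|f|`, `|B_f| ≤ ∫|f|`, `|B_f| ≤ K_B e^{−r²/16}`; the
integrability of `A_f²/r³` and `r B_f²` on `(0, ∞)`. Folklore calculus; no definitions (statements are
spelled out).

Not carried from this source module (not needed by the declarations re-homed here; their consumers are Summits-side): `stub_arnoldModeOne1DToolsB`.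
-/

section Part6

namespace Literature.Analysis.GaussianVortexArnold

open _root_.Set _root_.Function _root_.Filter _root_.MeasureTheory _root_.Topology
open Literature.Analysis.FluidPDE

/-! ### Integration by parts on `(0, ∞)` with vanishing boundary values -/

/-- **FTC on `(0, ∞)` with zero boundary values**: if `Ψ' = ψ` on `(0,∞)`, `ψ ∈ L¹(0,∞)` and
`Ψ → 0` at `0⁺` and at `+∞`, then `∫₀^∞ ψ = 0`. [folklore]
[cite: GallaySverak2021, §2 proof of Thm 2.5, the mode-one (n = ±1) constrained coercivity (source of the ARGUMENT implemented; this declaration is the cell’s own lemma, NOT a printed statement)] -/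
theorem am1_integral_Ioi_eq_zero_of_hasDerivAt {Ψ ψ : ℝ → ℝ}
    (hderiv : ∀ r, 0 < r → HasDerivAt Ψ (ψ r) r) (hint : IntegrableOn ψ (Ioi 0))
    (h0 : Tendsto Ψ (𝓝[>] 0) (𝓝 0)) (hinf : Tendsto Ψ atTop (𝓝 0)) :
    ∫ r in Ioi (0 : ℝ), ψ r = 0 := by
  set Ψ₀ : ℝ → ℝ := fun r => if 0 < r then Ψ r else 0 with hΨ₀
  have heq : ∀ r : ℝ, 0 < r → Ψ₀ r = Ψ r := fun r hr => if_pos hr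
  have hderiv₀ : ∀ r ∈ Ioi (0 : ℝ), HasDerivAt Ψ₀ (ψ r) r := by
    intro r hr
    refine (hderiv r hr).congr_of_eventuallyEq ?_
    filter_upwards [Ioi_mem_nhds hr] with x hx using heq x hx
  have hcont : ContinuousWithinAt Ψ₀ (Ici 0) 0 := by
    rw [← continuousWithinAt_Ioi_iff_Ici, ContinuousWithinAt]
    have h00 : Ψ₀ 0 = 0 := if_neg (lt_irrefl 0)
    rw [h00]
    exact h0.congr' (by filter_upwards [self_mem_nhdsWithin] with x hx using (heq x hx).symm)
  have hinf₀ : Tendsto Ψ₀ atTop (𝓝 0) :=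
    hinf.congr' (by filter_upwards [Ioi_mem_atTop 0] with x hx using (heq x hx).symm)
  rw [integral_Ioi_of_hasDerivAt_of_tendsto hcont hderiv₀ hint hinf₀]
  simp [hΨ₀]

/-- A squeeze at `0⁺`: if `|Ψ r| ≤ b r` on `(0, δ)` hmm — on `(0, ∞)` — for a continuous `b` with
`b 0 = 0`, then `Ψ → 0` at `0⁺`. [folklore]
[cite: GallaySverak2021, §2 proof of Thm 2.5, the mode-one (n = ±1) constrained coercivity (source of the ARGUMENT implemented; this declaration is the cell’s own lemma, NOT a printed statement)] -/
theorem am1_tendsto_zero_nhdsGT {Ψ b : ℝ → ℝ} (hb : Continuous b) (hb0 : b 0 = 0)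
    (hle : ∀ r, 0 < r → |Ψ r| ≤ b r) : Tendsto Ψ (𝓝[>] 0) (𝓝 0) := by
  have hbt : Tendsto b (𝓝[>] 0) (𝓝 0) := by
    have := hb.tendsto 0
    rw [hb0] at this
    exact tendsto_nhdsWithin_of_tendsto_nhds this
  refine squeeze_zero_norm' ?_ hbt
  filter_upwards [self_mem_nhdsWithin] with r hr
  rw [Real.norm_eq_abs]
  exact hle r hr

/-! ### The functionals `A_f(r) = ∫₀ʳ s² f`, `B_f(r) = ∫ᵣ^∞ f` -/

/-- `A_f' = r² f` for continuous `f`. [folklore]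
[cite: GallaySverak2021, §2 proof of Thm 2.5, the mode-one (n = ±1) constrained coercivity (source of the ARGUMENT implemented; this declaration is the cell’s own lemma, NOT a printed statement)] -/
theorem am1_hasDerivAt_A {f : ℝ → ℝ} (hf : Continuous f) (r : ℝ) :
    HasDerivAt (fun x : ℝ => ∫ s in (0 : ℝ)..x, s ^ 2 * f s) (r ^ 2 * f r) r := by
  have hc : Continuous fun s : ℝ => s ^ 2 * f s := (continuous_pow 2).mul hf
  exact intervalIntegral.integral_hasDerivAt_right (hc.intervalIntegrable _ _)
    (hc.stronglyMeasurableAtFilter _ _) hc.continuousAt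

/-- `∫ᵣ^∞ f = ∫₀^∞ f − ∫₀ʳ f` for `r ≥ 0` and `f ∈ L¹(0, ∞)`. [folklore]
[cite: GallaySverak2021, §2 proof of Thm 2.5, the mode-one (n = ±1) constrained coercivity (source of the ARGUMENT implemented; this declaration is the cell’s own lemma, NOT a printed statement)] -/
theorem am1_integral_Ioi_eq_sub {f : ℝ → ℝ} (hfi : IntegrableOn f (Ioi 0)) {r : ℝ} (hr : 0 ≤ r) :
    ∫ s in Ioi r, f s = (∫ s in Ioi (0 : ℝ), f s) - ∫ s in (0 : ℝ)..r, f s := by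
  rw [← Ioc_union_Ioi_eq_Ioi hr, setIntegral_union (Ioc_disjoint_Ioi le_rfl) measurableSet_Ioi
    (hfi.mono_set Ioc_subset_Ioi_self) (hfi.mono_set (Ioi_subset_Ioi hr)),
    intervalIntegral.integral_of_le hr]
  ring

/-- `B_f' = −f` on `(0, ∞)` for continuous `f ∈ L¹(0, ∞)`. [folklore]
[cite: GallaySverak2021, §2 proof of Thm 2.5, the mode-one (n = ±1) constrained coercivity (source of the ARGUMENT implemented; this declaration is the cell’s own lemma, NOT a printed statement)] -/
theorem am1_hasDerivAt_B {f : ℝ → ℝ} (hf : Continuous f) (hfi : IntegrableOn f (Ioi 0)) {r : ℝ}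
    (hr : 0 < r) : HasDerivAt (fun x : ℝ => ∫ s in Ioi x, f s) (-f r) r := by
  have h1 : HasDerivAt (fun x : ℝ => (∫ s in Ioi (0 : ℝ), f s) - ∫ s in (0 : ℝ)..x, f s) (-f r) r :=
    (intervalIntegral.integral_hasDerivAt_right (hf.intervalIntegrable _ _)
      (hf.stronglyMeasurableAtFilter _ _) hf.continuousAt).const_sub _
  refine h1.congr_of_eventuallyEq ?_
  filter_upwards [Ioi_mem_nhds hr] with x hx using am1_integral_Ioi_eq_sub hfi (le_of_lt hx)

/-- `B_f` is continuous on `[0, ∞)`. [folklore]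
[cite: GallaySverak2021, §2 proof of Thm 2.5, the mode-one (n = ±1) constrained coercivity (source of the ARGUMENT implemented; this declaration is the cell’s own lemma, NOT a printed statement)] -/
theorem am1_continuousOn_B {f : ℝ → ℝ} (hf : Continuous f) (hfi : IntegrableOn f (Ioi 0)) :
    ContinuousOn (fun x : ℝ => ∫ s in Ioi x, f s) (Ici 0) := by
  have hc : Continuous fun x : ℝ => (∫ s in Ioi (0 : ℝ), f s) - ∫ s in (0 : ℝ)..x, f s :=
    continuous_const.sub (intervalIntegral.continuous_primitive (fun _ _ => hf.intervalIntegrable _ _) 0)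
  exact hc.continuousOn.congr fun x hx => am1_integral_Ioi_eq_sub hfi hx

/-- The constants of a Gaussian-class `f`: one `K ≥ 0` with `|f| ≤ K e^{−r²/8}` and
`r²|f| ≤ K e^{−r²/8}` on `[0, ∞)`. [folklore]
[cite: GallaySverak2021, §2 proof of Thm 2.5, the mode-one (n = ±1) constrained coercivity (source of the ARGUMENT implemented; this declaration is the cell’s own lemma, NOT a printed statement)] -/
theorem am1_gc_consts {f : ℝ → ℝ} {C : ℝ} {N : ℕ}
    (hb : ∀ r, 0 ≤ r → |f r| ≤ C * (1 + r) ^ N * Real.exp (-(r ^ 2 / 4))) :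
    ∃ K : ℝ, 0 ≤ K ∧ (∀ r, 0 ≤ r → |f r| ≤ K * Real.exp (-(r ^ 2 / 8))) ∧
      (∀ r, 0 ≤ r → r ^ 2 * |f r| ≤ K * Real.exp (-(r ^ 2 / 8))) ∧ (∀ r, 0 ≤ r → |f r| ≤ K) := by
  refine ⟨|C| * Real.exp (2 * ((N + 2 : ℕ) : ℝ) ^ 2), by positivity, fun r hr => ?_, fun r hr =>
    am1_pow_mul_abs_le hb 2 hr, fun r hr => ?_⟩
  · have h := am1_pow_mul_abs_le hb 0 hr
    rw [pow_zero, one_mul] at h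
    refine h.trans ?_
    gcongr
    simp
  · have h := am1_pow_mul_abs_le hb 0 hr
    rw [pow_zero, one_mul] at h
    refine h.trans ?_
    have h1 : Real.exp (-(r ^ 2 / 8)) ≤ 1 := Real.exp_le_one_iff.2 (by nlinarith)
    calc |C| * Real.exp (2 * ((N + 0 : ℕ) : ℝ) ^ 2) * Real.exp (-(r ^ 2 / 8))
        ≤ |C| * Real.exp (2 * ((N + 2 : ℕ) : ℝ) ^ 2) * 1 := by
          gcongr
          simp
      _ = _ := mul_one _

/-- `|A_f(r)| ≤ K r³` on `[0, ∞)` when `|f| ≤ K` there. [folklore]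
[cite: GallaySverak2021, §2 proof of Thm 2.5, the mode-one (n = ±1) constrained coercivity (source of the ARGUMENT implemented; this declaration is the cell’s own lemma, NOT a printed statement)] -/
theorem am1_abs_A_le_cube {f : ℝ → ℝ} {K : ℝ} (hK : ∀ r, 0 ≤ r → |f r| ≤ K) {r : ℝ} (hr : 0 ≤ r) :
    |∫ s in (0 : ℝ)..r, s ^ 2 * f s| ≤ K * r ^ 3 := by
  have h : ∀ x ∈ Set.uIoc (0 : ℝ) r, ‖x ^ 2 * f x‖ ≤ r ^ 2 * K := by
    intro x hx
    rw [uIoc_of_le hr] at hx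
    rw [Real.norm_eq_abs, abs_mul, abs_of_nonneg (sq_nonneg x)]
    have hx2 : x ^ 2 ≤ r ^ 2 := pow_le_pow_left₀ hx.1.le hx.2 2
    exact mul_le_mul hx2 (hK x hx.1.le) (abs_nonneg _) (sq_nonneg r)
  have := intervalIntegral.norm_integral_le_of_norm_le_const h
  rw [Real.norm_eq_abs, sub_zero, abs_of_nonneg hr] at this
  calc |∫ s in (0 : ℝ)..r, s ^ 2 * f s| ≤ r ^ 2 * K * r := this
    _ = K * r ^ 3 := by ring

/-- `|A_f(r)| ≤ ∫₀^∞ s²|f|` on `[0, ∞)`. [folklore]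
[cite: GallaySverak2021, §2 proof of Thm 2.5, the mode-one (n = ±1) constrained coercivity (source of the ARGUMENT implemented; this declaration is the cell’s own lemma, NOT a printed statement)] -/
theorem am1_abs_A_le_integral {f : ℝ → ℝ} (hf : Continuous f) {C : ℝ} {N : ℕ}
    (hb : ∀ r, 0 ≤ r → |f r| ≤ C * (1 + r) ^ N * Real.exp (-(r ^ 2 / 4))) {r : ℝ} (hr : 0 ≤ r) :
    |∫ s in (0 : ℝ)..r, s ^ 2 * f s| ≤ ∫ s in Ioi (0 : ℝ), s ^ 2 * |f s| := by
  have hi := am1_integrableOn_pow_mul_abs hf hb 2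
  calc |∫ s in (0 : ℝ)..r, s ^ 2 * f s| ≤ ∫ s in (0 : ℝ)..r, |s ^ 2 * f s| :=
        intervalIntegral.abs_integral_le_integral_abs hr
    _ = ∫ s in Ioc 0 r, s ^ 2 * |f s| := by
        rw [intervalIntegral.integral_of_le hr]
        refine setIntegral_congr_fun measurableSet_Ioc fun s hs => ?_
        rw [abs_mul, abs_of_nonneg (sq_nonneg s)]
    _ ≤ ∫ s in Ioi (0 : ℝ), s ^ 2 * |f s| :=
        setIntegral_mono_set hi (Eventually.of_forall fun s => mul_nonneg (sq_nonneg s) (abs_nonneg _))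
          (Eventually.of_forall Ioc_subset_Ioi_self)

/-- `|B_f(r)| ≤ ∫₀^∞ |f|` on `[0, ∞)`. [folklore]
[cite: GallaySverak2021, §2 proof of Thm 2.5, the mode-one (n = ±1) constrained coercivity (source of the ARGUMENT implemented; this declaration is the cell’s own lemma, NOT a printed statement)] -/
theorem am1_abs_B_le_integral {f : ℝ → ℝ} (hfi : IntegrableOn f (Ioi 0)) {r : ℝ} (hr : 0 ≤ r) :
    |∫ s in Ioi r, f s| ≤ ∫ s in Ioi (0 : ℝ), |f s| := by
  calc |∫ s in Ioi r, f s| ≤ ∫ s in Ioi r, |f s| := abs_integral_le_integral_abs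
    _ ≤ ∫ s in Ioi (0 : ℝ), |f s| :=
        setIntegral_mono_set hfi.abs (Eventually.of_forall fun s => abs_nonneg _)
          (Eventually.of_forall (Ioi_subset_Ioi hr))

/-- Gaussian decay of the tail functional: `|B_f(r)| ≤ K_B e^{−r²/16}` on `[0, ∞)` with
`K_B = K ∫₀^∞ e^{−s²/16} ds` (`e^{−s²/8} ≤ e^{−r²/16} e^{−s²/16}` for `s ≥ r`). [folklore]
[cite: GallaySverak2021, §2 proof of Thm 2.5, the mode-one (n = ±1) constrained coercivity (source of the ARGUMENT implemented; this declaration is the cell’s own lemma, NOT a printed statement)] -/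
theorem am1_abs_B_le_exp {f : ℝ → ℝ} (hf : Continuous f) {K : ℝ} (hK0 : 0 ≤ K)
    (hK : ∀ r, 0 ≤ r → |f r| ≤ K * Real.exp (-(r ^ 2 / 8))) :
    ∃ KB : ℝ, 0 ≤ KB ∧ ∀ r, 0 ≤ r → |∫ s in Ioi r, f s| ≤ KB * Real.exp (-(r ^ 2 / 16)) := by
  have h16 : (0 : ℝ) < 1 / 16 := by norm_num
  have hgi : IntegrableOn (fun s : ℝ => Real.exp (-(s ^ 2 / 16))) (Ioi 0) := by
    refine (integrable_exp_neg_mul_sq h16).integrableOn.congr_fun (fun s _ => ?_) measurableSet_Ioi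
    show Real.exp _ = Real.exp _
    congr 1; ring
  set J : ℝ := ∫ s in Ioi (0 : ℝ), Real.exp (-(s ^ 2 / 16)) with hJ
  have hJ0 : 0 ≤ J := setIntegral_nonneg measurableSet_Ioi fun s _ => (Real.exp_pos _).le
  refine ⟨K * J, mul_nonneg hK0 hJ0, fun r hr => ?_⟩
  have hfi : IntegrableOn f (Ioi r) := by
    refine Integrable.mono' ((hgi.mono_set (Ioi_subset_Ioi hr)).const_mul K) hf.aestronglyMeasurable ?_
    refine (ae_restrict_iff' measurableSet_Ioi).2 (Eventually.of_forall fun s hs => ?_)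
    have hs0 : 0 ≤ s := hr.trans (le_of_lt hs)
    refine (hK s hs0).trans (mul_le_mul_of_nonneg_left (Real.exp_le_exp.2 ?_) hK0)
    nlinarith [sq_nonneg s]
  have hpt : ∀ s ∈ Ioi r, |f s| ≤ K * Real.exp (-(r ^ 2 / 16)) * Real.exp (-(s ^ 2 / 16)) := by
    intro s hs
    have hs0 : 0 ≤ s := hr.trans (le_of_lt hs)
    have hrs : r ^ 2 ≤ s ^ 2 := pow_le_pow_left₀ hr (le_of_lt hs) 2
    calc |f s| ≤ K * Real.exp (-(s ^ 2 / 8)) := hK s hs0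
      _ ≤ K * (Real.exp (-(r ^ 2 / 16)) * Real.exp (-(s ^ 2 / 16))) := by
          refine mul_le_mul_of_nonneg_left ?_ hK0
          rw [← Real.exp_add]
          exact Real.exp_le_exp.2 (by nlinarith)
      _ = _ := by ring
  calc |∫ s in Ioi r, f s| ≤ ∫ s in Ioi r, |f s| := abs_integral_le_integral_abs
    _ ≤ ∫ s in Ioi r, K * Real.exp (-(r ^ 2 / 16)) * Real.exp (-(s ^ 2 / 16)) :=
        setIntegral_mono_on hfi.abs ((hgi.mono_set (Ioi_subset_Ioi hr)).const_mul _)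
          measurableSet_Ioi hpt
    _ = K * Real.exp (-(r ^ 2 / 16)) * ∫ s in Ioi r, Real.exp (-(s ^ 2 / 16)) :=
        MeasureTheory.integral_const_mul _ _
    _ ≤ K * Real.exp (-(r ^ 2 / 16)) * J := by
        refine mul_le_mul_of_nonneg_left ?_ (by positivity)
        exact setIntegral_mono_set hgi (Eventually.of_forall fun s => (Real.exp_pos _).le)
          (Eventually.of_forall (Ioi_subset_Ioi hr))
    _ = K * J * Real.exp (-(r ^ 2 / 16)) := by ring

/-- Integrability on `(0, ∞)` from a bound on `(0, 1]` and an integrable majorant on `(1, ∞)`,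
for a function continuous on `(0, ∞)`. [folklore]
[cite: GallaySverak2021, §2 proof of Thm 2.5, the mode-one (n = ±1) constrained coercivity (source of the ARGUMENT implemented; this declaration is the cell’s own lemma, NOT a printed statement)] -/
theorem am1_integrableOn_of_bounds {φ ψ : ℝ → ℝ} (hφ : ContinuousOn φ (Ioi 0)) {M : ℝ}
    (h1 : ∀ r, 0 < r → r ≤ 1 → |φ r| ≤ M) (hψ : IntegrableOn ψ (Ioi 1))
    (h2 : ∀ r, 1 < r → |φ r| ≤ ψ r) : IntegrableOn φ (Ioi 0) := by
  rw [← Ioc_union_Ioi_eq_Ioi zero_le_one]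
  refine IntegrableOn.union ?_ ?_
  · refine Integrable.mono' (integrableOn_const (C := M) (by simp))
      ((hφ.mono Ioc_subset_Ioi_self).aestronglyMeasurable measurableSet_Ioc) ?_
    exact (ae_restrict_iff' measurableSet_Ioc).2 (Eventually.of_forall fun r hr => h1 r hr.1 hr.2)
  · refine Integrable.mono' hψ ((hφ.mono (Ioi_subset_Ioi zero_le_one)).aestronglyMeasurable
      measurableSet_Ioi) ?_
    exact (ae_restrict_iff' measurableSet_Ioi).2 (Eventually.of_forall fun r hr => h2 r hr)

/-- `A_f²/r³` is integrable on `(0, ∞)` (`≤ K²r³` on `(0,1]`, `≤ I₂²/r³` on `(1,∞)`). [folklore]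
[cite: GallaySverak2021, §2 proof of Thm 2.5, the mode-one (n = ±1) constrained coercivity (source of the ARGUMENT implemented; this declaration is the cell’s own lemma, NOT a printed statement)] -/
theorem am1_integrableOn_A_sq_div {f : ℝ → ℝ} (hf : Continuous f) {C : ℝ} {N : ℕ}
    (hb : ∀ r, 0 ≤ r → |f r| ≤ C * (1 + r) ^ N * Real.exp (-(r ^ 2 / 4))) :
    IntegrableOn (fun r : ℝ => (∫ s in (0 : ℝ)..r, s ^ 2 * f s) ^ 2 / r ^ 3) (Ioi 0) := by
  obtain ⟨K, hK0, -, -, hK⟩ := am1_gc_consts hb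
  set I₂ : ℝ := ∫ s in Ioi (0 : ℝ), s ^ 2 * |f s| with hI₂
  have hAc : Continuous fun r : ℝ => ∫ s in (0 : ℝ)..r, s ^ 2 * f s :=
    continuous_iff_continuousAt.2 fun r => (am1_hasDerivAt_A hf r).continuousAt
  refine am1_integrableOn_of_bounds (M := K ^ 2) (ψ := fun r => I₂ ^ 2 / 4 * (4 / r ^ 3))
    (((hAc.pow 2).continuousOn).div ((continuous_pow 3).continuousOn)
      fun r hr => pow_ne_zero 3 (ne_of_gt hr)) (fun r hr0 hr1 => ?_)
    ((integral_Ioi_four_div_cube zero_lt_one).2.const_mul (I₂ ^ 2 / 4)) (fun r hr => ?_)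
  · have hA := am1_abs_A_le_cube hK hr0.le
    rw [abs_div, abs_of_pos (pow_pos hr0 3), div_le_iff₀ (pow_pos hr0 3), abs_of_nonneg (sq_nonneg _)]
    calc (∫ s in (0 : ℝ)..r, s ^ 2 * f s) ^ 2 = |∫ s in (0 : ℝ)..r, s ^ 2 * f s| ^ 2 := (sq_abs _).symm
      _ ≤ (K * r ^ 3) ^ 2 := pow_le_pow_left₀ (abs_nonneg _) hA 2
      _ = K ^ 2 * r ^ 3 * r ^ 3 := by ring
      _ ≤ K ^ 2 * 1 * r ^ 3 := by
          gcongr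
          exact pow_le_one₀ hr0.le hr1
      _ = K ^ 2 * r ^ 3 := by ring
  · have hr0 : 0 < r := zero_lt_one.trans hr
    have hA := am1_abs_A_le_integral hf hb hr0.le
    rw [abs_div, abs_of_pos (pow_pos hr0 3), abs_of_nonneg (sq_nonneg _)]
    have hI0 : 0 ≤ I₂ := setIntegral_nonneg measurableSet_Ioi fun s _ => mul_nonneg (sq_nonneg s) (abs_nonneg _)
    calc (∫ s in (0 : ℝ)..r, s ^ 2 * f s) ^ 2 / r ^ 3 = |∫ s in (0 : ℝ)..r, s ^ 2 * f s| ^ 2 / r ^ 3 := by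
          rw [sq_abs]
      _ ≤ I₂ ^ 2 / r ^ 3 := by
          gcongr
      _ = I₂ ^ 2 / 4 * (4 / r ^ 3) := by field_simp

/-- `r B_f(r)²` is integrable on `(0, ∞)` (`≤ K_B² r e^{−r²/8}`). [folklore]
[cite: GallaySverak2021, §2 proof of Thm 2.5, the mode-one (n = ±1) constrained coercivity (source of the ARGUMENT implemented; this declaration is the cell’s own lemma, NOT a printed statement)] -/
theorem am1_integrableOn_mul_B_sq {f : ℝ → ℝ} (hf : Continuous f) {C : ℝ} {N : ℕ}
    (hb : ∀ r, 0 ≤ r → |f r| ≤ C * (1 + r) ^ N * Real.exp (-(r ^ 2 / 4))) :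
    IntegrableOn (fun r : ℝ => r * (∫ s in Ioi r, f s) ^ 2) (Ioi 0) := by
  obtain ⟨K, hK0, hK8, -, -⟩ := am1_gc_consts hb
  obtain ⟨KB, hKB0, hKB⟩ := am1_abs_B_le_exp hf hK0 hK8
  have hfi : IntegrableOn f (Ioi 0) :=
    (am1_integrableOn_pow_mul hf hb 0).congr_fun (fun r _ => by simp) measurableSet_Ioi
  have hBc := am1_continuousOn_B hf hfi
  refine Integrable.mono' (am1_integrableOn_exp_neg_sq.2.const_mul (KB ^ 2)) ?_ ?_
  · exact ContinuousOn.aestronglyMeasurable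
      (continuousOn_id.mul ((hBc.mono Ioi_subset_Ici_self).pow 2)) measurableSet_Ioi
  refine (ae_restrict_iff' measurableSet_Ioi).2 (Eventually.of_forall fun r hr => ?_)
  have hr0 : 0 ≤ r := le_of_lt hr
  rw [Real.norm_eq_abs, abs_mul, abs_of_nonneg hr0, abs_of_nonneg (sq_nonneg _)]
  have hB := hKB r hr0
  have he : Real.exp (-(r ^ 2 / 16)) ^ 2 = Real.exp (-(r ^ 2 / 8)) := by
    rw [← Real.exp_nat_mul]; congr 1; ring
  calc r * (∫ s in Ioi r, f s) ^ 2 = r * |∫ s in Ioi r, f s| ^ 2 := by rw [sq_abs]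
    _ ≤ r * (KB * Real.exp (-(r ^ 2 / 16))) ^ 2 := by
        gcongr
    _ = KB ^ 2 * (r * Real.exp (-(r ^ 2 / 8))) := by rw [mul_pow, he]; ring

/-! ### The registered tools stub -/

end Literature.Analysis.GaussianVortexArnold

end Part6

/-!
## Part 7 — port of `Summits/NavierStokesRegularity/NavierStokesRegularity/Theorems/FilamentSkeletonRssCoreLinearInvertibilityArnoldModeOne1DEnergy.lean` (5 declarations kept)

# Tools for stub `stub_arnoldModeOne1D` (crux `CoreLinearInvertibility`,
# stmt-NavierStokesRegularity-17973, route `FilamentSkeletonRss`, line `Sketch`) — part C: the energy and the trace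

The `k = 1` Biot–Savart form of Gallay–Šverák, `P(f) = ∫₀^∞ (B₁f)(r) f(r) r dr` with
`(B₁f)(r) = ½ ∫₀^∞ min(r/s, s/r) f(s) s ds = ½ (A_f(r)/r + r B_f(r))`, is the ENERGY
`P(f) = ½ ∫₀^∞ (A_f²/r³ + r B_f²) dr` (one integration by parts on `(0,∞)`; this is `∫ ω ψ = −∫ |∇ψ|²`
in the first angular mode) — the positive factorisation `B̃₁ = C̃*C̃` behind the trace argument.
Also here: the first trace identity `∫₀^∞ F(r)/r³ dr = ½∫ rΦ` for `F(r) = ∫₀ʳ s³Φ` and the tail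
`G(r) = ∫ᵣ^∞ Φ/s` (`Φ = kerWeight`). Folklore calculus; no definitions.

Not carried from this source module (not needed by the declarations re-homed here; their consumers are Summits-side): `stub_arnoldModeOne1DToolsC`.
-/

section Part7

namespace Literature.Analysis.GaussianVortexArnold

open _root_.Set _root_.Function _root_.Filter _root_.MeasureTheory _root_.Topology
open Literature.Analysis.FluidPDE

/-! ### The inner integral and the energy identity -/

/-- **Splitting the mode-one integral at `s = r`**: for `r > 0`,
`∫₀^∞ min(r/s, s/r) f(s) s ds = A_f(r)/r + r B_f(r)`. [folklore]
[cite: GallaySverak2021, §2 proof of Thm 2.5, the mode-one (n = ±1) constrained coercivity (source of the ARGUMENT implemented; this declaration is the cell’s own lemma, NOT a printed statement)] -/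
theorem am1_inner_split {f : ℝ → ℝ} (hf : Continuous f) {C : ℝ} {N : ℕ}
    (hb : ∀ r, 0 ≤ r → |f r| ≤ C * (1 + r) ^ N * Real.exp (-(r ^ 2 / 4))) {r : ℝ} (hr : 0 < r) :
    ∫ s in Ioi (0 : ℝ), min (r / s) (s / r) * f s * s =
      (∫ s in (0 : ℝ)..r, s ^ 2 * f s) / r + r * ∫ s in Ioi r, f s := by
  have hfi : IntegrableOn f (Ioi 0) :=
    (am1_integrableOn_pow_mul hf hb 0).congr_fun (fun r _ => by simp) measurableSet_Ioi
  -- the integrand on the two pieces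
  have h1 : EqOn (fun s : ℝ => min (r / s) (s / r) * f s * s) (fun s : ℝ => r⁻¹ * (s ^ 2 * f s)) (Ioc 0 r) := by
    intro s hs
    have hs0 : 0 < s := hs.1
    have hmin : min (r / s) (s / r) = s / r :=
      min_eq_right (((div_le_one hr).2 hs.2).trans ((one_le_div hs0).2 hs.2))
    simp only [hmin]
    field_simp
  have h2 : EqOn (fun s : ℝ => min (r / s) (s / r) * f s * s) (fun s : ℝ => r * f s) (Ioi r) := by
    intro s hs
    have hs0 : 0 < s := hr.trans hs
    have hmin : min (r / s) (s / r) = r / s :=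
      min_eq_left (((div_le_one hs0).2 (le_of_lt hs)).trans ((one_le_div hr).2 (le_of_lt hs)))
    simp only [hmin]
    field_simp
  have hi1 : IntegrableOn (fun s : ℝ => r⁻¹ * (s ^ 2 * f s)) (Ioc 0 r) :=
    ((((continuous_pow 2).mul hf).const_mul r⁻¹).integrableOn_Icc (a := 0) (b := r)).mono_set
      Ioc_subset_Icc_self
  have hi2 : IntegrableOn (fun s : ℝ => r * f s) (Ioi r) := (hfi.mono_set (Ioi_subset_Ioi hr.le)).const_mul r
  rw [← Ioc_union_Ioi_eq_Ioi hr.le, setIntegral_union (Ioc_disjoint_Ioi le_rfl) measurableSet_Ioi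
    (hi1.congr_fun h1.symm measurableSet_Ioc) (hi2.congr_fun h2.symm measurableSet_Ioi),
    setIntegral_congr_fun measurableSet_Ioc h1, setIntegral_congr_fun measurableSet_Ioi h2,
    MeasureTheory.integral_const_mul, MeasureTheory.integral_const_mul,
    ← intervalIntegral.integral_of_le hr.le]
  ring

/-- **The mode-one energy identity** `∫₀^∞ (B₁f) f r dr = ½ ∫₀^∞ (A_f²/r³ + r B_f²) dr` for a
continuous Gaussian-class `f`, `(B₁f)(r) = ½∫₀^∞ min(r/s,s/r) f(s) s ds`: with
`Ψ = ¼(A_f²/r² − r²B_f²)` one has `Ψ' = ½(A_f f + r²B_f f) − ½(A_f²/r³ + rB_f²)` on `(0,∞)` and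
`Ψ(0⁺) = Ψ(∞) = 0`. This is `∫ ω ψ_ω = −∫|∇ψ_ω|²` in the first angular Fourier mode. [folklore]
[cite: GallaySverak2021, §2 proof of Thm 2.5, the mode-one (n = ±1) constrained coercivity (source of the ARGUMENT implemented; this declaration is the cell’s own lemma, NOT a printed statement)] -/
theorem am1_energy_identity {f : ℝ → ℝ} (hf : Continuous f) {C : ℝ} {N : ℕ}
    (hb : ∀ r, 0 ≤ r → |f r| ≤ C * (1 + r) ^ N * Real.exp (-(r ^ 2 / 4))) :
    ∫ r in Ioi (0 : ℝ), ((1 / 2 : ℝ) * ∫ s in Ioi (0 : ℝ), min (r / s) (s / r) * f s * s) * f r * r =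
      (1 / 2) * ∫ r in Ioi (0 : ℝ),
        ((∫ s in (0 : ℝ)..r, s ^ 2 * f s) ^ 2 / r ^ 3 + r * (∫ s in Ioi r, f s) ^ 2) := by
  set A : ℝ → ℝ := fun r => ∫ s in (0 : ℝ)..r, s ^ 2 * f s with hA
  set B : ℝ → ℝ := fun r => ∫ s in Ioi r, f s with hB
  obtain ⟨K, hK0, hK8, -, hK⟩ := am1_gc_consts hb
  obtain ⟨KB, hKB0, hKB⟩ := am1_abs_B_le_exp hf hK0 hK8
  have hfi : IntegrableOn f (Ioi 0) :=
    (am1_integrableOn_pow_mul hf hb 0).congr_fun (fun r _ => by simp) measurableSet_Ioi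
  set I₀ : ℝ := ∫ s in Ioi (0 : ℝ), |f s| with hI₀
  set I₂ : ℝ := ∫ s in Ioi (0 : ℝ), s ^ 2 * |f s| with hI₂
  have hI₀0 : 0 ≤ I₀ := setIntegral_nonneg measurableSet_Ioi fun s _ => abs_nonneg _
  have hI₂0 : 0 ≤ I₂ := setIntegral_nonneg measurableSet_Ioi fun s _ => mul_nonneg (sq_nonneg s) (abs_nonneg _)
  have hAc : Continuous A := continuous_iff_continuousAt.2 fun r => (am1_hasDerivAt_A hf r).continuousAt
  have hBc : ContinuousOn B (Ici 0) := am1_continuousOn_B hf hfi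
  have hA3 : ∀ r, 0 ≤ r → |A r| ≤ K * r ^ 3 := fun r hr => am1_abs_A_le_cube hK hr
  have hAI : ∀ r, 0 ≤ r → |A r| ≤ I₂ := fun r hr => am1_abs_A_le_integral hf hb hr
  have hBI : ∀ r, 0 ≤ r → |B r| ≤ I₀ := fun r hr => am1_abs_B_le_integral hfi hr
  -- the two integrands
  set p : ℝ → ℝ := fun r => (1 / 2) * (A r * f r + r ^ 2 * (B r * f r)) with hp
  set e : ℝ → ℝ := fun r => (1 / 2) * (A r ^ 2 / r ^ 3 + r * B r ^ 2) with he
  have hLHS : (∫ r in Ioi (0 : ℝ), ((1 / 2 : ℝ) * ∫ s in Ioi (0 : ℝ), min (r / s) (s / r) * f s * s) * f r * r) =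
      ∫ r in Ioi (0 : ℝ), p r := by
    refine setIntegral_congr_fun measurableSet_Ioi fun r hr => ?_
    rw [am1_inner_split hf hb hr]
    have hr0 : r ≠ 0 := ne_of_gt hr
    simp only [hp, hA, hB]
    field_simp
  have hpi : IntegrableOn p (Ioi 0) := by
    have h1 : IntegrableOn (fun r => A r * f r) (Ioi 0) := by
      refine Integrable.mono' (hfi.abs.const_mul I₂) ((hAc.mul hf).aestronglyMeasurable) ?_
      refine (ae_restrict_iff' measurableSet_Ioi).2 (Eventually.of_forall fun r hr => ?_)
      rw [Real.norm_eq_abs, abs_mul]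
      exact mul_le_mul_of_nonneg_right (hAI r (le_of_lt hr)) (abs_nonneg _)
    have h2 : IntegrableOn (fun r => r ^ 2 * (B r * f r)) (Ioi 0) := by
      refine Integrable.mono' ((am1_integrableOn_pow_mul_abs hf hb 2).const_mul I₀) ?_ ?_
      · exact ContinuousOn.aestronglyMeasurable ((continuous_pow 2).continuousOn.mul
          ((hBc.mono Ioi_subset_Ici_self).mul hf.continuousOn)) measurableSet_Ioi
      refine (ae_restrict_iff' measurableSet_Ioi).2 (Eventually.of_forall fun r hr => ?_)
      rw [Real.norm_eq_abs, abs_mul, abs_mul, abs_of_nonneg (sq_nonneg r)]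
      calc r ^ 2 * (|B r| * |f r|) ≤ r ^ 2 * (I₀ * |f r|) := by gcongr; exact hBI r (le_of_lt hr)
        _ = I₀ * (r ^ 2 * |f r|) := by ring
    exact (h1.add h2).const_mul (1 / 2)
  have hei : IntegrableOn e (Ioi 0) :=
    ((am1_integrableOn_A_sq_div hf hb).add (am1_integrableOn_mul_B_sq hf hb)).const_mul (1 / 2)
  -- the primitive `Ψ = ¼(A²/r² − r²B²)`
  set Ψ : ℝ → ℝ := fun r => (1 / 4) * (A r ^ 2 / r ^ 2) - (1 / 4) * (r ^ 2 * B r ^ 2) with hΨ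
  have hderiv : ∀ r, 0 < r → HasDerivAt Ψ (p r - e r) r := by
    intro r hr
    have hA' : HasDerivAt A (r ^ 2 * f r) r := am1_hasDerivAt_A hf r
    have hB' : HasDerivAt B (-f r) r := am1_hasDerivAt_B hf hfi hr
    have h1 := ((hA'.pow 2).div (hasDerivAt_pow 2 r) (pow_ne_zero 2 hr.ne')).const_mul (1 / 4)
    have h2 := ((hasDerivAt_pow 2 r).mul (hB'.pow 2)).const_mul (1 / 4)
    refine (h1.sub h2).congr_deriv ?_
    simp only [hp, he, Pi.pow_apply]
    push_cast
    field_simp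
    ring
  have h0 : Tendsto Ψ (𝓝[>] 0) (𝓝 0) := by
    refine am1_tendsto_zero_nhdsGT (b := fun r => (1 / 4) * (K ^ 2 * r ^ 4) + (1 / 4) * (r ^ 2 * I₀ ^ 2))
      (by fun_prop) (by simp) fun r hr => ?_
    have hA2 : A r ^ 2 ≤ (K * r ^ 3) ^ 2 := by
      rw [← sq_abs]; exact pow_le_pow_left₀ (abs_nonneg _) (hA3 r hr.le) 2
    have hB2 : B r ^ 2 ≤ I₀ ^ 2 := by
      rw [← sq_abs]; exact pow_le_pow_left₀ (abs_nonneg _) (hBI r hr.le) 2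
    simp only [hΨ]
    rw [abs_le]
    constructor
    · have : (1 / 4) * (r ^ 2 * B r ^ 2) ≤ (1 / 4) * (r ^ 2 * I₀ ^ 2) := by gcongr
      have : 0 ≤ (1 / 4) * (A r ^ 2 / r ^ 2) := by positivity
      nlinarith [sq_nonneg (K * r ^ 2), sq_nonneg K]
    · have h3 : A r ^ 2 / r ^ 2 ≤ K ^ 2 * r ^ 4 := by
        rw [div_le_iff₀ (pow_pos hr 2)]
        calc A r ^ 2 ≤ (K * r ^ 3) ^ 2 := hA2
          _ = K ^ 2 * r ^ 4 * r ^ 2 := by ring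
      have : 0 ≤ (1 / 4) * (r ^ 2 * B r ^ 2) := by positivity
      nlinarith [sq_nonneg (r * I₀)]
  have hinf : Tendsto Ψ atTop (𝓝 0) := by
    have hb1 : Tendsto (fun r : ℝ => (1 / 4) * (I₂ ^ 2 * (r ^ 2)⁻¹) +
        (1 / 4) * (KB ^ 2 * (r ^ 2 * Real.exp (-(r ^ 2 / 8))))) atTop (𝓝 0) := by
      have h1 := (tendsto_inv_atTop_zero.comp (tendsto_pow_atTop two_ne_zero)).const_mul (I₂ ^ 2)
      have h2 := (am1_tendsto_pow_mul_exp_neg_sq 2 (by norm_num : (0 : ℝ) < 8)).const_mul (KB ^ 2)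
      have h := (h1.const_mul (1 / 4)).add (h2.const_mul (1 / 4))
      simp only [mul_zero, add_zero] at h
      exact h
    refine squeeze_zero_norm' ?_ hb1
    filter_upwards [eventually_gt_atTop (0 : ℝ)] with r hr
    have hA2 : A r ^ 2 ≤ I₂ ^ 2 := by
      rw [← sq_abs]; exact pow_le_pow_left₀ (abs_nonneg _) (hAI r hr.le) 2
    have hB2 : B r ^ 2 ≤ (KB * Real.exp (-(r ^ 2 / 16))) ^ 2 := by
      rw [← sq_abs]; exact pow_le_pow_left₀ (abs_nonneg _) (hKB r hr.le) 2
    have he2 : Real.exp (-(r ^ 2 / 16)) ^ 2 = Real.exp (-(r ^ 2 / 8)) := by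
      rw [← Real.exp_nat_mul]; congr 1; ring
    rw [mul_pow, he2] at hB2
    rw [Real.norm_eq_abs]
    simp only [hΨ]
    refine (abs_sub _ _).trans ?_
    rw [abs_of_nonneg (by positivity), abs_of_nonneg (by positivity)]
    have h3 : A r ^ 2 / r ^ 2 ≤ I₂ ^ 2 * (r ^ 2)⁻¹ := by
      rw [div_eq_mul_inv]; exact mul_le_mul_of_nonneg_right hA2 (by positivity)
    have h4 : r ^ 2 * B r ^ 2 ≤ KB ^ 2 * (r ^ 2 * Real.exp (-(r ^ 2 / 8))) := by
      calc r ^ 2 * B r ^ 2 ≤ r ^ 2 * (KB ^ 2 * Real.exp (-(r ^ 2 / 8))) := by gcongr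
        _ = _ := by ring
    linarith
  -- integrate
  have hzero := am1_integral_Ioi_eq_zero_of_hasDerivAt hderiv (hpi.sub hei) h0 hinf
  rw [integral_sub hpi hei, sub_eq_zero] at hzero
  rw [hLHS, hzero, he, ← integral_const_mul]

/-! ### The trace identities -/

/-- `F(r) = ∫₀ʳ s³Φ` satisfies `0 ≤ F(r) ≤ r⁴/4` and `F(r) ≤ 32` for `r ≥ 0`. [folklore]
[cite: GallaySverak2021, §2 proof of Thm 2.5, the mode-one (n = ±1) constrained coercivity (source of the ARGUMENT implemented; this declaration is the cell’s own lemma, NOT a printed statement)] -/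
theorem am1_F_bounds {r : ℝ} (hr : 0 ≤ r) :
    0 ≤ ∫ s in (0 : ℝ)..r, s ^ 3 * kerWeight s ∧ (∫ s in (0 : ℝ)..r, s ^ 3 * kerWeight s) ≤ r ^ 4 / 4 ∧
      (∫ s in (0 : ℝ)..r, s ^ 3 * kerWeight s) ≤ 32 := by
  have hc : Continuous fun s : ℝ => s ^ 3 * kerWeight s := (continuous_pow 3).mul continuous_kerWeight
  have hnn : ∀ s, 0 ≤ s → 0 ≤ s ^ 3 * kerWeight s := fun s hs => mul_nonneg (pow_nonneg hs 3) (kerWeight_pos s).le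
  refine ⟨intervalIntegral.integral_nonneg hr fun s hs => hnn s hs.1, ?_, ?_⟩
  · calc (∫ s in (0 : ℝ)..r, s ^ 3 * kerWeight s) ≤ ∫ s in (0 : ℝ)..r, s ^ 3 := by
          refine intervalIntegral.integral_mono_on hr (hc.intervalIntegrable _ _)
            ((continuous_pow 3).intervalIntegrable _ _) fun s hs => ?_
          calc s ^ 3 * kerWeight s ≤ s ^ 3 * 1 := mul_le_mul_of_nonneg_left (kerWeight_le_one s) (pow_nonneg hs.1 3)
            _ = s ^ 3 := mul_one _
      _ = r ^ 4 / 4 := by rw [integral_pow]; norm_num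
  · obtain ⟨hv, hi⟩ := am1_integral_pow_three_mul_kerWeight_le
    calc (∫ s in (0 : ℝ)..r, s ^ 3 * kerWeight s) = ∫ s in Ioc 0 r, s ^ 3 * kerWeight s :=
          intervalIntegral.integral_of_le hr
      _ ≤ ∫ s in Ioi (0 : ℝ), s ^ 3 * kerWeight s :=
          setIntegral_mono_set hi ((ae_restrict_iff' measurableSet_Ioi).2
            (Eventually.of_forall fun s hs => hnn s (le_of_lt hs))) (Eventually.of_forall Ioc_subset_Ioi_self)
      _ ≤ 32 := hv

/-- **First trace identity** `∫₀^∞ F(r)/r³ dr = ½∫₀^∞ rΦ(r) dr`, `F(r) = ∫₀ʳ s³Φ` (by parts with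
`Ψ = −F/(2r²)`, `Ψ(0⁺) = Ψ(∞) = 0`), with the integrability of `F/r³` on `(0, ∞)`. [folklore]
[cite: GallaySverak2021, §2 proof of Thm 2.5, the mode-one (n = ±1) constrained coercivity (source of the ARGUMENT implemented; this declaration is the cell’s own lemma, NOT a printed statement)] -/
theorem am1_integral_F_div_cube :
    IntegrableOn (fun r : ℝ => (∫ s in (0 : ℝ)..r, s ^ 3 * kerWeight s) / r ^ 3) (Ioi 0) ∧
      ∫ r in Ioi (0 : ℝ), (∫ s in (0 : ℝ)..r, s ^ 3 * kerWeight s) / r ^ 3 =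
        (1 / 2) * ∫ r in Ioi (0 : ℝ), r * kerWeight r := by
  set F : ℝ → ℝ := fun r => ∫ s in (0 : ℝ)..r, s ^ 3 * kerWeight s with hF
  have hc : Continuous fun s : ℝ => s ^ 3 * kerWeight s := (continuous_pow 3).mul continuous_kerWeight
  have hF' : ∀ r, HasDerivAt F (r ^ 3 * kerWeight r) r := fun r =>
    intervalIntegral.integral_hasDerivAt_right (hc.intervalIntegrable _ _)
      (hc.stronglyMeasurableAtFilter _ _) hc.continuousAt
  have hFc : Continuous F := continuous_iff_continuousAt.2 fun r => (hF' r).continuousAt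
  have hFi : IntegrableOn (fun r : ℝ => F r / r ^ 3) (Ioi 0) := by
    refine am1_integrableOn_of_bounds (M := 1 / 4) (ψ := fun r => 8 * (4 / r ^ 3))
      (hFc.continuousOn.div ((continuous_pow 3).continuousOn) fun r hr => pow_ne_zero 3 (ne_of_gt hr))
      (fun r hr0 hr1 => ?_) ((integral_Ioi_four_div_cube zero_lt_one).2.const_mul 8) (fun r hr => ?_)
    · obtain ⟨h0, h4, -⟩ := am1_F_bounds hr0.le
      rw [abs_div, abs_of_nonneg h0, abs_of_pos (pow_pos hr0 3), div_le_iff₀ (pow_pos hr0 3)]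
      have : r ^ 4 ≤ r ^ 3 := by
        calc r ^ 4 = r ^ 3 * r := by ring
          _ ≤ r ^ 3 * 1 := by gcongr
          _ = r ^ 3 := mul_one _
      linarith
    · have hr0 : 0 < r := zero_lt_one.trans hr
      obtain ⟨h0, -, h32⟩ := am1_F_bounds hr0.le
      rw [abs_div, abs_of_nonneg h0, abs_of_pos (pow_pos hr0 3)]
      calc F r / r ^ 3 ≤ 32 / r ^ 3 := by gcongr
        _ = 8 * (4 / r ^ 3) := by ring
  refine ⟨hFi, ?_⟩
  set Ψ : ℝ → ℝ := fun r => -(1 / 2) * (F r / r ^ 2) with hΨ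
  have hderiv : ∀ r, 0 < r → HasDerivAt Ψ (F r / r ^ 3 - (1 / 2) * (r * kerWeight r)) r := by
    intro r hr
    have h := ((hF' r).div (hasDerivAt_pow 2 r) (pow_ne_zero 2 hr.ne')).const_mul (-(1 / 2))
    refine h.congr_deriv ?_
    push_cast
    field_simp
    ring
  have h0 : Tendsto Ψ (𝓝[>] 0) (𝓝 0) := by
    refine am1_tendsto_zero_nhdsGT (b := fun r => (1 / 2) * (r ^ 2 / 4)) (by fun_prop) (by simp)
      fun r hr => ?_
    obtain ⟨hF0, h4, -⟩ := am1_F_bounds hr.le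
    simp only [hΨ]
    rw [abs_mul, show |-(1 / 2 : ℝ)| = 1 / 2 by norm_num, abs_div, abs_of_nonneg hF0, abs_of_pos (pow_pos hr 2)]
    refine mul_le_mul_of_nonneg_left ?_ (by norm_num)
    rw [div_le_iff₀ (pow_pos hr 2)]
    calc F r ≤ r ^ 4 / 4 := h4
      _ = r ^ 2 / 4 * r ^ 2 := by ring
  have hinf : Tendsto Ψ atTop (𝓝 0) := by
    have hb1 : Tendsto (fun r : ℝ => (1 / 2) * (32 * (r ^ 2)⁻¹)) atTop (𝓝 0) := by
      have h := (((tendsto_inv_atTop_zero (𝕜 := ℝ)).comp (tendsto_pow_atTop two_ne_zero)).const_mul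
        (32 : ℝ)).const_mul (1 / 2)
      simp only [mul_zero] at h
      exact h
    refine squeeze_zero_norm' ?_ hb1
    filter_upwards [eventually_gt_atTop (0 : ℝ)] with r hr
    obtain ⟨hF0, -, h32⟩ := am1_F_bounds hr.le
    rw [Real.norm_eq_abs]
    simp only [hΨ]
    rw [abs_mul, show |-(1 / 2 : ℝ)| = 1 / 2 by norm_num, abs_div, abs_of_nonneg hF0,
      abs_of_pos (pow_pos hr 2)]
    refine mul_le_mul_of_nonneg_left ?_ (by norm_num)
    rw [← div_eq_mul_inv]
    exact div_le_div_of_nonneg_right h32 (pow_pos hr 2).le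
  have hΦi : IntegrableOn (fun r : ℝ => (1 / 2) * (r * kerWeight r)) (Ioi 0) :=
    integrableOn_mul_kerWeight.const_mul _
  have hzero := am1_integral_Ioi_eq_zero_of_hasDerivAt hderiv (hFi.sub hΦi) h0 hinf
  rw [integral_sub hFi hΦi, sub_eq_zero, MeasureTheory.integral_const_mul] at hzero
  exact hzero

/-- The tail `G(r) = ∫ᵣ^∞ Φ(s)/s ds`: integrability on `(r, ∞)` for `r > 0`, the bounds
`0 ≤ G(r) ≤ (∫₀^∞ Φ)/r` and `r² G(r) ≤ 4e^{−r²/8}` (tree `integral_Ioi_tail_le_exp`). [folklore]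
[cite: GallaySverak2021, §2 proof of Thm 2.5, the mode-one (n = ±1) constrained coercivity (source of the ARGUMENT implemented; this declaration is the cell’s own lemma, NOT a printed statement)] -/
theorem am1_G_bounds {r : ℝ} (hr : 0 < r) :
    IntegrableOn (fun s : ℝ => kerWeight s / s) (Ioi r) ∧ 0 ≤ ∫ s in Ioi r, kerWeight s / s ∧
      (∫ s in Ioi r, kerWeight s / s) ≤ (∫ s in Ioi (0 : ℝ), kerWeight s) / r ∧
      r ^ 2 * (∫ s in Ioi r, kerWeight s / s) ≤ 4 * Real.exp (-(r ^ 2 / 8)) := by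
  have hi0 := (integral_Ioi_tail_le_two hr).2
  have hi : IntegrableOn (fun s : ℝ => kerWeight s / s) (Ioi r) := by
    have h' : IntegrableOn (fun s : ℝ => (r ^ 2)⁻¹ * (r ^ 2 * kerWeight s / s)) (Ioi r) :=
      hi0.const_mul _
    refine h'.congr_fun (fun s _ => ?_) measurableSet_Ioi
    have hr2 : r ^ 2 ≠ 0 := pow_ne_zero 2 hr.ne'
    field_simp
  have hΦi : IntegrableOn (fun s : ℝ => kerWeight s) (Ioi 0) := by
    refine Integrable.mono' am1_integrableOn_exp_neg_sq.1 continuous_kerWeight.aestronglyMeasurable ?_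
    exact Eventually.of_forall fun s => by
      rw [Real.norm_of_nonneg (kerWeight_pos s).le]; exact kerWeight_le_exp s
  refine ⟨hi, setIntegral_nonneg measurableSet_Ioi fun s hs => div_nonneg (kerWeight_pos s).le
    (hr.trans hs).le, ?_, ?_⟩
  · calc (∫ s in Ioi r, kerWeight s / s) ≤ ∫ s in Ioi r, kerWeight s / r := by
          refine setIntegral_mono_on hi ((hΦi.mono_set (Ioi_subset_Ioi hr.le)).div_const r)
            measurableSet_Ioi fun s hs => ?_
          exact div_le_div_of_nonneg_left (kerWeight_pos s).le hr (le_of_lt hs)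
      _ = (∫ s in Ioi r, kerWeight s) / r := MeasureTheory.integral_div _ _
      _ ≤ (∫ s in Ioi (0 : ℝ), kerWeight s) / r :=
          div_le_div_of_nonneg_right (setIntegral_mono_set hΦi
            (Eventually.of_forall fun s => (kerWeight_pos s).le)
            (Eventually.of_forall (Ioi_subset_Ioi hr.le))) hr.le
  · have h := integral_Ioi_tail_le_exp hr
    have heq : (∫ ρ in Ioi r, r ^ 2 * kerWeight ρ / ρ) = r ^ 2 * ∫ ρ in Ioi r, kerWeight ρ / ρ := by
      rw [← MeasureTheory.integral_const_mul]
      refine setIntegral_congr_fun measurableSet_Ioi fun ρ _ => ?_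
      ring
    rw [heq] at h
    exact h

/-! ### The registered tools stub -/

end Literature.Analysis.GaussianVortexArnold

end Part7

/-!
## Part 8 — port of `Summits/NavierStokesRegularity/NavierStokesRegularity/Theorems/FilamentSkeletonRssCoreLinearInvertibilityArnoldModeOne1DNeutral.lean` (6 declarations kept)

# Tools for stub `stub_arnoldModeOne1D` (crux `CoreLinearInvertibility`,
# stmt-NavierStokesRegularity-17973, route `FilamentSkeletonRss`, line `Sketch`) — part D: the neutral mode

The `k = 1` neutral direction is `a⋆(r) = r e^{−r²/4}` (first mode of `∂_j G`), with
`A⋆(r) = ∫₀ʳ s³e^{−s²/4} = 8 − 2(r²+4)e^{−r²/4}`, `B⋆(r) = ∫ᵣ^∞ s e^{−s²/4} = 2e^{−r²/4}`. This file: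

* the second trace identity `∫₀^∞ r G(r) dr = ½∫ rΦ`, `G(r) = ∫ᵣ^∞ Φ/s` (`Φ = kerWeight`);
* the CROSS IDENTITY `½∫ (A_g A⋆/r³ + r B_g B⋆) dr = ∫ 4(1 − e^{−r²/4}) g dr` (`= ⟨g, a⋆⟩_{L²(Φ⁻¹ r dr)}`)
  for every Gaussian-class `g` — one integration by parts with `V = −4(1−e^{−r²/4})/r²`,
  `W = 4(1−e^{−r²/4})`, `V' = A⋆/r³`, `W' = rB⋆` (`a⋆` is the top eigenvector of `A⁻¹B₁`);
* the energy of `a⋆`: `½∫(A⋆²/r³ + rB⋆²) = ‖a⋆‖² = 4`.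

Folklore calculus; no definitions.

Not carried from this source module (not needed by the declarations re-homed here; their consumers are Summits-side): `stub_arnoldModeOne1DToolsD`.
-/

section Part8

namespace Literature.Analysis.GaussianVortexArnold

open _root_.Set _root_.Function _root_.Filter _root_.MeasureTheory _root_.Topology
open Literature.Analysis.FluidPDE

/-! ### The trace identities -/

/-- **Second trace identity** `∫₀^∞ r G(r) dr = ½∫₀^∞ rΦ(r) dr`, `G(r) = ∫ᵣ^∞ Φ/s` (by parts with
`Ψ = r²G/2`), with the integrability of `r G(r)` on `(0, ∞)`. Together with the first:
`½∫(F/r³ + rG) = ½∫ rΦ = tr B̃₁`. [folklore]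
[cite: GallaySverak2021, §2 proof of Thm 2.5, the mode-one (n = ±1) constrained coercivity (source of the ARGUMENT implemented; this declaration is the cell’s own lemma, NOT a printed statement)] -/
theorem am1_integral_mul_G :
    IntegrableOn (fun r : ℝ => r * ∫ s in Ioi r, kerWeight s / s) (Ioi 0) ∧
      ∫ r in Ioi (0 : ℝ), r * ∫ s in Ioi r, kerWeight s / s = (1 / 2) * ∫ r in Ioi (0 : ℝ), r * kerWeight r := by
  set G : ℝ → ℝ := fun r => ∫ s in Ioi r, kerWeight s / s with hG
  set IΦ : ℝ := ∫ s in Ioi (0 : ℝ), kerWeight s with hIΦ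
  have hIΦ0 : 0 ≤ IΦ := setIntegral_nonneg measurableSet_Ioi fun s _ => (kerWeight_pos s).le
  have hq : ContinuousOn (fun s : ℝ => kerWeight s / s) (Ioi 0) :=
    continuous_kerWeight.continuousOn.div continuousOn_id fun s hs => ne_of_gt hs
  -- `G a = ∫_a^b Φ/s + G b` for `0 < a ≤ b`
  have hsplit : ∀ a b : ℝ, 0 < a → a ≤ b → G a = (∫ s in a..b, kerWeight s / s) + G b := by
    intro a b ha hab
    have hia := (am1_G_bounds ha).1
    simp only [hG]
    rw [← Ioc_union_Ioi_eq_Ioi hab, setIntegral_union (Ioc_disjoint_Ioi le_rfl) measurableSet_Ioi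
      (hia.mono_set Ioc_subset_Ioi_self) (hia.mono_set (Ioi_subset_Ioi hab)),
      intervalIntegral.integral_of_le hab]
  have hrepr : ∀ r : ℝ, 0 < r → G r = G 1 - ∫ s in (1 : ℝ)..r, kerWeight s / s := by
    intro r hr
    rcases le_total r 1 with h | h
    · rw [hsplit r 1 hr h, intervalIntegral.integral_symm]; ring
    · rw [hsplit 1 r zero_lt_one h]; ring
  have hG' : ∀ r, 0 < r → HasDerivAt G (-(kerWeight r / r)) r := by
    intro r hr
    have hii : IntervalIntegrable (fun s : ℝ => kerWeight s / s) volume 1 r :=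
      (hq.mono fun s hs => lt_of_lt_of_le (lt_min zero_lt_one hr) hs.1).intervalIntegrable
    have h1 : HasDerivAt (fun x : ℝ => G 1 - ∫ s in (1 : ℝ)..x, kerWeight s / s) (-(kerWeight r / r)) r :=
      (intervalIntegral.integral_hasDerivAt_right hii
        (hq.stronglyMeasurableAtFilter isOpen_Ioi r hr) (hq.continuousAt (Ioi_mem_nhds hr))).const_sub _
    refine h1.congr_of_eventuallyEq ?_
    filter_upwards [Ioi_mem_nhds hr] with x hx using hrepr x hx
  have hGc : ContinuousOn G (Ioi 0) := fun r hr => (hG' r hr).continuousAt.continuousWithinAt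
  -- integrability of `r G(r)`
  have hGi : IntegrableOn (fun r : ℝ => r * G r) (Ioi 0) := by
    refine am1_integrableOn_of_bounds (M := IΦ) (ψ := fun r => 4 * Real.exp (-(r ^ 2 / 8)))
      (continuousOn_id.mul hGc) (fun r hr0 hr1 => ?_)
      ((am1_integrableOn_exp_neg_sq.1.mono_set (Ioi_subset_Ioi zero_le_one)).const_mul 4) (fun r hr => ?_)
    · obtain ⟨-, h0, h1, -⟩ := am1_G_bounds hr0
      rw [abs_mul, abs_of_pos hr0, abs_of_nonneg h0]
      calc r * G r ≤ r * (IΦ / r) := mul_le_mul_of_nonneg_left h1 hr0.le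
        _ = IΦ := by field_simp
    · have hr0 : 0 < r := zero_lt_one.trans hr
      obtain ⟨-, h0, -, h2⟩ := am1_G_bounds hr0
      rw [abs_mul, abs_of_pos hr0, abs_of_nonneg h0]
      calc r * G r ≤ r * G r * r := le_mul_of_one_le_right (mul_nonneg hr0.le h0) hr.le
        _ = r ^ 2 * G r := by ring
        _ ≤ 4 * Real.exp (-(r ^ 2 / 8)) := h2
  refine ⟨hGi, ?_⟩
  set Ψ : ℝ → ℝ := fun r => (1 / 2) * (r ^ 2 * G r) with hΨ
  have hderiv : ∀ r, 0 < r → HasDerivAt Ψ (r * G r - (1 / 2) * (r * kerWeight r)) r := by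
    intro r hr
    have h := ((hasDerivAt_pow 2 r).mul (hG' r hr)).const_mul (1 / 2)
    refine h.congr_deriv ?_
    push_cast
    field_simp
    ring
  have h0 : Tendsto Ψ (𝓝[>] 0) (𝓝 0) := by
    refine am1_tendsto_zero_nhdsGT (b := fun r => (1 / 2) * (r * IΦ)) (by fun_prop) (by simp) fun r hr => ?_
    obtain ⟨-, hG0, h1, -⟩ := am1_G_bounds hr
    simp only [hΨ]
    rw [abs_mul, abs_of_pos (by norm_num : (0 : ℝ) < 1 / 2), abs_of_nonneg (by positivity)]
    refine mul_le_mul_of_nonneg_left ?_ (by norm_num)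
    calc r ^ 2 * G r ≤ r ^ 2 * (IΦ / r) := mul_le_mul_of_nonneg_left h1 (sq_nonneg r)
      _ = r * IΦ := by field_simp
  have hinf : Tendsto Ψ atTop (𝓝 0) := by
    have hb1 : Tendsto (fun r : ℝ => (1 / 2) * (4 * Real.exp (-(r ^ 2 / 8)))) atTop (𝓝 0) := by
      have h := ((am1_tendsto_pow_mul_exp_neg_sq 0 (by norm_num : (0 : ℝ) < 8)).const_mul 4).const_mul (1 / 2)
      simp only [mul_zero, pow_zero, one_mul] at h
      exact h
    refine squeeze_zero_norm' ?_ hb1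
    filter_upwards [eventually_gt_atTop (0 : ℝ)] with r hr
    obtain ⟨-, hG0, -, h2⟩ := am1_G_bounds hr
    rw [Real.norm_eq_abs]
    simp only [hΨ]
    rw [abs_mul, abs_of_pos (by norm_num : (0 : ℝ) < 1 / 2), abs_of_nonneg (by positivity)]
    exact mul_le_mul_of_nonneg_left h2 (by norm_num)
  have hΦi : IntegrableOn (fun r : ℝ => (1 / 2) * (r * kerWeight r)) (Ioi 0) :=
    integrableOn_mul_kerWeight.const_mul _
  have hzero := am1_integral_Ioi_eq_zero_of_hasDerivAt hderiv (hGi.sub hΦi) h0 hinf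
  rw [integral_sub hGi hΦi, sub_eq_zero, MeasureTheory.integral_const_mul] at hzero
  exact hzero

/-! ### The neutral mode `a⋆ = r e^{−r²/4}` -/

/-- `d/dr e^{−r²/4} = −(r/2) e^{−r²/4}`. [folklore]
[cite: GallaySverak2021, §2 proof of Thm 2.5, the mode-one (n = ±1) constrained coercivity (source of the ARGUMENT implemented; this declaration is the cell’s own lemma, NOT a printed statement)] -/
theorem am1_hasDerivAt_gauss (r : ℝ) :
    HasDerivAt (fun x : ℝ => Real.exp (-(x ^ 2 / 4))) (-(r / 2) * Real.exp (-(r ^ 2 / 4))) r := by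
  have h1 : HasDerivAt (fun x : ℝ => -(x ^ 2 / 4)) (-(r / 2)) r := by
    have h := (hasDerivAt_pow 2 r).const_mul (-(1 / 4 : ℝ))
    refine (h.congr_of_eventuallyEq (Eventually.of_forall fun y => ?_)).congr_deriv ?_
    · simp only; ring
    · push_cast; ring
  exact ((Real.hasDerivAt_exp _).comp r h1).congr_deriv (by ring)

/-- `1 − r²/4 ≤ e^{−r²/4} ≤ 1`, i.e. `0 ≤ 4(1 − e^{−r²/4}) ≤ r²`. [folklore]
[cite: GallaySverak2021, §2 proof of Thm 2.5, the mode-one (n = ±1) constrained coercivity (source of the ARGUMENT implemented; this declaration is the cell’s own lemma, NOT a printed statement)] -/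
theorem am1_one_sub_gauss_mem (r : ℝ) :
    0 ≤ 4 * (1 - Real.exp (-(r ^ 2 / 4))) ∧ 4 * (1 - Real.exp (-(r ^ 2 / 4))) ≤ r ^ 2 := by
  have h1 : Real.exp (-(r ^ 2 / 4)) ≤ 1 := Real.exp_le_one_iff.2 (by nlinarith [sq_nonneg r])
  have h2 := Real.add_one_le_exp (-(r ^ 2 / 4))
  constructor <;> nlinarith

/-- **The cross identity.** For a continuous Gaussian-class `g`,
`½ ∫₀^∞ (A_g(r) A⋆(r)/r³ + r B_g(r) B⋆(r)) dr = ∫₀^∞ 4(1 − e^{−r²/4}) g(r) dr`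
(`A⋆ = 8 − 2(r²+4)e^{−r²/4}`, `B⋆ = 2e^{−r²/4}`): the polarised energy of `g` against the neutral mode
`a⋆` is `⟨g, a⋆⟩_{L²(Φ⁻¹ r dr)}` — `a⋆` is an eigenvector (eigenvalue `1`) of `A⁻¹B₁`. Proof: one
integration by parts with `Λ = ½A_gV + ½B_gW`, `V = −4(1−e^{−r²/4})/r²`, `W = 4(1−e^{−r²/4})`. [folklore]
[cite: GallaySverak2021, §2 proof of Thm 2.5, the mode-one (n = ±1) constrained coercivity (source of the ARGUMENT implemented; this declaration is the cell’s own lemma, NOT a printed statement)] -/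
theorem am1_cross_identity {g : ℝ → ℝ} (hg : Continuous g) {C : ℝ} {N : ℕ}
    (hb : ∀ r, 0 ≤ r → |g r| ≤ C * (1 + r) ^ N * Real.exp (-(r ^ 2 / 4))) :
    IntegrableOn (fun r : ℝ =>
        (∫ s in (0 : ℝ)..r, s ^ 2 * g s) * (8 - 2 * (r ^ 2 + 4) * Real.exp (-(r ^ 2 / 4))) / r ^ 3 +
          r * ((∫ s in Ioi r, g s) * (2 * Real.exp (-(r ^ 2 / 4))))) (Ioi 0) ∧
    (1 / 2) * ∫ r in Ioi (0 : ℝ),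
        ((∫ s in (0 : ℝ)..r, s ^ 2 * g s) * (8 - 2 * (r ^ 2 + 4) * Real.exp (-(r ^ 2 / 4))) / r ^ 3 +
          r * ((∫ s in Ioi r, g s) * (2 * Real.exp (-(r ^ 2 / 4))))) =
      ∫ r in Ioi (0 : ℝ), 4 * (1 - Real.exp (-(r ^ 2 / 4))) * g r := by
  set A : ℝ → ℝ := fun r => ∫ s in (0 : ℝ)..r, s ^ 2 * g s with hA
  set B : ℝ → ℝ := fun r => ∫ s in Ioi r, g s with hB
  set E : ℝ → ℝ := fun r => Real.exp (-(r ^ 2 / 4)) with hE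
  set As : ℝ → ℝ := fun r => 8 - 2 * (r ^ 2 + 4) * E r with hAs
  set V : ℝ → ℝ := fun r => -4 * (1 - E r) / r ^ 2 with hV
  set W : ℝ → ℝ := fun r => 4 * (1 - E r) with hW
  obtain ⟨K, hK0, hK8, -, hK⟩ := am1_gc_consts hb
  obtain ⟨KB, hKB0, hKB⟩ := am1_abs_B_le_exp hg hK0 hK8
  have hgi : IntegrableOn g (Ioi 0) :=
    (am1_integrableOn_pow_mul hg hb 0).congr_fun (fun r _ => by simp) measurableSet_Ioi
  set I₀ : ℝ := ∫ s in Ioi (0 : ℝ), |g s| with hI₀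
  set I₂ : ℝ := ∫ s in Ioi (0 : ℝ), s ^ 2 * |g s| with hI₂
  have hI₀0 : 0 ≤ I₀ := setIntegral_nonneg measurableSet_Ioi fun s _ => abs_nonneg _
  have hI₂0 : 0 ≤ I₂ := setIntegral_nonneg measurableSet_Ioi fun s _ => mul_nonneg (sq_nonneg s) (abs_nonneg _)
  have hAc : Continuous A := continuous_iff_continuousAt.2 fun r => (am1_hasDerivAt_A hg r).continuousAt
  have hBc : ContinuousOn B (Ici 0) := am1_continuousOn_B hg hgi
  have hA3 : ∀ r, 0 ≤ r → |A r| ≤ K * r ^ 3 := fun r hr => am1_abs_A_le_cube hK hr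
  have hAI : ∀ r, 0 ≤ r → |A r| ≤ I₂ := fun r hr => am1_abs_A_le_integral hg hb hr
  have hBI : ∀ r, 0 ≤ r → |B r| ≤ I₀ := fun r hr => am1_abs_B_le_integral hgi hr
  have hEc : Continuous E := by simp only [hE]; fun_prop
  -- the neutral mode as a Gaussian-class function, and its functionals
  have haS : Continuous fun s : ℝ => s * Real.exp (-(s ^ 2 / 4)) := by fun_prop
  have hAstar : ∀ r : ℝ, (∫ s in (0 : ℝ)..r, s ^ 2 * (s * Real.exp (-(s ^ 2 / 4)))) = As r := fun r =>
    am1_integral_sq_mul_aStar r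
  have hBstar : ∀ r : ℝ, 0 ≤ r → (∫ s in Ioi r, s * Real.exp (-(s ^ 2 / 4))) = 2 * E r := fun r hr =>
    am1_integral_Ioi_aStar hr
  -- integrands: `x` (cross energy) and the right-hand side
  set x : ℝ → ℝ := fun r => (1 / 2) * (A r * As r / r ^ 3 + r * (B r * (2 * E r))) with hx
  have hxi : IntegrableOn x (Ioi 0) := by
    -- AM–GM against the squares, whose integrability is `am1_integrableOn_A_sq_div/mul_B_sq`
    have h1 := am1_integrableOn_A_sq_div hg hb
    have h2 := am1_integrableOn_mul_B_sq hg hb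
    have h3 := am1_integrableOn_A_sq_div haS am1_gc_aStar
    have h4 := am1_integrableOn_mul_B_sq haS am1_gc_aStar
    have h3' : IntegrableOn (fun r : ℝ => As r ^ 2 / r ^ 3) (Ioi 0) :=
      h3.congr_fun (fun r _ => by simp only [hAstar r]) measurableSet_Ioi
    have h4' : IntegrableOn (fun r : ℝ => r * (2 * E r) ^ 2) (Ioi 0) :=
      h4.congr_fun (fun r hr => by simp only [hBstar r (le_of_lt hr)]) measurableSet_Ioi
    have hmeas : AEStronglyMeasurable x (volume.restrict (Ioi 0)) := by
      refine ContinuousOn.aestronglyMeasurable ?_ measurableSet_Ioi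
      simp only [hx]
      refine ContinuousOn.mul continuousOn_const (ContinuousOn.add ?_ ?_)
      · exact ((hAc.continuousOn).mul ((continuous_const.sub ((continuous_const.mul
          ((continuous_pow 2).add continuous_const)).mul hEc)).continuousOn)).div
          ((continuous_pow 3).continuousOn) fun r hr => pow_ne_zero 3 (ne_of_gt hr)
      · exact continuousOn_id.mul ((hBc.mono Ioi_subset_Ici_self).mul
          ((continuous_const.mul hEc).continuousOn))
    refine Integrable.mono' ((((h1.add h3').add (h2.add h4')).const_mul (1 / 2)).const_mul (1 / 2))
      hmeas ?_
    refine (ae_restrict_iff' measurableSet_Ioi).2 (Eventually.of_forall fun r hr => ?_)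
    have hr0 : 0 < r := hr
    have hr3 : 0 < r ^ 3 := pow_pos hr0 3
    rw [Real.norm_eq_abs, hx]
    simp only [Pi.add_apply]
    rw [abs_mul, abs_of_pos (by norm_num : (0 : ℝ) < 1 / 2)]
    refine mul_le_mul_of_nonneg_left ?_ (by norm_num)
    refine (abs_add_le _ _).trans ?_
    rw [abs_div, abs_of_pos hr3, abs_mul, abs_mul, abs_of_pos hr0, abs_mul]
    have e1 : |A r| * |As r| / r ^ 3 ≤ (1 / 2) * (A r ^ 2 / r ^ 3 + As r ^ 2 / r ^ 3) := by
      have h : |A r| * |As r| ≤ (1 / 2) * (A r ^ 2 + As r ^ 2) := by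
        nlinarith [sq_nonneg (|A r| - |As r|), sq_abs (A r), sq_abs (As r)]
      calc |A r| * |As r| / r ^ 3 ≤ (1 / 2) * (A r ^ 2 + As r ^ 2) / r ^ 3 :=
            div_le_div_of_nonneg_right h hr3.le
        _ = _ := by ring
    have e2 : r * (|B r| * |2 * E r|) ≤ (1 / 2) * (r * B r ^ 2 + r * (2 * E r) ^ 2) := by
      nlinarith [mul_nonneg hr0.le (sq_nonneg (|B r| - |2 * E r|)), sq_abs (B r), sq_abs (2 * E r)]
    linarith
  have hri : IntegrableOn (fun r : ℝ => 4 * (1 - E r) * g r) (Ioi 0) := by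
    refine Integrable.mono' (hgi.abs.const_mul 4) ?_ ?_
    · exact ((continuous_const.mul (continuous_const.sub hEc)).mul hg).aestronglyMeasurable
    refine (ae_restrict_iff' measurableSet_Ioi).2 (Eventually.of_forall fun r _ => ?_)
    have hm := am1_one_sub_gauss_mem r
    rw [Real.norm_eq_abs, abs_mul, abs_of_nonneg hm.1]
    refine mul_le_mul_of_nonneg_right ?_ (abs_nonneg _)
    have : E r ≤ 1 := Real.exp_le_one_iff.2 (by nlinarith [sq_nonneg r])
    have : 0 < E r := Real.exp_pos _
    simp only [hE] at *
    nlinarith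
  -- the primitive and its derivative
  set Λ : ℝ → ℝ := fun r => (1 / 2) * (A r * V r) + (1 / 2) * (B r * W r) with hΛ
  have hderiv : ∀ r, 0 < r → HasDerivAt Λ (x r - 4 * (1 - E r) * g r) r := by
    intro r hr
    have hA' : HasDerivAt A (r ^ 2 * g r) r := am1_hasDerivAt_A hg r
    have hB' : HasDerivAt B (-g r) r := am1_hasDerivAt_B hg hgi hr
    have hE' : HasDerivAt E (-(r / 2) * E r) r := am1_hasDerivAt_gauss r
    have hV' : HasDerivAt V (((-4) * (-(-(r / 2) * E r)) * r ^ 2 - (-4 * (1 - E r)) * (↑2 * r ^ (2 - 1))) /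
        (r ^ 2) ^ 2) r :=
      ((hE'.const_sub 1).const_mul (-4)).div (hasDerivAt_pow 2 r) (pow_ne_zero 2 hr.ne')
    have hW' : HasDerivAt W (4 * (-(-(r / 2) * E r))) r := (hE'.const_sub 1).const_mul 4
    have h := ((hA'.mul hV').const_mul (1 / 2)).add ((hB'.mul hW').const_mul (1 / 2))
    refine h.congr_deriv ?_
    simp only [hx, hAs, hV, hW]
    push_cast
    field_simp
    ring
  -- boundary values
  have hVb : ∀ r, 0 < r → |V r| ≤ 1 ∧ |V r| ≤ 4 / r ^ 2 := by
    intro r hr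
    have hm := am1_one_sub_gauss_mem r
    have hr2 : 0 < r ^ 2 := pow_pos hr 2
    simp only [hV]
    rw [abs_div, abs_of_pos hr2, show -4 * (1 - E r) = -(4 * (1 - E r)) by ring, abs_neg,
      abs_of_nonneg hm.1, div_le_one hr2, div_le_div_iff_of_pos_right hr2]
    refine ⟨hm.2, ?_⟩
    have : 0 < E r := Real.exp_pos _
    simp only [hE] at *
    nlinarith
  have hWb : ∀ r, 0 ≤ W r ∧ W r ≤ r ^ 2 ∧ W r ≤ 4 := by
    intro r
    have hm := am1_one_sub_gauss_mem r
    have : 0 < E r := Real.exp_pos _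
    simp only [hW, hE] at *
    exact ⟨hm.1, hm.2, by nlinarith⟩
  have h0 : Tendsto Λ (𝓝[>] 0) (𝓝 0) := by
    refine am1_tendsto_zero_nhdsGT (b := fun r => (1 / 2) * (K * r ^ 3) + (1 / 2) * (I₀ * r ^ 2))
      (by fun_prop) (by simp) fun r hr => ?_
    simp only [hΛ]
    refine (abs_add_le _ _).trans ?_
    rw [abs_mul, abs_mul, abs_mul, abs_mul, abs_of_pos (by norm_num : (0 : ℝ) < 1 / 2),
      abs_of_nonneg (hWb r).1]
    gcongr (1 / 2) * ?_ + (1 / 2) * ?_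
    · calc |A r| * |V r| ≤ K * r ^ 3 * 1 :=
            mul_le_mul (hA3 r hr.le) (hVb r hr).1 (abs_nonneg _) (by positivity)
        _ = K * r ^ 3 := mul_one _
    · exact mul_le_mul (hBI r hr.le) (hWb r).2.1 (hWb r).1 hI₀0
  have hinf : Tendsto Λ atTop (𝓝 0) := by
    have hb1 : Tendsto (fun r : ℝ => (1 / 2) * (I₂ * (4 * (r ^ 2)⁻¹)) +
        (1 / 2) * (KB * Real.exp (-(r ^ 2 / 16)) * 4)) atTop (𝓝 0) := by
      have h1 := ((tendsto_inv_atTop_zero.comp (tendsto_pow_atTop two_ne_zero)).const_mul 4).const_mul I₂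
      have h2 := ((am1_tendsto_pow_mul_exp_neg_sq 0 (by norm_num : (0 : ℝ) < 16)).const_mul KB).mul_const 4
      have h := (h1.const_mul (1 / 2)).add (h2.const_mul (1 / 2))
      simp only [mul_zero, zero_mul, add_zero, pow_zero, one_mul] at h
      exact h
    refine squeeze_zero_norm' ?_ hb1
    filter_upwards [eventually_gt_atTop (0 : ℝ)] with r hr
    rw [Real.norm_eq_abs]
    simp only [hΛ]
    refine (abs_add_le _ _).trans ?_
    rw [abs_mul, abs_mul, abs_mul, abs_mul, abs_of_pos (by norm_num : (0 : ℝ) < 1 / 2),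
      abs_of_nonneg (hWb r).1]
    gcongr (1 / 2) * ?_ + (1 / 2) * ?_
    · refine mul_le_mul (hAI r hr.le) ?_ (abs_nonneg _) hI₂0
      rw [← div_eq_mul_inv]; exact (hVb r hr).2
    · exact mul_le_mul (hKB r hr.le) (hWb r).2.2 (hWb r).1 (by positivity)
  have hzero := am1_integral_Ioi_eq_zero_of_hasDerivAt hderiv (hxi.sub hri) h0 hinf
  rw [integral_sub hxi hri, sub_eq_zero] at hzero
  have hxi' : IntegrableOn (fun r : ℝ => A r * As r / r ^ 3 + r * (B r * (2 * E r))) (Ioi 0) := by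
    have h : IntegrableOn (fun r : ℝ => 2 * x r) (Ioi 0) := hxi.const_mul 2
    refine h.congr_fun (fun r _ => ?_) measurableSet_Ioi
    simp only [hx]; ring
  refine ⟨hxi', ?_⟩
  rw [← hzero, hx, ← integral_const_mul]

/-- `∫₀^∞ 4(1 − e^{−r²/4}) · r e^{−r²/4} dr = 4` (`= 4∫ r(e^{−r²/4} − e^{−r²/2}) = 4(2 − 1)`): the
`L²(Φ⁻¹ r dr)`-norm² of the neutral mode `a⋆`. [folklore]
[cite: GallaySverak2021, §2 proof of Thm 2.5, the mode-one (n = ±1) constrained coercivity (source of the ARGUMENT implemented; this declaration is the cell’s own lemma, NOT a printed statement)] -/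
theorem am1_integral_q_mul_aStar :
    (∫ r in Ioi (0 : ℝ), 4 * (1 - Real.exp (-(r ^ 2 / 4))) * (r * Real.exp (-(r ^ 2 / 4)))) = 4 := by
  obtain ⟨h4v, h4i⟩ := integral_Ioi_mul_exp_neg_sq_div (c := 4) (by norm_num) (le_refl (0 : ℝ))
  obtain ⟨h2v, h2i⟩ := integral_Ioi_mul_exp_neg_sq_div (c := 2) (by norm_num) (le_refl (0 : ℝ))
  have hpt : ∀ r : ℝ, 4 * (1 - Real.exp (-(r ^ 2 / 4))) * (r * Real.exp (-(r ^ 2 / 4))) =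
      4 * (r * Real.exp (-(r ^ 2 / 4))) - 4 * (r * Real.exp (-(r ^ 2 / 2))) := by
    intro r
    have : Real.exp (-(r ^ 2 / 4)) * Real.exp (-(r ^ 2 / 4)) = Real.exp (-(r ^ 2 / 2)) := by
      rw [← Real.exp_add]; ring_nf
    linear_combination (-4 * r) * this
  simp_rw [hpt]
  rw [integral_sub (h4i.const_mul 4) (h2i.const_mul 4), MeasureTheory.integral_const_mul,
    MeasureTheory.integral_const_mul, h4v, h2v]
  norm_num

/-- **The energy of the neutral mode is `4`**: `½∫₀^∞ (A⋆²/r³ + r B⋆²) dr = 4`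
(`= ⟨a⋆, a⋆⟩_{L²(Φ⁻¹ r dr)}`, by the cross identity at `g = a⋆`), with the integrability of the
integrand. [folklore]
[cite: GallaySverak2021, §2 proof of Thm 2.5, the mode-one (n = ±1) constrained coercivity (source of the ARGUMENT implemented; this declaration is the cell’s own lemma, NOT a printed statement)] -/
theorem am1_energy_aStar :
    IntegrableOn (fun r : ℝ => (8 - 2 * (r ^ 2 + 4) * Real.exp (-(r ^ 2 / 4))) ^ 2 / r ^ 3 +
        r * (2 * Real.exp (-(r ^ 2 / 4))) ^ 2) (Ioi 0) ∧
    (1 / 2) * ∫ r in Ioi (0 : ℝ), ((8 - 2 * (r ^ 2 + 4) * Real.exp (-(r ^ 2 / 4))) ^ 2 / r ^ 3 +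
        r * (2 * Real.exp (-(r ^ 2 / 4))) ^ 2) = 4 := by
  have haS : Continuous fun s : ℝ => s * Real.exp (-(s ^ 2 / 4)) := by fun_prop
  obtain ⟨hi, h⟩ := am1_cross_identity haS am1_gc_aStar
  have hpt : EqOn (fun r : ℝ => (∫ s in (0 : ℝ)..r, s ^ 2 * (s * Real.exp (-(s ^ 2 / 4)))) *
      (8 - 2 * (r ^ 2 + 4) * Real.exp (-(r ^ 2 / 4))) / r ^ 3 +
      r * ((∫ s in Ioi r, s * Real.exp (-(s ^ 2 / 4))) * (2 * Real.exp (-(r ^ 2 / 4)))))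
      (fun r : ℝ => (8 - 2 * (r ^ 2 + 4) * Real.exp (-(r ^ 2 / 4))) ^ 2 / r ^ 3 +
        r * (2 * Real.exp (-(r ^ 2 / 4))) ^ 2) (Ioi 0) := by
    intro r hr
    simp only
    rw [am1_integral_sq_mul_aStar r, am1_integral_Ioi_aStar (le_of_lt hr)]
    ring
  refine ⟨hi.congr_fun hpt measurableSet_Ioi, ?_⟩
  rw [setIntegral_congr_fun measurableSet_Ioi hpt, am1_integral_q_mul_aStar] at h
  exact h

/-! ### The registered tools stub -/

end Literature.Analysis.GaussianVortexArnold

end Part8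

/-!
## Part 9 — port of `Summits/NavierStokesRegularity/NavierStokesRegularity/Theorems/FilamentSkeletonRssCoreLinearInvertibilityArnoldModeOne1DDeflation.lean` (7 declarations kept)

# Tools for stub `stub_arnoldModeOne1D` (crux `CoreLinearInvertibility`,
# stmt-NavierStokesRegularity-17973, route `FilamentSkeletonRss`, line `Sketch`) — part D: Bessel and deflation

The trace argument for the second eigenvalue of the `k = 1` mode operator
`B̃₁ = A^{-1/2} B₁ A^{-1/2}` (`A = Φ⁻¹`) on `L²(r dr)`: `B̃₁ = C̃*C̃` is positive with the explicit
factorisation `P(g) = ½∫ (A_g²/r³ + r B_g²)` (part B), its top eigenpair is `(1, a⋆)`; BESSEL's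
inequality in `L²(Φ⁻¹ s ds)` for the orthogonal pair `{a⋆/2, g/‖g‖}` applied to the representers
`Φ s 1_{(0,r]}` of `A_·(r)` and `Φ s⁻¹ 1_{(r,∞)}` of `B_·(r)`, integrated in `r`, gives
`P(a⋆)/4 + P(g)/Q(g) ≤ ½∫(F/r³ + rG) = ½∫ rΦ = tr B̃₁ ≤ 5/3`, i.e. the DEFLATION BOUND
`P(g) ≤ (2/3) Q(g)` for every Gaussian-class `g ⊥ a⋆` (`Q(g) = ∫ Φ⁻¹g² s`; true constant
`π²/6 − 1 ≈ 0.645`). Folklore; no definitions.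

Not carried from this source module (not needed by the declarations re-homed here; their consumers are Summits-side): `stub_arnoldModeOne1DToolsE`.
-/

section Part9

namespace Literature.Analysis.GaussianVortexArnold

open _root_.Set _root_.Function _root_.Filter _root_.MeasureTheory _root_.Topology
open Literature.Analysis.FluidPDE

/-! ### The weighted pairing with the neutral mode -/

/-- A discriminant lemma: `2ya − y²Q ≤ M` for all `y` and `Q ≥ 0` give `a² ≤ QM`. [folklore]
[cite: GallaySverak2021, §2 proof of Thm 2.5, the mode-one (n = ±1) constrained coercivity (source of the ARGUMENT implemented; this declaration is the cell’s own lemma, NOT a printed statement)] -/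
theorem am1_sq_le_of_forall {a Q M : ℝ} (hQ : 0 ≤ Q) (h : ∀ y : ℝ, 2 * y * a - y ^ 2 * Q ≤ M) :
    a ^ 2 ≤ Q * M := by
  rcases hQ.eq_or_lt with hQ0 | hQpos
  · subst hQ0
    have ha : a = 0 := by
      by_contra ha
      have h1 := h ((M + 1) / (2 * a))
      have : 2 * ((M + 1) / (2 * a)) * a = M + 1 := by field_simp
      rw [this] at h1
      linarith
    subst ha
    simp
  · have h1 := h (a / Q)
    have : 2 * (a / Q) * a - (a / Q) ^ 2 * Q = a ^ 2 / Q := by field_simp; ring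
    rw [this, div_le_iff₀ hQpos] at h1
    linarith

/-- `⟨a⋆, g⟩_{L²(Φ⁻¹ s ds)} = ∫₀^∞ 4(1 − e^{−s²/4}) g(s) ds` (`Φ⁻¹ a⋆ = 4(1−e^{−s²/4})/s`). [folklore]
[cite: GallaySverak2021, §2 proof of Thm 2.5, the mode-one (n = ±1) constrained coercivity (source of the ARGUMENT implemented; this declaration is the cell’s own lemma, NOT a printed statement)] -/
theorem am1_weight_aStar_mul (g : ℝ → ℝ) :
    ∫ s in Ioi (0 : ℝ), (kerWeight s)⁻¹ * (s * Real.exp (-(s ^ 2 / 4)) * g s) * s =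
      ∫ s in Ioi (0 : ℝ), 4 * (1 - Real.exp (-(s ^ 2 / 4))) * g s := by
  refine setIntegral_congr_fun measurableSet_Ioi fun s hs => ?_
  have hs0 : s ≠ 0 := ne_of_gt hs
  calc (kerWeight s)⁻¹ * (s * Real.exp (-(s ^ 2 / 4)) * g s) * s
      = ((kerWeight s)⁻¹ * (s * Real.exp (-(s ^ 2 / 4)))) * g s * s := by ring
    _ = 4 * (1 - Real.exp (-(s ^ 2 / 4))) / s * g s * s := by rw [am1_inv_kerWeight_mul_aStar hs0]
    _ = 4 * (1 - Real.exp (-(s ^ 2 / 4))) * g s := by field_simp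

/-- `‖a⋆‖²_{L²(Φ⁻¹ s ds)} = 4`. [folklore]
[cite: GallaySverak2021, §2 proof of Thm 2.5, the mode-one (n = ±1) constrained coercivity (source of the ARGUMENT implemented; this declaration is the cell’s own lemma, NOT a printed statement)] -/
theorem am1_Q_aStar :
    ∫ s in Ioi (0 : ℝ), (kerWeight s)⁻¹ *
      (s * Real.exp (-(s ^ 2 / 4)) * (s * Real.exp (-(s ^ 2 / 4)))) * s = 4 := by
  rw [am1_weight_aStar_mul, am1_integral_q_mul_aStar]

/-- `‖x a⋆ + y g‖² = 4x² + y²‖g‖²` in `L²(Φ⁻¹ s ds)` for `g ⊥ a⋆`, with integrability. [folklore]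
[cite: GallaySverak2021, §2 proof of Thm 2.5, the mode-one (n = ±1) constrained coercivity (source of the ARGUMENT implemented; this declaration is the cell’s own lemma, NOT a printed statement)] -/
theorem am1_weight_sq_lin {g : ℝ → ℝ} (hg : Continuous g) {C : ℝ} {N : ℕ}
    (hb : ∀ r, 0 ≤ r → |g r| ≤ C * (1 + r) ^ N * Real.exp (-(r ^ 2 / 4)))
    (horth : ∫ s in Ioi (0 : ℝ), (kerWeight s)⁻¹ * (s * Real.exp (-(s ^ 2 / 4)) * g s) * s = 0)
    (x y : ℝ) :
    IntegrableOn (fun s : ℝ => (kerWeight s)⁻¹ *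
        ((x * (s * Real.exp (-(s ^ 2 / 4))) + y * g s) * (x * (s * Real.exp (-(s ^ 2 / 4))) + y * g s)) * s)
        (Ioi 0) ∧
      ∫ s in Ioi (0 : ℝ), (kerWeight s)⁻¹ *
        ((x * (s * Real.exp (-(s ^ 2 / 4))) + y * g s) * (x * (s * Real.exp (-(s ^ 2 / 4))) + y * g s)) * s =
        4 * x ^ 2 + y ^ 2 * ∫ s in Ioi (0 : ℝ), (kerWeight s)⁻¹ * (g s * g s) * s := by
  have haS : Continuous fun s : ℝ => s * Real.exp (-(s ^ 2 / 4)) := by fun_prop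
  have Iaa := am1_integrableOn_weight_mul_mul haS haS am1_gc_aStar am1_gc_aStar
  have Iag := am1_integrableOn_weight_mul_mul haS hg am1_gc_aStar hb
  have Igg := am1_integrableOn_weight_mul_mul hg hg hb hb
  have hpt : (fun s : ℝ => (kerWeight s)⁻¹ *
      ((x * (s * Real.exp (-(s ^ 2 / 4))) + y * g s) * (x * (s * Real.exp (-(s ^ 2 / 4))) + y * g s)) * s) =
      fun s : ℝ => x ^ 2 * ((kerWeight s)⁻¹ * (s * Real.exp (-(s ^ 2 / 4)) * (s * Real.exp (-(s ^ 2 / 4)))) * s) +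
        2 * x * y * ((kerWeight s)⁻¹ * (s * Real.exp (-(s ^ 2 / 4)) * g s) * s) +
        y ^ 2 * ((kerWeight s)⁻¹ * (g s * g s) * s) := by
    funext s; ring
  rw [hpt]
  have J1 : IntegrableOn (fun s : ℝ => x ^ 2 * ((kerWeight s)⁻¹ *
      (s * Real.exp (-(s ^ 2 / 4)) * (s * Real.exp (-(s ^ 2 / 4)))) * s)) (Ioi 0) := Iaa.const_mul _
  have J2 : IntegrableOn (fun s : ℝ => 2 * x * y * ((kerWeight s)⁻¹ *
      (s * Real.exp (-(s ^ 2 / 4)) * g s) * s)) (Ioi 0) := Iag.const_mul _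
  have J3 : IntegrableOn (fun s : ℝ => y ^ 2 * ((kerWeight s)⁻¹ * (g s * g s) * s)) (Ioi 0) :=
    Igg.const_mul _
  have J12 : IntegrableOn (fun s : ℝ => x ^ 2 * ((kerWeight s)⁻¹ *
      (s * Real.exp (-(s ^ 2 / 4)) * (s * Real.exp (-(s ^ 2 / 4)))) * s) + 2 * x * y * ((kerWeight s)⁻¹ *
      (s * Real.exp (-(s ^ 2 / 4)) * g s) * s)) (Ioi 0) := J1.add J2
  refine ⟨J12.add J3, ?_⟩
  rw [integral_add J12 J3, integral_add J1 J2, MeasureTheory.integral_const_mul,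
    MeasureTheory.integral_const_mul, MeasureTheory.integral_const_mul, am1_Q_aStar, horth]
  ring

/-! ### Bessel's inequality for the representers of `A_·(r)` and `B_·(r)` -/

/-- **Bessel, core part.** For a Gaussian-class `g ⊥ a⋆` in `L²(Φ⁻¹ s ds)`, `r > 0` and every `y`:
`2y A_g(r) − y² Q(g) ≤ F(r) − A⋆(r)²/4` (`F(r) = ∫₀ʳ s³Φ = ‖Φ s 1_{(0,r]}‖²`, `A⋆ = 8 − 2(r²+4)e^{−r²/4}`,
`‖a⋆‖² = 4`): expand `0 ≤ ‖Φ s 1_{(0,r]} − (A⋆(r)/4) a⋆ − y g‖²`. [folklore]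
[cite: GallaySverak2021, §2 proof of Thm 2.5, the mode-one (n = ±1) constrained coercivity (source of the ARGUMENT implemented; this declaration is the cell’s own lemma, NOT a printed statement)] -/
theorem am1_bessel_A {g : ℝ → ℝ} (hg : Continuous g) {C : ℝ} {N : ℕ}
    (hb : ∀ r, 0 ≤ r → |g r| ≤ C * (1 + r) ^ N * Real.exp (-(r ^ 2 / 4)))
    (horth : ∫ s in Ioi (0 : ℝ), (kerWeight s)⁻¹ * (s * Real.exp (-(s ^ 2 / 4)) * g s) * s = 0)
    {r : ℝ} (hr : 0 < r) (y : ℝ) :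
    2 * y * (∫ s in (0 : ℝ)..r, s ^ 2 * g s) -
        y ^ 2 * (∫ s in Ioi (0 : ℝ), (kerWeight s)⁻¹ * (g s * g s) * s) ≤
      (∫ s in (0 : ℝ)..r, s ^ 3 * kerWeight s) - (8 - 2 * (r ^ 2 + 4) * Real.exp (-(r ^ 2 / 4))) ^ 2 / 4 := by
  set As : ℝ := 8 - 2 * (r ^ 2 + 4) * Real.exp (-(r ^ 2 / 4)) with hAs
  set x : ℝ := As / 4 with hx
  set w : ℝ → ℝ := fun s => x * (s * Real.exp (-(s ^ 2 / 4))) + y * g s with hw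
  set Qg : ℝ := ∫ s in Ioi (0 : ℝ), (kerWeight s)⁻¹ * (g s * g s) * s with hQg
  obtain ⟨hwi, hwv⟩ := am1_weight_sq_lin hg hb horth x y
  have haS : Continuous fun s : ℝ => s * Real.exp (-(s ^ 2 / 4)) := by fun_prop
  have hwc : Continuous w := by simp only [hw]; fun_prop
  have hΦi : Continuous fun s : ℝ => (kerWeight s)⁻¹ :=
    continuous_kerWeight.inv₀ fun s => (kerWeight_pos s).ne'
  -- piece `(0, r]`
  have hI1 : IntegrableOn (fun s : ℝ => s ^ 3 * kerWeight s) (Ioc 0 r) :=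
    (((continuous_pow 3).mul continuous_kerWeight).integrableOn_Icc (a := 0) (b := r)).mono_set
      Ioc_subset_Icc_self
  have hI2 : IntegrableOn (fun s : ℝ => s ^ 2 * w s) (Ioc 0 r) :=
    (((continuous_pow 2).mul hwc).integrableOn_Icc (a := 0) (b := r)).mono_set Ioc_subset_Icc_self
  have hI3 : IntegrableOn (fun s : ℝ => (kerWeight s)⁻¹ * (w s * w s) * s) (Ioc 0 r) :=
    hwi.mono_set Ioc_subset_Ioi_self
  have h1 : 0 ≤ ∫ s in Ioc 0 r, (kerWeight s)⁻¹ * ((kerWeight s * s - w s) * (kerWeight s * s - w s)) * s :=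
    setIntegral_nonneg measurableSet_Ioc fun s hs => mul_nonneg (mul_nonneg
      (inv_nonneg.2 (kerWeight_pos s).le) (mul_self_nonneg _)) hs.1.le
  have h1eq : (∫ s in Ioc 0 r, (kerWeight s)⁻¹ * ((kerWeight s * s - w s) * (kerWeight s * s - w s)) * s) =
      (∫ s in (0 : ℝ)..r, s ^ 3 * kerWeight s) - 2 * (x * As + y * ∫ s in (0 : ℝ)..r, s ^ 2 * g s) +
        ∫ s in Ioc 0 r, (kerWeight s)⁻¹ * (w s * w s) * s := by
    have hpt : EqOn (fun s : ℝ => (kerWeight s)⁻¹ * ((kerWeight s * s - w s) * (kerWeight s * s - w s)) * s)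
        (fun s : ℝ => s ^ 3 * kerWeight s - 2 * (s ^ 2 * w s) + (kerWeight s)⁻¹ * (w s * w s) * s) (Ioc 0 r) := by
      intro s _
      have hΦ : kerWeight s ≠ 0 := (kerWeight_pos s).ne'
      simp only
      field_simp
      ring
    have hI2' : IntegrableOn (fun s : ℝ => 2 * (s ^ 2 * w s)) (Ioc 0 r) := hI2.const_mul 2
    have hI12 : IntegrableOn (fun s : ℝ => s ^ 3 * kerWeight s - 2 * (s ^ 2 * w s)) (Ioc 0 r) := hI1.sub hI2'
    rw [setIntegral_congr_fun measurableSet_Ioc hpt, integral_add hI12 hI3, integral_sub hI1 hI2',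
      MeasureTheory.integral_const_mul, ← intervalIntegral.integral_of_le hr.le,
      ← intervalIntegral.integral_of_le hr.le]
    congr 2
    simp only [hw]
    have e1 : (∫ s in (0 : ℝ)..r, s ^ 2 * (x * (s * Real.exp (-(s ^ 2 / 4))) + y * g s)) =
        x * (∫ s in (0 : ℝ)..r, s ^ 2 * (s * Real.exp (-(s ^ 2 / 4)))) + y * ∫ s in (0 : ℝ)..r, s ^ 2 * g s := by
      rw [← intervalIntegral.integral_const_mul, ← intervalIntegral.integral_const_mul,
        ← intervalIntegral.integral_add]
      · refine intervalIntegral.integral_congr fun s _ => ?_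
        ring
      · exact ((((continuous_pow 2).mul haS)).const_mul x).intervalIntegrable _ _
      · exact (((continuous_pow 2).mul hg).const_mul y).intervalIntegrable _ _
    rw [e1, am1_integral_sq_mul_aStar r]
  -- piece `(r, ∞)`
  have h2 : 0 ≤ ∫ s in Ioi r, (kerWeight s)⁻¹ * (w s * w s) * s :=
    setIntegral_nonneg measurableSet_Ioi fun s hs => mul_nonneg (mul_nonneg
      (inv_nonneg.2 (kerWeight_pos s).le) (mul_self_nonneg _)) (hr.trans hs).le
  have hunion : (∫ s in Ioc 0 r, (kerWeight s)⁻¹ * (w s * w s) * s) +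
      (∫ s in Ioi r, (kerWeight s)⁻¹ * (w s * w s) * s) = 4 * x ^ 2 + y ^ 2 * Qg := by
    rw [← hwv, ← setIntegral_union (Ioc_disjoint_Ioi le_rfl) measurableSet_Ioi hI3
      (hwi.mono_set (Ioi_subset_Ioi hr.le)), Ioc_union_Ioi_eq_Ioi hr.le]
  have hxv : 4 * x ^ 2 - 2 * (x * As) = -(As ^ 2 / 4) := by rw [hx]; ring
  linarith

/-- **Bessel, tail part.** For a Gaussian-class `g ⊥ a⋆`, `r > 0` and every `y`:
`2y B_g(r) − y² Q(g) ≤ G(r) − e^{−r²/2}` (`G(r) = ∫ᵣ^∞ Φ/s = ‖Φ s⁻¹ 1_{(r,∞)}‖²`,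
`B⋆(r)²/4 = e^{−r²/2}`): expand `0 ≤ ‖Φ s⁻¹ 1_{(r,∞)} − (B⋆(r)/4) a⋆ − y g‖²`. [folklore]
[cite: GallaySverak2021, §2 proof of Thm 2.5, the mode-one (n = ±1) constrained coercivity (source of the ARGUMENT implemented; this declaration is the cell’s own lemma, NOT a printed statement)] -/
theorem am1_bessel_B {g : ℝ → ℝ} (hg : Continuous g) {C : ℝ} {N : ℕ}
    (hb : ∀ r, 0 ≤ r → |g r| ≤ C * (1 + r) ^ N * Real.exp (-(r ^ 2 / 4)))
    (horth : ∫ s in Ioi (0 : ℝ), (kerWeight s)⁻¹ * (s * Real.exp (-(s ^ 2 / 4)) * g s) * s = 0)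
    {r : ℝ} (hr : 0 < r) (y : ℝ) :
    2 * y * (∫ s in Ioi r, g s) - y ^ 2 * (∫ s in Ioi (0 : ℝ), (kerWeight s)⁻¹ * (g s * g s) * s) ≤
      (∫ s in Ioi r, kerWeight s / s) - Real.exp (-(r ^ 2 / 4)) ^ 2 := by
  set Er : ℝ := Real.exp (-(r ^ 2 / 4)) with hEr
  set x : ℝ := Er / 2 with hx
  set w : ℝ → ℝ := fun s => x * (s * Real.exp (-(s ^ 2 / 4))) + y * g s with hw
  set Qg : ℝ := ∫ s in Ioi (0 : ℝ), (kerWeight s)⁻¹ * (g s * g s) * s with hQg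
  obtain ⟨hwi, hwv⟩ := am1_weight_sq_lin hg hb horth x y
  have haS : Continuous fun s : ℝ => s * Real.exp (-(s ^ 2 / 4)) := by fun_prop
  have hgi : IntegrableOn g (Ioi 0) :=
    (am1_integrableOn_pow_mul hg hb 0).congr_fun (fun r _ => by simp) measurableSet_Ioi
  have hai : IntegrableOn (fun s : ℝ => s * Real.exp (-(s ^ 2 / 4))) (Ioi 0) :=
    (am1_integrableOn_pow_mul haS am1_gc_aStar 0).congr_fun (fun r _ => by simp) measurableSet_Ioi
  -- piece `(r, ∞)`
  have hI1 : IntegrableOn (fun s : ℝ => kerWeight s / s) (Ioi r) := (am1_G_bounds hr).1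
  have hax : IntegrableOn (fun s : ℝ => x * (s * Real.exp (-(s ^ 2 / 4)))) (Ioi r) :=
    (hai.mono_set (Ioi_subset_Ioi hr.le)).const_mul x
  have hgy : IntegrableOn (fun s : ℝ => y * g s) (Ioi r) := (hgi.mono_set (Ioi_subset_Ioi hr.le)).const_mul y
  have hI2 : IntegrableOn w (Ioi r) := hax.add hgy
  have hI3 : IntegrableOn (fun s : ℝ => (kerWeight s)⁻¹ * (w s * w s) * s) (Ioi r) :=
    hwi.mono_set (Ioi_subset_Ioi hr.le)
  have h1 : 0 ≤ ∫ s in Ioi r, (kerWeight s)⁻¹ * ((kerWeight s / s - w s) * (kerWeight s / s - w s)) * s :=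
    setIntegral_nonneg measurableSet_Ioi fun s hs => mul_nonneg (mul_nonneg
      (inv_nonneg.2 (kerWeight_pos s).le) (mul_self_nonneg _)) (hr.trans hs).le
  have h1eq : (∫ s in Ioi r, (kerWeight s)⁻¹ * ((kerWeight s / s - w s) * (kerWeight s / s - w s)) * s) =
      (∫ s in Ioi r, kerWeight s / s) - 2 * (x * (2 * Er) + y * ∫ s in Ioi r, g s) +
        ∫ s in Ioi r, (kerWeight s)⁻¹ * (w s * w s) * s := by
    have hpt : EqOn (fun s : ℝ => (kerWeight s)⁻¹ * ((kerWeight s / s - w s) * (kerWeight s / s - w s)) * s)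
        (fun s : ℝ => kerWeight s / s - 2 * w s + (kerWeight s)⁻¹ * (w s * w s) * s) (Ioi r) := by
      intro s hs
      have hΦ : kerWeight s ≠ 0 := (kerWeight_pos s).ne'
      have hs0 : s ≠ 0 := ne_of_gt (hr.trans hs)
      simp only
      field_simp
      ring
    have hI2' : IntegrableOn (fun s : ℝ => 2 * w s) (Ioi r) := hI2.const_mul 2
    have hI12 : IntegrableOn (fun s : ℝ => kerWeight s / s - 2 * w s) (Ioi r) := hI1.sub hI2'
    rw [setIntegral_congr_fun measurableSet_Ioi hpt, integral_add hI12 hI3, integral_sub hI1 hI2',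
      MeasureTheory.integral_const_mul]
    congr 2
    simp only [hw]
    rw [integral_add hax hgy, MeasureTheory.integral_const_mul, MeasureTheory.integral_const_mul,
      am1_integral_Ioi_aStar hr.le]
  -- piece `(0, r]`
  have h2 : 0 ≤ ∫ s in Ioc 0 r, (kerWeight s)⁻¹ * (w s * w s) * s :=
    setIntegral_nonneg measurableSet_Ioc fun s hs => mul_nonneg (mul_nonneg
      (inv_nonneg.2 (kerWeight_pos s).le) (mul_self_nonneg _)) hs.1.le
  have hunion : (∫ s in Ioc 0 r, (kerWeight s)⁻¹ * (w s * w s) * s) +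
      (∫ s in Ioi r, (kerWeight s)⁻¹ * (w s * w s) * s) = 4 * x ^ 2 + y ^ 2 * Qg := by
    rw [← hwv, ← setIntegral_union (Ioc_disjoint_Ioi le_rfl) measurableSet_Ioi
      (hwi.mono_set Ioc_subset_Ioi_self) hI3, Ioc_union_Ioi_eq_Ioi hr.le]
  have hxv : 4 * x ^ 2 - 2 * (x * (2 * Er)) = -Er ^ 2 := by rw [hx]; ring
  linarith

/-! ### The deflation bound -/

/-- **Deflation bound (second eigenvalue of the `k = 1` mode operator).** For a continuous
Gaussian-class `g` orthogonal to the neutral mode `a⋆` in `L²(Φ⁻¹ s ds)`,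
`P(g) = ½∫₀^∞ (A_g²/r³ + r B_g²) dr ≤ (2/3) ∫₀^∞ Φ⁻¹ g² s ds`: Bessel pointwise in `r`
(`A_g² ≤ Q(F − A⋆²/4)`, `B_g² ≤ Q(G − B⋆²/4)`), integrated with the trace identities
(`∫F/r³ = ∫rG = ½∫rΦ`), the energy `4` of `a⋆`, and `∫ rΦ ≤ 10/3`:
`P(g) ≤ ½ Q (∫rΦ − 2) ≤ (2/3) Q` (`λ₂(B̃₁) ≤ tr B̃₁ − 1 = π²/6 − 1`). [folklore]
[cite: GallaySverak2021, §2 proof of Thm 2.5, the mode-one (n = ±1) constrained coercivity (source of the ARGUMENT implemented; this declaration is the cell’s own lemma, NOT a printed statement)] -/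
theorem am1_deflation {g : ℝ → ℝ} (hg : Continuous g) {C : ℝ} {N : ℕ}
    (hb : ∀ r, 0 ≤ r → |g r| ≤ C * (1 + r) ^ N * Real.exp (-(r ^ 2 / 4)))
    (horth : ∫ s in Ioi (0 : ℝ), (kerWeight s)⁻¹ * (s * Real.exp (-(s ^ 2 / 4)) * g s) * s = 0) :
    (1 / 2) * ∫ r in Ioi (0 : ℝ), ((∫ s in (0 : ℝ)..r, s ^ 2 * g s) ^ 2 / r ^ 3 + r * (∫ s in Ioi r, g s) ^ 2) ≤
      (2 / 3) * ∫ s in Ioi (0 : ℝ), (kerWeight s)⁻¹ * (g s * g s) * s := by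
  set Q : ℝ := ∫ s in Ioi (0 : ℝ), (kerWeight s)⁻¹ * (g s * g s) * s with hQ
  set F : ℝ → ℝ := fun r => ∫ s in (0 : ℝ)..r, s ^ 3 * kerWeight s with hF
  set G : ℝ → ℝ := fun r => ∫ s in Ioi r, kerWeight s / s with hG
  set E : ℝ → ℝ := fun r => Real.exp (-(r ^ 2 / 4)) with hE
  set As : ℝ → ℝ := fun r => 8 - 2 * (r ^ 2 + 4) * E r with hAs
  have hQ0 : 0 ≤ Q := setIntegral_nonneg measurableSet_Ioi fun s hs =>
    mul_nonneg (mul_nonneg (inv_nonneg.2 (kerWeight_pos s).le) (mul_self_nonneg _)) (le_of_lt hs)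
  -- pointwise Bessel consequences
  have hA2 : ∀ r, 0 < r → (∫ s in (0 : ℝ)..r, s ^ 2 * g s) ^ 2 ≤ Q * (F r - As r ^ 2 / 4) := fun r hr =>
    am1_sq_le_of_forall hQ0 fun y => am1_bessel_A hg hb horth hr y
  have hB2 : ∀ r, 0 < r → (∫ s in Ioi r, g s) ^ 2 ≤ Q * (G r - E r ^ 2) := fun r hr =>
    am1_sq_le_of_forall hQ0 fun y => am1_bessel_B hg hb horth hr y
  -- integrability
  have he := (am1_integrableOn_A_sq_div hg hb).add (am1_integrableOn_mul_B_sq hg hb)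
  obtain ⟨hFi, hFv⟩ := am1_integral_F_div_cube
  obtain ⟨hGi, hGv⟩ := am1_integral_mul_G
  obtain ⟨hSi, hSv⟩ := am1_energy_aStar
  have hm : IntegrableOn (fun r : ℝ => Q * ((F r / r ^ 3 + r * G r) -
      (1 / 4) * (As r ^ 2 / r ^ 3 + r * (2 * E r) ^ 2))) (Ioi 0) :=
    ((hFi.add hGi).sub (hSi.const_mul (1 / 4))).const_mul Q
  have hle : (∫ r in Ioi (0 : ℝ), ((∫ s in (0 : ℝ)..r, s ^ 2 * g s) ^ 2 / r ^ 3 + r * (∫ s in Ioi r, g s) ^ 2)) ≤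
      ∫ r in Ioi (0 : ℝ), Q * ((F r / r ^ 3 + r * G r) - (1 / 4) * (As r ^ 2 / r ^ 3 + r * (2 * E r) ^ 2)) := by
    refine setIntegral_mono_on he hm measurableSet_Ioi fun r hr => ?_
    have hr0 : 0 < r := hr
    have hr3 : 0 < r ^ 3 := pow_pos hr0 3
    have h1 : (∫ s in (0 : ℝ)..r, s ^ 2 * g s) ^ 2 / r ^ 3 ≤ Q * (F r - As r ^ 2 / 4) / r ^ 3 :=
      div_le_div_of_nonneg_right (hA2 r hr0) hr3.le
    have h2 : r * (∫ s in Ioi r, g s) ^ 2 ≤ r * (Q * (G r - E r ^ 2)) :=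
      mul_le_mul_of_nonneg_left (hB2 r hr0) hr0.le
    have h3 : Q * (F r - As r ^ 2 / 4) / r ^ 3 + r * (Q * (G r - E r ^ 2)) =
        Q * ((F r / r ^ 3 + r * G r) - (1 / 4) * (As r ^ 2 / r ^ 3 + r * (2 * E r) ^ 2)) := by
      field_simp
      ring
    linarith
  have hval : (∫ r in Ioi (0 : ℝ), Q * ((F r / r ^ 3 + r * G r) - (1 / 4) * (As r ^ 2 / r ^ 3 + r * (2 * E r) ^ 2))) =
      Q * ((∫ r in Ioi (0 : ℝ), r * kerWeight r) - 2) := by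
    have hS4 : IntegrableOn (fun r : ℝ => (1 / 4) * (As r ^ 2 / r ^ 3 + r * (2 * E r) ^ 2)) (Ioi 0) :=
      hSi.const_mul (1 / 4)
    have hFG : IntegrableOn (fun r : ℝ => F r / r ^ 3 + r * G r) (Ioi 0) := hFi.add hGi
    have hS : (∫ r in Ioi (0 : ℝ), (As r ^ 2 / r ^ 3 + r * (2 * E r) ^ 2)) = 8 := by
      simp only [hAs, hE]
      linarith [hSv]
    rw [MeasureTheory.integral_const_mul, integral_sub hFG hS4, integral_add hFi hGi,
      MeasureTheory.integral_const_mul, hFv, hGv, hS]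
    ring
  have hΦ := am1_integral_mul_kerWeight_le
  rw [hval] at hle
  nlinarith [hle, hQ0, hΦ]

/-! ### The registered tools stub -/

end Literature.Analysis.GaussianVortexArnold

end Part9

/-!
## Part 10 — port of `Summits/NavierStokesRegularity/NavierStokesRegularity/Theorems/FilamentSkeletonRssCoreLinearInvertibilityArnoldModeOne1D.lean` (2 declarations kept)

# Stub `stub_arnoldModeOne1D` (crux `CoreLinearInvertibility`, stmt-NavierStokesRegularity-17973,
# route `FilamentSkeletonRss`, line `Sketch`): the `k = ±1` constrained Arnold coercivity at the Gaussian

For the radial coefficient `a` (continuous on `[0,∞)`, Gaussian class) of the `k = ±1` angular part of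
an odd vorticity, with the first-moment constraint `∫₀^∞ r² a dr = 0`,

  `γ ∫ Φ⁻¹ a² r ≤ ∫ Φ⁻¹ a² r − ∫ (B₁a) a r`,  `(B₁a)(r) = ½∫₀^∞ min(r/s, s/r) a(s) s ds`, `γ = 1/9`,

(`Φ = kerWeight`; Gallay–Šverák, arXiv:2110.13739, §2, the case `k = 1` of Thm. 2.5 / Rem. 2.7 at the
Gaussian). PROOF (elementary, no spectral theory): write `a = g + (α/2) a⋆` with the neutral mode
`a⋆ = r e^{−r²/4}` (`B₁a⋆ = Φ⁻¹a⋆`, `‖a⋆‖² = 4` in `L²(Φ⁻¹ r dr)`) and `g ⊥ a⋆`; then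
`∫Φ⁻¹a²r = Q(g) + α²` and, by the energy identity (part B), the cross identity and the energy of `a⋆`
(part C), `∫(B₁a) a r = P(g) + α²`; the deflation bound (part D, a trace argument:
`λ₂ ≤ tr B̃₁ − 1 ≤ 2/3`) gives `P(g) ≤ (2/3)Q(g)`; the constraint and Cauchy–Schwarz give
`16α² = (∫r²g)² ≤ (∫r³Φ) Q(g) ≤ 32 Q(g)`; hence `Q(a) − P(a) ≥ Q(g)/3 ≥ Q(a)/9`.
-/

section Part10

namespace Literature.Analysis.GaussianVortexArnold

open _root_.Set _root_.Function _root_.Filter _root_.MeasureTheory _root_.Topology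
open Literature.Analysis.FluidPDE

/-- **The `k = 1` constrained coercivity for continuous Gaussian-class `f` with `∫ r² f = 0`**:
`(1/9) ∫Φ⁻¹f²r ≤ ∫Φ⁻¹f²r − ∫(B₁f) f r`. [cite: GallaySverak2021, Thm. 2.5 proof] -/
theorem am1_coercive_continuous {f : ℝ → ℝ} (hf : Continuous f) {C : ℝ} {N : ℕ}
    (hb : ∀ r, 0 ≤ r → |f r| ≤ C * (1 + r) ^ N * Real.exp (-(r ^ 2 / 4)))
    (hm : ∫ r in Ioi (0 : ℝ), r ^ 2 * f r = 0) :
    (1 / 9) * ∫ r in Ioi (0 : ℝ), (kerWeight r)⁻¹ * f r ^ 2 * r ≤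
      (∫ r in Ioi (0 : ℝ), (kerWeight r)⁻¹ * f r ^ 2 * r) -
        ∫ r in Ioi (0 : ℝ), ((1 / 2 : ℝ) * ∫ s in Ioi (0 : ℝ), min (r / s) (s / r) * f s * s) * f r * r := by
  set E : ℝ → ℝ := fun r => Real.exp (-(r ^ 2 / 4)) with hE
  set aS : ℝ → ℝ := fun s => s * E s with haS
  set As : ℝ → ℝ := fun r => 8 - 2 * (r ^ 2 + 4) * E r with hAs
  have haSc : Continuous aS := by simp only [haS, hE]; fun_prop
  have hba : ∀ r : ℝ, 0 ≤ r → |aS r| ≤ 1 * (1 + r) ^ 1 * Real.exp (-(r ^ 2 / 4)) := am1_gc_aStar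
  -- the decomposition `f = g + β a⋆`, `β = α/2`, `α = ½⟨a⋆, f⟩`
  set α : ℝ := (1 / 2) * ∫ s in Ioi (0 : ℝ), (kerWeight s)⁻¹ * (aS s * f s) * s with hα
  set β : ℝ := α / 2 with hβ
  set g : ℝ → ℝ := fun s => f s - β * aS s with hg
  have hgc : Continuous g := by simp only [hg]; fun_prop
  have hbg : ∀ r, 0 ≤ r → |g r| ≤ (|(1 : ℝ)| * |C| + |(-β)| * |(1 : ℝ)|) * (1 + r) ^ (max N 1) *
      Real.exp (-(r ^ 2 / 4)) := by
    intro r hr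
    have h := am1_gc_lin hb hba 1 (-β) r hr
    have e : g r = 1 * f r + -β * aS r := by simp only [hg]; ring
    rw [e]; exact h
  -- weighted integrability
  have Iaf := am1_integrableOn_weight_mul_mul haSc hf hba hb
  have Iaa := am1_integrableOn_weight_mul_mul haSc haSc hba hba
  have Iag := am1_integrableOn_weight_mul_mul haSc hgc hba hbg
  have Igg := am1_integrableOn_weight_mul_mul hgc hgc hbg hbg
  have hQa : (∫ s in Ioi (0 : ℝ), (kerWeight s)⁻¹ * (aS s * aS s) * s) = 4 := am1_Q_aStar
  -- orthogonality `⟨a⋆, g⟩ = 0`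
  have horth : (∫ s in Ioi (0 : ℝ), (kerWeight s)⁻¹ * (s * Real.exp (-(s ^ 2 / 4)) * g s) * s) = 0 := by
    have e : (fun s : ℝ => (kerWeight s)⁻¹ * (s * Real.exp (-(s ^ 2 / 4)) * g s) * s) = fun s : ℝ =>
        (kerWeight s)⁻¹ * (aS s * f s) * s - β * ((kerWeight s)⁻¹ * (aS s * aS s) * s) := by
      funext s; simp only [hg, haS, hE]; ring
    have Iaa' : IntegrableOn (fun s : ℝ => β * ((kerWeight s)⁻¹ * (aS s * aS s) * s)) (Ioi 0) := Iaa.const_mul β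
    rw [e, integral_sub Iaf Iaa', MeasureTheory.integral_const_mul, hQa, hβ, hα]
    ring
  set Qg : ℝ := ∫ s in Ioi (0 : ℝ), (kerWeight s)⁻¹ * (g s * g s) * s with hQg
  have hQg0 : 0 ≤ Qg := setIntegral_nonneg measurableSet_Ioi fun s hs =>
    mul_nonneg (mul_nonneg (inv_nonneg.2 (kerWeight_pos s).le) (mul_self_nonneg _)) (le_of_lt hs)
  -- `Q(f) = Q(g) + α²`
  have hQf : (∫ r in Ioi (0 : ℝ), (kerWeight r)⁻¹ * f r ^ 2 * r) = Qg + α ^ 2 := by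
    have e : (fun r : ℝ => (kerWeight r)⁻¹ * f r ^ 2 * r) = fun r : ℝ =>
        (kerWeight r)⁻¹ * (g r * g r) * r + 2 * β * ((kerWeight r)⁻¹ * (aS r * g r) * r) +
          β ^ 2 * ((kerWeight r)⁻¹ * (aS r * aS r) * r) := by
      funext r; simp only [hg]; ring
    have J2 : IntegrableOn (fun r : ℝ => 2 * β * ((kerWeight r)⁻¹ * (aS r * g r) * r)) (Ioi 0) := Iag.const_mul _
    have J3 : IntegrableOn (fun r : ℝ => β ^ 2 * ((kerWeight r)⁻¹ * (aS r * aS r) * r)) (Ioi 0) :=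
      Iaa.const_mul _
    have J12 : IntegrableOn (fun r : ℝ => (kerWeight r)⁻¹ * (g r * g r) * r +
        2 * β * ((kerWeight r)⁻¹ * (aS r * g r) * r)) (Ioi 0) := Igg.add J2
    have horth' : (∫ r in Ioi (0 : ℝ), (kerWeight r)⁻¹ * (aS r * g r) * r) = 0 := horth
    rw [e, integral_add J12 J3, integral_add Igg J2, MeasureTheory.integral_const_mul,
      MeasureTheory.integral_const_mul, horth', hQa, hβ]
    ring
  -- `P(f) = P(g) + α²`
  have hPf : (∫ r in Ioi (0 : ℝ), ((1 / 2 : ℝ) * ∫ s in Ioi (0 : ℝ), min (r / s) (s / r) * f s * s) * f r * r) =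
      (1 / 2) * (∫ r in Ioi (0 : ℝ), ((∫ s in (0 : ℝ)..r, s ^ 2 * g s) ^ 2 / r ^ 3 +
        r * (∫ s in Ioi r, g s) ^ 2)) + α ^ 2 := by
    rw [am1_energy_identity hf hb]
    have hgi : IntegrableOn g (Ioi 0) :=
      (am1_integrableOn_pow_mul hgc hbg 0).congr_fun (fun r _ => by simp) measurableSet_Ioi
    have hai : IntegrableOn aS (Ioi 0) :=
      (am1_integrableOn_pow_mul haSc hba 0).congr_fun (fun r _ => by simp) measurableSet_Ioi
    -- the functionals of `f` against those of `g` and `a⋆`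
    have hAf : ∀ r : ℝ, (∫ s in (0 : ℝ)..r, s ^ 2 * f s) = (∫ s in (0 : ℝ)..r, s ^ 2 * g s) + β * As r := by
      intro r
      have hAsr : As r = 8 - 2 * (r ^ 2 + 4) * Real.exp (-(r ^ 2 / 4)) := by simp only [hAs, hE]
      have i1 : IntervalIntegrable (fun s : ℝ => s ^ 2 * g s) volume 0 r :=
        ((continuous_pow 2).mul hgc).intervalIntegrable _ _
      have i2 : IntervalIntegrable (fun s : ℝ => β * (s ^ 2 * (s * Real.exp (-(s ^ 2 / 4))))) volume 0 r :=
        (Continuous.intervalIntegrable (by fun_prop) _ _)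
      rw [hAsr, ← am1_integral_sq_mul_aStar r, ← intervalIntegral.integral_const_mul,
        ← intervalIntegral.integral_add i1 i2]
      refine intervalIntegral.integral_congr fun s _ => ?_
      simp only [hg, haS, hE]; ring
    have hBf : ∀ r : ℝ, 0 ≤ r → (∫ s in Ioi r, f s) = (∫ s in Ioi r, g s) + β * (2 * E r) := by
      intro r hr
      rw [← am1_integral_Ioi_aStar hr, ← MeasureTheory.integral_const_mul,
        ← integral_add (hgi.mono_set (Ioi_subset_Ioi hr)) ((hai.mono_set (Ioi_subset_Ioi hr)).const_mul β)]
      refine setIntegral_congr_fun measurableSet_Ioi fun s _ => ?_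
      simp only [hg, haS, hE]; ring
    have heg : IntegrableOn (fun r : ℝ => (∫ s in (0 : ℝ)..r, s ^ 2 * g s) ^ 2 / r ^ 3 +
        r * (∫ s in Ioi r, g s) ^ 2) (Ioi 0) :=
      (am1_integrableOn_A_sq_div hgc hbg).add (am1_integrableOn_mul_B_sq hgc hbg)
    obtain ⟨hxi, hxv⟩ := am1_cross_identity hgc hbg
    obtain ⟨hSi, hSv⟩ := am1_energy_aStar
    have hpt : EqOn (fun r : ℝ => (∫ s in (0 : ℝ)..r, s ^ 2 * f s) ^ 2 / r ^ 3 + r * (∫ s in Ioi r, f s) ^ 2)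
        (fun r : ℝ => ((∫ s in (0 : ℝ)..r, s ^ 2 * g s) ^ 2 / r ^ 3 + r * (∫ s in Ioi r, g s) ^ 2) +
          2 * β * ((∫ s in (0 : ℝ)..r, s ^ 2 * g s) * (8 - 2 * (r ^ 2 + 4) * Real.exp (-(r ^ 2 / 4))) / r ^ 3 +
            r * ((∫ s in Ioi r, g s) * (2 * Real.exp (-(r ^ 2 / 4))))) +
          β ^ 2 * ((8 - 2 * (r ^ 2 + 4) * Real.exp (-(r ^ 2 / 4))) ^ 2 / r ^ 3 +
            r * (2 * Real.exp (-(r ^ 2 / 4))) ^ 2)) (Ioi 0) := by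
      intro r hr
      simp only
      rw [hAf r, hBf r (le_of_lt hr)]
      simp only [hAs, hE]
      ring
    have J2 : IntegrableOn (fun r : ℝ => 2 * β * ((∫ s in (0 : ℝ)..r, s ^ 2 * g s) *
        (8 - 2 * (r ^ 2 + 4) * Real.exp (-(r ^ 2 / 4))) / r ^ 3 +
        r * ((∫ s in Ioi r, g s) * (2 * Real.exp (-(r ^ 2 / 4)))))) (Ioi 0) := hxi.const_mul (2 * β)
    have J3 : IntegrableOn (fun r : ℝ => β ^ 2 * ((8 - 2 * (r ^ 2 + 4) * Real.exp (-(r ^ 2 / 4))) ^ 2 / r ^ 3 +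
        r * (2 * Real.exp (-(r ^ 2 / 4))) ^ 2)) (Ioi 0) := hSi.const_mul (β ^ 2)
    have J12 : IntegrableOn (fun r : ℝ => ((∫ s in (0 : ℝ)..r, s ^ 2 * g s) ^ 2 / r ^ 3 +
        r * (∫ s in Ioi r, g s) ^ 2) + 2 * β * ((∫ s in (0 : ℝ)..r, s ^ 2 * g s) *
        (8 - 2 * (r ^ 2 + 4) * Real.exp (-(r ^ 2 / 4))) / r ^ 3 +
        r * ((∫ s in Ioi r, g s) * (2 * Real.exp (-(r ^ 2 / 4)))))) (Ioi 0) := heg.add J2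
    have hx0 : (∫ r in Ioi (0 : ℝ), ((∫ s in (0 : ℝ)..r, s ^ 2 * g s) * (8 - 2 * (r ^ 2 + 4) * Real.exp (-(r ^ 2 / 4))) / r ^ 3 +
        r * ((∫ s in Ioi r, g s) * (2 * Real.exp (-(r ^ 2 / 4)))))) = 0 := by
      rw [← am1_weight_aStar_mul g, horth] at hxv
      linarith
    have hS8 : (∫ r in Ioi (0 : ℝ), ((8 - 2 * (r ^ 2 + 4) * Real.exp (-(r ^ 2 / 4))) ^ 2 / r ^ 3 +
        r * (2 * Real.exp (-(r ^ 2 / 4))) ^ 2)) = 8 := by linarith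
    rw [setIntegral_congr_fun measurableSet_Ioi hpt, integral_add J12 J3, integral_add heg J2,
      MeasureTheory.integral_const_mul, MeasureTheory.integral_const_mul, hx0, hS8, hβ]
    ring
  -- the constraint: `∫ r² g = −4α`
  have hmg : (∫ r in Ioi (0 : ℝ), r ^ 2 * g r) = -4 * α := by
    obtain ⟨h8v, h8i⟩ := am1_integral_Ioi_pow_three_mul_exp (c := 4) (by norm_num)
    have I2f := am1_integrableOn_pow_mul hf hb 2
    have I3 : IntegrableOn (fun r : ℝ => β * (r ^ 3 * Real.exp (-(r ^ 2 / 4)))) (Ioi 0) := h8i.const_mul β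
    have e : (fun r : ℝ => r ^ 2 * g r) = fun r : ℝ => r ^ 2 * f r - β * (r ^ 3 * Real.exp (-(r ^ 2 / 4))) := by
      funext r; simp only [hg, haS, hE]; ring
    rw [e, integral_sub I2f I3, MeasureTheory.integral_const_mul, hm, h8v, hβ]
    ring
  -- Cauchy–Schwarz through the discriminant: `(∫ r² g)² ≤ (∫ r³Φ) Q(g) ≤ 32 Q(g)`
  obtain ⟨h32, hI3i⟩ := am1_integral_pow_three_mul_kerWeight_le
  have hI30 : 0 ≤ ∫ r in Ioi (0 : ℝ), r ^ 3 * kerWeight r :=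
    setIntegral_nonneg measurableSet_Ioi fun r hr => mul_nonneg (pow_nonneg (le_of_lt hr) 3) (kerWeight_pos r).le
  have hdisc : ∀ y : ℝ, 2 * y * (∫ r in Ioi (0 : ℝ), r ^ 2 * g r) - y ^ 2 * (∫ r in Ioi (0 : ℝ), r ^ 3 * kerWeight r) ≤ Qg := by
    intro y
    have I2g := am1_integrableOn_pow_mul hgc hbg 2
    have h0 : 0 ≤ ∫ r in Ioi (0 : ℝ), (kerWeight r)⁻¹ * ((y * (kerWeight r * r) - g r) *
        (y * (kerWeight r * r) - g r)) * r :=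
      setIntegral_nonneg measurableSet_Ioi fun r hr => mul_nonneg (mul_nonneg
        (inv_nonneg.2 (kerWeight_pos r).le) (mul_self_nonneg _)) (le_of_lt hr)
    have e : (fun r : ℝ => (kerWeight r)⁻¹ * ((y * (kerWeight r * r) - g r) * (y * (kerWeight r * r) - g r)) * r) =
        fun r : ℝ => y ^ 2 * (r ^ 3 * kerWeight r) - 2 * y * (r ^ 2 * g r) + (kerWeight r)⁻¹ * (g r * g r) * r := by
      funext r
      have hΦ : kerWeight r ≠ 0 := (kerWeight_pos r).ne'
      field_simp
      ring
    have J1 : IntegrableOn (fun r : ℝ => y ^ 2 * (r ^ 3 * kerWeight r)) (Ioi 0) := hI3i.const_mul _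
    have J2 : IntegrableOn (fun r : ℝ => 2 * y * (r ^ 2 * g r)) (Ioi 0) := I2g.const_mul _
    have J12 : IntegrableOn (fun r : ℝ => y ^ 2 * (r ^ 3 * kerWeight r) - 2 * y * (r ^ 2 * g r)) (Ioi 0) := J1.sub J2
    rw [e, integral_add J12 Igg, integral_sub J1 J2, MeasureTheory.integral_const_mul,
      MeasureTheory.integral_const_mul] at h0
    linarith
  have hCS := am1_sq_le_of_forall hI30 hdisc
  have hα2 : α ^ 2 ≤ 2 * Qg := by
    rw [hmg] at hCS
    nlinarith [hCS, h32, hQg0]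
  -- deflation and conclusion
  have hdef := am1_deflation hgc hbg horth
  rw [hQf, hPf]
  nlinarith [hdef, hα2, hQg0]

/-- **Registered stub `stub_arnoldModeOne1D`** (line `Sketch` of crux `CoreLinearInvertibility`,
stmt-NavierStokesRegularity-17973): the one-dimensional constrained Arnold coercivity in the angular
mode `k = ±1` at the Gaussian — for the radial coefficient `a` (continuous on `[0,∞)`, Gaussian class)
with the first-moment constraint `∫ r² a = 0`, `γ ∫ A a² r ≤ ∫ A a² r − ∫ (B₁a) a r` with
`A = Φ⁻¹ = (kerWeight)⁻¹`, `(B₁a)(r) = ½ ∫₀^∞ min(r/s, s/r) a(s) s ds`; here `γ = 1/9`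
(reduction to a continuous extension `a(max(r,0))`, then `am1_coercive_continuous`).
[cite: GallaySverak2021, Thm. 2.5 proof] -/
theorem stub_arnoldModeOne1D :
    ∃ γ : ℝ, 0 < γ ∧ ∀ a : ℝ → ℝ, ContinuousOn a (Set.Ici 0) →
    (∃ (C : ℝ) (N : ℕ), ∀ r : ℝ, 0 ≤ r → |a r| ≤ C * (1 + r) ^ N * Real.exp (-(r ^ 2 / 4))) →
    ∫ r in Set.Ioi (0 : ℝ), r ^ 2 * a r = 0 →
    γ * ∫ r in Set.Ioi (0 : ℝ), (kerWeight r)⁻¹ * a r ^ 2 * r ≤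
      (∫ r in Set.Ioi (0 : ℝ), (kerWeight r)⁻¹ * a r ^ 2 * r) -
        ∫ r in Set.Ioi (0 : ℝ),
          ((1 / 2 : ℝ) * ∫ s in Set.Ioi (0 : ℝ), min (r / s) (s / r) * a s * s) * a r * r := by
  refine ⟨1 / 9, by norm_num, fun a ha hgc hm => ?_⟩
  obtain ⟨C, N, hb⟩ := hgc
  -- continuous extension `f = a ∘ max(·, 0)`
  set f : ℝ → ℝ := fun r => a (max r 0) with hf
  have hfc : Continuous f :=
    ha.comp_continuous (continuous_id.max continuous_const) fun r => mem_Ici.2 (le_max_right _ _)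
  have hfa : ∀ r : ℝ, 0 ≤ r → f r = a r := fun r hr => by simp only [hf, max_eq_left hr]
  have hbf : ∀ r : ℝ, 0 ≤ r → |f r| ≤ C * (1 + r) ^ N * Real.exp (-(r ^ 2 / 4)) := fun r hr => by
    rw [hfa r hr]; exact hb r hr
  have hQ : (∫ r in Ioi (0 : ℝ), (kerWeight r)⁻¹ * a r ^ 2 * r) = ∫ r in Ioi (0 : ℝ), (kerWeight r)⁻¹ * f r ^ 2 * r :=
    setIntegral_congr_fun measurableSet_Ioi fun r hr => by rw [hfa r (le_of_lt hr)]
  have hin : ∀ r : ℝ, (∫ s in Ioi (0 : ℝ), min (r / s) (s / r) * a s * s) =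
      ∫ s in Ioi (0 : ℝ), min (r / s) (s / r) * f s * s := fun r =>
    setIntegral_congr_fun measurableSet_Ioi fun s hs => by rw [hfa s (le_of_lt hs)]
  have hP : (∫ r in Ioi (0 : ℝ), ((1 / 2 : ℝ) * ∫ s in Ioi (0 : ℝ), min (r / s) (s / r) * a s * s) * a r * r) =
      ∫ r in Ioi (0 : ℝ), ((1 / 2 : ℝ) * ∫ s in Ioi (0 : ℝ), min (r / s) (s / r) * f s * s) * f r * r :=
    setIntegral_congr_fun measurableSet_Ioi fun r hr => by rw [hin r, hfa r (le_of_lt hr)]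
  have hmf : (∫ r in Ioi (0 : ℝ), r ^ 2 * f r) = 0 := by
    calc (∫ r in Ioi (0 : ℝ), r ^ 2 * f r) = ∫ r in Ioi (0 : ℝ), r ^ 2 * a r :=
          setIntegral_congr_fun measurableSet_Ioi fun r hr => by rw [hfa r (le_of_lt hr)]
      _ = 0 := hm
  rw [hQ, hP]
  exact am1_coercive_continuous hfc hbf hmf

end Literature.Analysis.GaussianVortexArnold

end Part10

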